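import Literature.Computability.MetaComplexity.RefuterLocalConsistency
import Literature.Computability.MetaComplexity.RefuterParams
import Literature.Computability.MetaComplexity.ConstructiveSeparations
import Literature.Computability.Complexity.PairPlumbing
import HarnessLib
import Literature.Computability.Complexity.KannanLanguage
import Literature.Computability.Complexity.SigmaPRelClosure
import Literature.Computability.Complexity.AdaptiveFunctions
import Literature.Computability.Complexity.StackBricksStrings
import Literature.Computability.Complexity.AdaptiveBPPSimulation
import Literature.Computability.Complexity.FinitePatching
import Literature.Computability.Complexity.BPClosureProofs
import Literature.Computability.Complexity.CountingHierarchyPH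
import Literature.Computability.Complexity.OracleProofs
import Literature.Computability.QuantumComplexity.AWPPLowForPP
import Mathlib.Data.Fintype.Pigeonhole

/-!
# Thm. 1.2 of Chen–Jin–Santhanam–Williams for `(𝒞, 𝒟) = (BPP, PP)` — proofs

Topic `Computability/MetaComplexity`. This file discharges the named fact
`constructiveSeparation_of_not_subset_BPP_PP` of `ConstructiveSeparations.lean`
(`theorem constructiveSeparation_of_not_subset_BPP_PP_holds`, Part 9):

  `PP ⊄ BPP →` every paddable `PP`-complete language `L` has, against every `L'' ∈ BPP`, a
  `BPP`-refuter — [ChenEtAl2022] Thm. 1.2 (= Thm. 6, §5.3, proved there from the list-refuter of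
  §5.1, Algorithm 1 / Thm. 4, and the list-to-single conversion Lemma 6).

It follows the printed proof (§5.3: binary search for the number of witnesses with the `PP` oracle,
local consistency `D(φ) = D(φ0) + D(φ1)` of the claimed counts, a search-to-decision reduction that
finds an inconsistent node, padding to a fixed query length; §5.1: the descent of Algorithm 1 and its
three-case analysis, Lemma 6 by pigeonhole over a constant-size list, amplification), on top of the
landed layers `RefuterBinarySearch.lean` (transcripts of the binary search), `RefuterLocalConsistency.lean`
(prefix counts, the local test `badNode`, `exists_mem_nodeList_disagree`), `RefuterParams.lean`
(level / depth bookkeeping, `pinv`) of this directory and `Complexity/AdaptiveBPPSimulation.lean`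
(a bounded adaptive reduction to a `BPP` language is a pseudo-deterministic `BPP` computation).
The one deliberate deviation from the text: the paper Karp-reduces an `NP` question that depends on
the refuted machine's coins `r`; here the search language `QL` depends on the refuted LANGUAGE
`L'' ∈ BPP` and is placed in `PP` by lowness (`NP^{L''} ⊆ PP^{L''} ⊆ PP`, via `BPP ⊆ AWPP` and the
tree's `AWPP_low_PP`), which keeps the refuter's output canonical as Lemma 6 requires.

Parts (each a `noncomputable section … end` block in `namespace PPRefuter`, the last in the topic
namespace):
1. queries — `Vpre`, `mem_TLang_Vpre_iff`, padding bricks `padS`/`padRed`, the embedding `tq`;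
2. witnesses — parsing `x u τᵤ τ₀ τ₁` in `FP`, the local-inconsistency bit `badW`;
3. the witness language `B0 ∈ P^{A}` (truth table) and the search language `QL`;
4. semantics: `mem_B0_wit_iff`, `mem_QL_iff_or`, `QL_mem_NPRel`;
5. the core transducer `coreQ` (descent + re-asks), stopping level `dstarF`, record `prepF`;
6. the six output slots `qSlotF`/`tSlotF`, `slotG`;
7. correctness: `exists_slot_disagree`;
8. the root decider `Ldec ∈ BPP`, `mem_Ldec_iff`, finite patching, round-padding invariance;
9. class-level ingredients (`NPRel_subset_PPRel`, `BPP_subset_AWPP`, `PPRel_subset_PP_of_mem_BPP`)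
   and the discharge `constructiveSeparation_of_not_subset_BPP_PP_holds`.

## References

* L. Chen, C. Jin, R. Santhanam, R. Williams, *Constructive separations and their consequences*,
  FOCS 2021 (doi:10.1109/FOCS52979.2021.00069) = TheoretiCS 3 (2024), arXiv:2203.14379; Thm. 1.2,
  §5.1 (Def. 4, Algorithm 1, Thm. 4, Lemma 6), §5.3 (Thm. 6) [ChenEtAl2022].
* S. Arora, B. Barak, *Computational Complexity: A Modern Approach*, CUP 2009, §17.2.1 (proof of
  Lemma 17.7: the threshold form of `PP`) [AroraBarak2009].
* S. Fenner, *PP-lowness and a simple definition of AWPP*, Theory Comput. Syst. 36 (2003),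
  Thm. 1.2 [Fenner2003].
-/

/-!
# Part 1. Queries of the `PP` refuter: the threshold oracle of the witness counts and padded reductions

Topic `Computability/MetaComplexity` (refuters for `PP`, Chen–Jin–Santhanam–Williams [ChenEtAl2022],
§5.3), machine layer (continuing the landed files `RefuterBinarySearch`, `RefuterLocalConsistency`,
`RefuterParams` of this directory).

* `Vpre L'` — the prefix-refined witness language `{⟨⟨x, t⟩, w⟩ | w ↾ |t| = t ∧ ⟨x, w⟩ ∈ L'}` of a
  majority-vote witness language `L' ∈ P` (`Vpre_mem_P`); its witness count at tag `t` is the prefix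
  count `pcnt L' x (p|x|) t` of `RefuterLocalConsistency.lean` (`cntV_Vpre`), so the tree's threshold
  language `ThresholdPP.TLang (Vpre L') p ∈ PP` (Arora–Barak, proof of Lemma 17.7) answers exactly
  the questions "`pcnt t > val s`" of the refuter's binary searches (`mem_TLang_Vpre_iff`). This is
  how the paper's `P^{PP}` algorithm for `#SAT` ([ChenEtAl2022, §5.3]: "`cᵢ` is the truth value of
  `#SAT(φ) ≥ 2ⁱ + Σ cⱼ2ʲ`, which can be determined by the `PP` oracle") is rendered without `#SAT`:
  the self-reducible count is the witness count of the `PP`-complete language itself.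
* `padS pad` — the padding map of a length-paddable language (`IsLengthPaddable`,
  `ConstructiveSeparations.lean`) as an `FP` string brick `⟨q, 1ᴺ⟩ ↦ pad (q, N)` (`padS_mem_FP`,
  via `mem_FP_of_unaryArg`); `padRed pad h` — "reduce by `h`, then pad to the length written in unary":
  `⟨v, 1ᴺ⟩ ↦ pad (h v, N)` (`padRed_apply`, `padRed_mem_FP`), and its truth lemma
  `padRed_mem_iff`: for a Karp reduction `h` of `K` to `L` and `|h v| ≤ N`, `pad (h v, N) ∈ L ↔ v ∈ K`
  and the padded query has length exactly `N` ("by padding, we assume the input strings received by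
  `A` have length exactly `ℓ(n)`", [ChenEtAl2022, §5.3]).

## References

* L. Chen, C. Jin, R. Santhanam, R. Williams, *Constructive separations and their consequences*,
  FOCS 2021 = TheoretiCS 3 (2024), §5.3 (proof of Thm. 6) [ChenEtAl2022].
* S. Arora, B. Barak, *Computational Complexity: A Modern Approach*, CUP 2009, §17.2.1, proof of
  Lemma 17.7 [AroraBarak2009].
-/

noncomputable section

namespace Literature.Computability.MetaComplexity

open _root_.Computability Polynomial Literature.Computability.Complexity
  Literature.Computability.Complexity.Brick Literature.Computability.Complexity.Plumb
  Literature.Computability.Complexity.ThresholdPP Literature.Computability.Complexity.PPSharpP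

namespace PPRefuter

/-! ### The prefix-refined witness language and its threshold oracle -/

section Threshold

variable (L' : Language Bool) (p : Polynomial ℕ)

/-- **The prefix-refined witness language** `Vpre L' = {⟨⟨x, t⟩, w⟩ | w ↾ |t| = t ∧ ⟨x, w⟩ ∈ L'}`
(read through the total projections, so that it is a language of all strings).
[cite: ChenEtAl2022, §5.3 (proof of Thm. 6)] -/
def Vpre : Language Bool :=
  ((fanoutFn (sndF ∘ fstF) (takeFn ∘ fanoutFn (sndF ∘ fstF) sndF)) ⁻¹' EqPair) ⊓
    ((fanoutFn (fstF ∘ fstF) sndF) ⁻¹' L')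

variable {L' p}

/-- Membership of a well-formed triple in `Vpre`. [folklore] -/
theorem mem_Vpre_iff (x t w : List Bool) :
    boolPair (boolPair x t) w ∈ Vpre L' ↔ w.take t.length = t ∧ boolPair x w ∈ L' := by
  simp only [Vpre, memL_inf', memL_preimage, Function.comp_apply, fanoutFn_apply, fstF_boolPair, sndF_boolPair,
    takeFn_boolPair, boolPair_mem_EqPair]
  constructor <;> rintro ⟨h, h'⟩ <;> exact ⟨h.symm, h'⟩

/-- **`Vpre L' ∈ P`** for `L' ∈ P`. [folklore] -/
theorem Vpre_mem_P (hL' : L' ∈ Classes.P) : Vpre L' ∈ Classes.P :=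
  inter_mem_P
    (preimage_mem_P EqPair_mem_P (fanoutFn_mem_FP (comp_mem_FP sndF_mem_FP fstF_mem_FP)
      (comp_mem_FP takeFn_mem_FP (fanoutFn_mem_FP (comp_mem_FP sndF_mem_FP fstF_mem_FP) sndF_mem_FP))))
    (preimage_mem_P hL' (fanoutFn_mem_FP (comp_mem_FP fstF_mem_FP fstF_mem_FP) sndF_mem_FP))

/-- **The witness count of `Vpre` at the tag `t` is the prefix count**: for `|t| ≤ p(|x|)`,
`cntV (Vpre L') p x t = pcnt L' x (p|x|) t`. [cite: ChenEtAl2022, §5.3 (proof of Thm. 6)] -/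
theorem cntV_Vpre {x t : List Bool} (ht : t.length ≤ p.eval x.length) :
    cntV (Vpre L') p x t = pcnt L' x (p.eval x.length) t := by
  rw [cntV, countWitnesses_eq_cnt, ← cnt_prefix_eq_pcnt ht]
  exact cnt_congr fun w _ => by rw [Set.mem_setOf_eq, mem_Vpre_iff]; rfl

/-- **The threshold oracle answers the questions of the binary search**: for `|t| ≤ p(|x|)`,
`⟨x, ⟨t, s⟩⟩ ∈ TLang (Vpre L') p ↔ val s < pcnt L' x (p|x|) t`. [cite: AroraBarak2009, Lemma 17.7 (proof)] -/
theorem mem_TLang_Vpre_iff {x t : List Bool} (s : List Bool) (ht : t.length ≤ p.eval x.length) :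
    boolPair x (boolPair t s) ∈ TLang (Vpre L') p ↔ bitsToNat s < pcnt L' x (p.eval x.length) t := by
  rw [mem_TLang_iff, cntV_Vpre ht]

/-- `TLang (Vpre L') p ∈ PP` for `L' ∈ P` (the tree's `TLang_mem_PP`). [cite: AroraBarak2009, Lemma 17.7 (proof)] -/
theorem TLang_Vpre_mem_PP (hL' : L' ∈ Classes.P) : TLang (Vpre L') p ∈ PP :=
  TLang_mem_PP (Vpre_mem_P hL')

end Threshold

/-! ### Padding as a brick -/

section Padding

variable (pad : List Bool × ℕ → List Bool)

/-- **The padding brick**: `padS pad w = pad ((boolUnpair w).1, |(boolUnpair w).2|)`, so that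
`padS pad ⟨q, 1ᴺ⟩ = pad (q, N)`. [cite: ChenEtAl2022, §5.3 (padding the queries)] -/
def padS : List Bool → List Bool := fun w => pad ((boolUnpair w).1, (boolUnpair w).2.length)

/-- **Reduce, then pad**: `padRed pad h ⟨v, 1ᴺ⟩ = pad (h v, N)`. [cite: ChenEtAl2022, §5.3 (padding the queries)] -/
def padRed (h : List Bool → List Bool) : List Bool → List Bool := padS pad ∘ fanoutFn (h ∘ fstF) sndF

/-- `padS pad ⟨q, u⟩ = pad (q, |u|)`. [folklore] -/
@[simp] theorem padS_boolPair (q u : List Bool) : padS pad (boolPair q u) = pad (q, u.length) := by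
  simp [padS]

/-- Value of `padRed`. [folklore] -/
@[simp] theorem padRed_apply (h : List Bool → List Bool) (v u : List Bool) :
    padRed pad h (boolPair v u) = pad (h v, u.length) := by
  simp [padRed]

variable {pad}

/-- **`padS pad ∈ FP`** when `pad` is polynomial time on `⟨q, 1ᴺ⟩` (the computability clause of
`IsLengthPaddable`). [cite: ChenEtAl2022, §5.3 (padding the queries)] -/
theorem padS_mem_FP
    (hpad : PolyTimeComputable (fun q : List Bool × ℕ => boolPair q.1 (unaryEncodeNat q.2)) (id : List Bool → List Bool) pad) :
    padS pad ∈ FP := by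
  have h := mem_FP_of_unaryArg (eb := (id : List Bool → List Bool)) (f := fun q n => pad (q, n)) hpad
  exact h

/-- `padRed pad h ∈ FP`. [folklore] -/
theorem padRed_mem_FP
    (hpad : PolyTimeComputable (fun q : List Bool × ℕ => boolPair q.1 (unaryEncodeNat q.2)) (id : List Bool → List Bool) pad)
    {h : List Bool → List Bool} (hh : h ∈ FP) : padRed pad h ∈ FP :=
  comp_mem_FP (padS_mem_FP hpad) (fanoutFn_mem_FP (comp_mem_FP hh fstF_mem_FP) sndF_mem_FP)

/-- **Truth of a padded reduced query.** If `pad` pads `L` (length exactly `N`, membership kept, for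
`|q| ≤ N`) and `h` Karp-reduces `K` to `L`, then for `|h v| ≤ N` the query `pad (h v, N)` has length
`N` and lies in `L` iff `v ∈ K`. [cite: ChenEtAl2022, §5.3 (padding the queries)] -/
theorem padRed_spec {L K : Language Bool}
    (hpad : ∀ (q : List Bool) (N : ℕ), q.length ≤ N → (pad (q, N)).length = N ∧ (pad (q, N) ∈ L ↔ q ∈ L))
    {h : List Bool → List Bool} (hh : ∀ v, v ∈ K ↔ h v ∈ L) {v : List Bool} {N : ℕ} (hv : (h v).length ≤ N) :
    (pad (h v, N)).length = N ∧ (pad (h v, N) ∈ L ↔ v ∈ K) := by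
  obtain ⟨hlen, hmem⟩ := hpad (h v) N hv
  exact ⟨hlen, hmem.trans (hh v).symm⟩

end Padding

/-! ### The threshold query embedding of a node -/

section Embedding

variable (pad : List Bool × ℕ → List Bool) (hT : List Bool → List Bool) (N : ℕ) (x : List Bool)

/-- **The threshold query embedding at padding length `N`**: the tag `t` and numeral `s` are asked as
`pad (hT ⟨x, ⟨t, s⟩⟩, N)` — the string handed to the refuted algorithm in place of the `PP` oracle.
(`τ` of `RefuterLocalConsistency.exists_mem_nodeList_disagree`.) [cite: ChenEtAl2022, §5.3 (proof of Thm. 6)] -/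
def tq (t s : List Bool) : List Bool := pad (hT (boolPair x (boolPair t s)), N)

variable {pad hT N x}

/-- **The embedding is truthful**: if `hT` reduces `TLang (Vpre L') p` to `L`, `pad` pads `L`, and the
reduced queries of `x` with tags of length `≤ p|x|` and numerals of length `D` fit into `N`, then
`tq t s ∈ L ↔ val s < pcnt L' x (p|x|) t` — the hypothesis `htruth` of the node/leaf analysis.
[cite: ChenEtAl2022, §5.3 (proof of Thm. 6)] -/
theorem tq_truth {L L' : Language Bool} {p : Polynomial ℕ} {D : ℕ}
    (hpad : ∀ (q : List Bool) (N : ℕ), q.length ≤ N → (pad (q, N)).length = N ∧ (pad (q, N) ∈ L ↔ q ∈ L))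
    (hh : ∀ v, v ∈ TLang (Vpre L') p ↔ hT v ∈ L)
    (hfit : ∀ t s : List Bool, t.length ≤ p.eval x.length → s.length = D → (hT (boolPair x (boolPair t s))).length ≤ N) :
    ∀ t s : List Bool, t.length ≤ p.eval x.length → s.length = D →
      (tq pad hT N x t s ∈ L ↔ bitsToNat s < pcnt L' x (p.eval x.length) t) := by
  intro t s ht hs
  rw [tq, (padRed_spec hpad hh (hfit t s ht hs)).2, mem_TLang_Vpre_iff s ht]

/-- Padded threshold queries have length exactly `N`. [folklore] -/
theorem length_tq {L L' : Language Bool} {p : Polynomial ℕ}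
    (hpad : ∀ (q : List Bool) (N : ℕ), q.length ≤ N → (pad (q, N)).length = N ∧ (pad (q, N) ∈ L ↔ q ∈ L))
    (hh : ∀ v, v ∈ TLang (Vpre L') p ↔ hT v ∈ L) {t s : List Bool}
    (hfit : (hT (boolPair x (boolPair t s))).length ≤ N) : (tq pad hT N x t s).length = N :=
  (padRed_spec hpad hh hfit).1

end Embedding

end PPRefuter

end Literature.Computability.MetaComplexity

end


/-!
# Part 2. Witnesses of the `PP` refuter: parsing `x u τᵤ τ₀ τ₁` and testing local inconsistency, in `FP`

Topic `Computability/MetaComplexity` (refuters for `PP`, Chen–Jin–Santhanam–Williams [ChenEtAl2022],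
§5.3), machine layer.

The refuter finds a locally inconsistent node `(x, u)` of the counting tree ("a formula `φ` such
that `D^A(φ) ≠ D^A(φ₀) + D^A(φ₁)` … by a search-to-decision reduction using `A`", [ChenEtAl2022,
§5.3]) by a prefix search over WITNESSES that carry, besides `x` (length `n`) and the prefix `u`
(length `j ≤ m = p(n)`), the three width-`D₀` transcripts `τᵤ, τ₀, τ₁` CLAIMED for the binary
searches at `u, u0, u1` (`D₀ = m + 2`): a witness is the plain concatenation
`w' = x u τᵤ τ₀ τ₁`, of length `n + j + 3D₀`, and `j` is recovered from the length. This file provides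
the `FP` bricks reading a witness off the pair `⟨z, w'⟩` (`|z| = N` fixes the level `n`, `RefuterParams`):
the fields (`xW`, `uW`, `jW`, `tauW`), the well-formedness bit (`wfW`: `3D₀ ≤ |w'| - n`, `j ≤ m`), the
leaf bit (`leafW`: `j = m`), the claimed values `c, a, b` (the reversed transcripts, read as
little-endian numerals), the bounds `K = 2^{m-j}`, `K/2`, the indicator `[⟨x, u⟩ ∈ L']`, and the
**local-inconsistency bit** `badW` (`RefuterLocalConsistency.badNode`, resp. `c ≠ [⟨x,u⟩ ∈ L']` at a
leaf), each with its value on well-formed inputs and its `FP` membership.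

## References

* L. Chen, C. Jin, R. Santhanam, R. Williams, *Constructive separations and their consequences*,
  FOCS 2021 = TheoretiCS 3 (2024), §5.3 (proof of Thm. 6) [ChenEtAl2022].
* S. Arora, B. Barak, *Computational Complexity: A Modern Approach*, CUP 2009, §1.3 [AroraBarak2009].
-/

noncomputable section

namespace Literature.Computability.MetaComplexity

open _root_.Computability Polynomial Literature.Computability.Complexity
  Literature.Computability.Complexity.Brick Literature.Computability.Complexity.Plumb

namespace PPRefuter

/-! ### One-bit helpers -/

/-- Disjunction of one-bit conditions. [folklore] -/
def orFn (c d : List Bool → List Bool) : List Bool → List Bool := iteFn c (fun _ => [true]) d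

/-- `orFn c d z = [b || b']` when `c z = [b]`, `d z = [b']`. [folklore] -/
theorem orFn_apply {c d : List Bool → List Bool} {z : List Bool} {b b' : Bool} (h : c z = [b]) (h' : d z = [b']) :
    orFn c d z = [b || b'] := by
  rw [orFn, iteFn_apply h]; cases b <;> simp [h']

/-- `orFn` of one-bit conditions is one-bit. [folklore] -/
theorem oneBit_orFn {c d : List Bool → List Bool} (hc : OneBit c) (hd : OneBit d) : OneBit (orFn c d) :=
  hc.ite (oneBit_const true) hd

/-- `orFn c d ∈ FP`. [folklore] -/
theorem orFn_mem_FP {c d : List Bool → List Bool} (hc : c ∈ FP) (hd : d ∈ FP) : orFn c d ∈ FP :=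
  iteFn_mem_FP hc (const_mem_FP _) hd

/-- The strict comparison of two numeral-valued bricks: `[val (f z) < val (g z)]`. [folklore] -/
def ltW (f g : List Bool → List Bool) : List Bool → List Bool := ltFn ∘ fanoutFn f g

/-- Value of `ltW`. [folklore] -/
@[simp] theorem ltW_apply (f g : List Bool → List Bool) (z : List Bool) :
    ltW f g z = [decide (bitsToNat (f z) < bitsToNat (g z))] := by simp [ltW]

/-- `ltW` is one-bit. [folklore] -/
theorem oneBit_ltW (f g : List Bool → List Bool) : OneBit (ltW f g) := fun z => ⟨_, ltW_apply f g z⟩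

/-- `ltW f g ∈ FP`. [folklore] -/
theorem ltW_mem_FP {f g : List Bool → List Bool} (hf : f ∈ FP) (hg : g ∈ FP) : ltW f g ∈ FP :=
  comp_mem_FP ltFn_mem_FP (fanoutFn_mem_FP hf hg)

/-- `[val f ≠ val g]` as two strict comparisons. [folklore] -/
def neW (f g : List Bool → List Bool) : List Bool → List Bool := orFn (ltW f g) (ltW g f)

/-- Value of `neW`. [folklore] -/
theorem neW_apply (f g : List Bool → List Bool) (z : List Bool) :
    neW f g z = [decide (bitsToNat (f z) ≠ bitsToNat (g z))] := by
  rw [neW, orFn_apply (ltW_apply f g z) (ltW_apply g f z)]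
  congr 1
  by_cases h : bitsToNat (f z) = bitsToNat (g z)
  · simp [h]
  · rcases Nat.lt_or_gt_of_ne h with hlt | hgt
    · simp [hlt, h]
    · simp [hgt, h]

/-- `neW` is one-bit. [folklore] -/
theorem oneBit_neW (f g : List Bool → List Bool) : OneBit (neW f g) := oneBit_orFn (oneBit_ltW f g) (oneBit_ltW g f)

/-- `neW f g ∈ FP`. [folklore] -/
theorem neW_mem_FP {f g : List Bool → List Bool} (hf : f ∈ FP) (hg : g ∈ FP) : neW f g ∈ FP :=
  orFn_mem_FP (ltW_mem_FP hf hg) (ltW_mem_FP hg hf)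

/-! ### Reading a witness -/

section Parse

variable (p PT : Polynomial ℕ)

/-- `1^{3D₀}` at the level of `z`. [folklore] -/
def d3F : List Bool → List Bool := fun z => d0F p PT z ++ (d0F p PT z ++ d0F p PT z)

/-- The input `x = w' ↾ n` of the witness in `⟨z, w'⟩`. [cite: ChenEtAl2022, §5.3 (proof of Thm. 6)] -/
def xW : List Bool → List Bool := takeFn ∘ fanoutFn (nF PT ∘ fstF) sndF
/-- The rest `w' ⇂ n = u τᵤ τ₀ τ₁`. [folklore] -/
def r1W : List Bool → List Bool := dropFn ∘ fanoutFn (nF PT ∘ fstF) sndF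
/-- The prefix length `j = |w' ⇂ n| - 3D₀`, in unary. [folklore] -/
def jW : List Bool → List Bool := dropFn ∘ fanoutFn (d3F p PT ∘ fstF) (onesFn ∘ r1W PT)
/-- The prefix `u`. [cite: ChenEtAl2022, §5.3 (proof of Thm. 6)] -/
def uW : List Bool → List Bool := takeFn ∘ fanoutFn (jW p PT) (r1W PT)
/-- The transcripts `τᵤ τ₀ τ₁`. [folklore] -/
def r2W : List Bool → List Bool := dropFn ∘ fanoutFn (jW p PT) (r1W PT)
/-- Shifting a transcript region by one transcript. [folklore] -/
def shiftW (pre : List Bool → List Bool) : List Bool → List Bool := dropFn ∘ fanoutFn (d0F p PT ∘ fstF) pre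
/-- The first transcript of a region. [folklore] -/
def blkW (pre : List Bool → List Bool) : List Bool → List Bool := takeFn ∘ fanoutFn (d0F p PT ∘ fstF) pre
/-- The claimed transcript at `u` (`i = 0`), `u0` (`i = 1`), `u1` (`i = 2`). [cite: ChenEtAl2022, §5.3 (proof of Thm. 6)] -/
def tauW : ℕ → List Bool → List Bool
  | 0 => blkW p PT (r2W p PT)
  | 1 => blkW p PT (shiftW p PT (r2W p PT))
  | _ => blkW p PT (shiftW p PT (shiftW p PT (r2W p PT)))

/-- The well-formedness bit: `3D₀ ≤ |w' ⇂ n|` and `j ≤ m`. [folklore] -/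
def wfW : List Bool → List Bool :=
  andFn (lenLeFn X ∘ fanoutFn (r1W PT) (d3F p PT ∘ fstF)) (lenLeFn X ∘ fanoutFn (mF p PT ∘ fstF) (jW p PT))

/-- The inner-node bit `[j < m]` (`[j + 1 ≤ m]`). [folklore] -/
def innerW : List Bool → List Bool := lenLeFn X ∘ fanoutFn (mF p PT ∘ fstF) (List.cons true ∘ jW p PT)

/-- The claimed value `c` / `a` / `b` as a little-endian numeral: the reversed transcript. [cite: ChenEtAl2022, §5.3 (proof of Thm. 6)] -/
def valW (i : ℕ) : List Bool → List Bool := List.reverse ∘ tauW p PT i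

/-- The bound `K = 2^{m-j}` as a numeral `0^{m-j} 1`. [folklore] -/
def kW : List Bool → List Bool :=
  fun v => (Kannan.zerosFn ∘ dropFn ∘ fanoutFn (jW p PT) (mF p PT ∘ fstF)) v ++ [true]

/-- The bound `K/2 = 2^{m-j-1}` (for `j < m`) as a numeral `0^{m-j-1} 1`. [folklore] -/
def k2W : List Bool → List Bool :=
  fun v => (Kannan.zerosFn ∘ dropFn ∘ fanoutFn (List.cons true ∘ jW p PT) (mF p PT ∘ fstF)) v ++ [true]

variable (L' : Language Bool)

/-- The leaf indicator `[⟨x, u⟩ ∈ L']` as a one-symbol numeral. [cite: ChenEtAl2022, §5.3 (proof of Thm. 6)] -/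
def indW : List Bool → List Bool := (fun w => encodeBool (L'.boolIndicator w)) ∘ fanoutFn (xW PT) (uW p PT)

/-- The sum `a + b` as a canonical numeral. [folklore] -/
def sumW : List Bool → List Bool := addFn ∘ fanoutFn (valW p PT 1) (valW p PT 2)

/-- **The inner-node inconsistency bit** `[K < c ∨ K/2 < a ∨ K/2 < b ∨ c ≠ a + b]` (`badNode`).
[cite: ChenEtAl2022, §5.3 (proof of Thm. 6)] -/
def badNodeW : List Bool → List Bool :=
  orFn (ltW (kW p PT) (valW p PT 0)) (orFn (ltW (k2W p PT) (valW p PT 1))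
    (orFn (ltW (k2W p PT) (valW p PT 2)) (neW (valW p PT 0) (sumW p PT))))

/-- **The leaf inconsistency bit** `[c ≠ [⟨x, u⟩ ∈ L']]`. [cite: ChenEtAl2022, §5.3 (proof of Thm. 6)] -/
def badLeafW : List Bool → List Bool := neW (valW p PT 0) (indW p PT L')

/-- **The local inconsistency bit** of a witness: `badNodeW` at an inner node, `badLeafW` at a leaf.
[cite: ChenEtAl2022, §5.3 (proof of Thm. 6)] -/
def badW : List Bool → List Bool := iteFn (innerW p PT) (badNodeW p PT) (badLeafW p PT L')

/-! #### `FP` membership -/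

variable {p PT L'}

/-- `d3F ∈ FP`. [folklore] -/
theorem d3F_mem_FP : d3F p PT ∈ FP := append_mem_FP d0F_mem_FP (append_mem_FP d0F_mem_FP d0F_mem_FP)
/-- `xW ∈ FP`. [folklore] -/
theorem xW_mem_FP : xW PT ∈ FP := comp_mem_FP takeFn_mem_FP (fanoutFn_mem_FP (comp_mem_FP nF_mem_FP fstF_mem_FP) sndF_mem_FP)
/-- `r1W ∈ FP`. [folklore] -/
theorem r1W_mem_FP : r1W PT ∈ FP := comp_mem_FP dropFn_mem_FP (fanoutFn_mem_FP (comp_mem_FP nF_mem_FP fstF_mem_FP) sndF_mem_FP)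
/-- `jW ∈ FP`. [folklore] -/
theorem jW_mem_FP : jW p PT ∈ FP :=
  comp_mem_FP dropFn_mem_FP (fanoutFn_mem_FP (comp_mem_FP d3F_mem_FP fstF_mem_FP) (comp_mem_FP onesFn_mem_FP r1W_mem_FP))
/-- `uW ∈ FP`. [folklore] -/
theorem uW_mem_FP : uW p PT ∈ FP := comp_mem_FP takeFn_mem_FP (fanoutFn_mem_FP jW_mem_FP r1W_mem_FP)
/-- `r2W ∈ FP`. [folklore] -/
theorem r2W_mem_FP : r2W p PT ∈ FP := comp_mem_FP dropFn_mem_FP (fanoutFn_mem_FP jW_mem_FP r1W_mem_FP)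
/-- `shiftW pre ∈ FP`. [folklore] -/
theorem shiftW_mem_FP {pre : List Bool → List Bool} (h : pre ∈ FP) : shiftW p PT pre ∈ FP :=
  comp_mem_FP dropFn_mem_FP (fanoutFn_mem_FP (comp_mem_FP d0F_mem_FP fstF_mem_FP) h)
/-- `blkW pre ∈ FP`. [folklore] -/
theorem blkW_mem_FP {pre : List Bool → List Bool} (h : pre ∈ FP) : blkW p PT pre ∈ FP :=
  comp_mem_FP takeFn_mem_FP (fanoutFn_mem_FP (comp_mem_FP d0F_mem_FP fstF_mem_FP) h)
/-- `tauW i ∈ FP`. [folklore] -/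
theorem tauW_mem_FP : ∀ i, tauW p PT i ∈ FP
  | 0 => blkW_mem_FP r2W_mem_FP
  | 1 => blkW_mem_FP (shiftW_mem_FP r2W_mem_FP)
  | _ + 2 => blkW_mem_FP (shiftW_mem_FP (shiftW_mem_FP r2W_mem_FP))
/-- `wfW ∈ FP`. [folklore] -/
theorem wfW_mem_FP : wfW p PT ∈ FP :=
  andFn_mem_FP (comp_mem_FP (lenLeFn_mem_FP X) (fanoutFn_mem_FP r1W_mem_FP (comp_mem_FP d3F_mem_FP fstF_mem_FP)))
    (comp_mem_FP (lenLeFn_mem_FP X) (fanoutFn_mem_FP (comp_mem_FP mF_mem_FP fstF_mem_FP) jW_mem_FP))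
/-- `innerW ∈ FP`. [folklore] -/
theorem innerW_mem_FP : innerW p PT ∈ FP :=
  comp_mem_FP (lenLeFn_mem_FP X) (fanoutFn_mem_FP (comp_mem_FP mF_mem_FP fstF_mem_FP) (comp_mem_FP (cons_mem_FP true) jW_mem_FP))
/-- `valW i ∈ FP`. [folklore] -/
theorem valW_mem_FP (i : ℕ) : valW p PT i ∈ FP := comp_mem_FP BinSearchPP.reverse_mem_FP (tauW_mem_FP i)
/-- `kW ∈ FP`. [folklore] -/
theorem kW_mem_FP : kW p PT ∈ FP :=
  append_mem_FP (comp_mem_FP Kannan.zerosFn_mem_FP (comp_mem_FP dropFn_mem_FP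
    (fanoutFn_mem_FP jW_mem_FP (comp_mem_FP mF_mem_FP fstF_mem_FP)))) (const_mem_FP _)
/-- `k2W ∈ FP`. [folklore] -/
theorem k2W_mem_FP : k2W p PT ∈ FP :=
  append_mem_FP (comp_mem_FP Kannan.zerosFn_mem_FP (comp_mem_FP dropFn_mem_FP
    (fanoutFn_mem_FP (comp_mem_FP (cons_mem_FP true) jW_mem_FP) (comp_mem_FP mF_mem_FP fstF_mem_FP)))) (const_mem_FP _)
/-- `indW ∈ FP` for `L' ∈ P`. [folklore] -/
theorem indW_mem_FP (hL' : L' ∈ Classes.P) : indW p PT L' ∈ FP :=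
  comp_mem_FP (indicatorFn_mem_FP hL') (fanoutFn_mem_FP xW_mem_FP uW_mem_FP)
/-- `sumW ∈ FP`. [folklore] -/
theorem sumW_mem_FP : sumW p PT ∈ FP := comp_mem_FP addFn_mem_FP (fanoutFn_mem_FP (valW_mem_FP 1) (valW_mem_FP 2))
/-- `badNodeW ∈ FP`. [folklore] -/
theorem badNodeW_mem_FP : badNodeW p PT ∈ FP :=
  orFn_mem_FP (ltW_mem_FP kW_mem_FP (valW_mem_FP 0)) (orFn_mem_FP (ltW_mem_FP k2W_mem_FP (valW_mem_FP 1))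
    (orFn_mem_FP (ltW_mem_FP k2W_mem_FP (valW_mem_FP 2)) (neW_mem_FP (valW_mem_FP 0) sumW_mem_FP)))
/-- `badLeafW ∈ FP` for `L' ∈ P`. [folklore] -/
theorem badLeafW_mem_FP (hL' : L' ∈ Classes.P) : badLeafW p PT L' ∈ FP := neW_mem_FP (valW_mem_FP 0) (indW_mem_FP hL')
/-- **`badW ∈ FP`** for `L' ∈ P`. [folklore] -/
theorem badW_mem_FP (hL' : L' ∈ Classes.P) : badW p PT L' ∈ FP := iteFn_mem_FP innerW_mem_FP badNodeW_mem_FP (badLeafW_mem_FP hL')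

/-- `innerW` is one-bit. [folklore] -/
theorem oneBit_innerW : OneBit (innerW p PT) := fun v => by
  rcases lenLeFn_eq_or X (fanoutFn (mF p PT ∘ fstF) (List.cons true ∘ jW p PT) v) with h | h
  · exact ⟨true, h⟩
  · exact ⟨false, h⟩

/-- `badW` is one-bit (so that `{v | badW v = [1]}`-style languages are decided by it). [folklore] -/
theorem oneBit_badW : OneBit (badW p PT L') := by
  refine oneBit_innerW.ite ?_ (oneBit_neW _ _)
  exact oneBit_orFn (oneBit_ltW _ _) (oneBit_orFn (oneBit_ltW _ _) (oneBit_orFn (oneBit_ltW _ _) (oneBit_neW _ _)))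

/-! #### Values on a well-formed witness -/

section Values

variable {z x u τu τ0 τ1 : List Bool}

local notation "nn" => lev PT (List.length z)
local notation "mm" => Polynomial.eval (lev PT (List.length z)) p
local notation "DD" => Polynomial.eval (lev PT (List.length z)) p + 2

/-- The witness string assembled from its fields. [folklore] -/
def wit (x u τu τ0 τ1 : List Bool) : List Bool := x ++ (u ++ (τu ++ (τ0 ++ τ1)))

/-- `xW` reads `x`. [folklore] -/
theorem xW_wit (hx : x.length = nn) : xW PT (boolPair z (wit x u τu τ0 τ1)) = x := by
  simp [xW, wit, ← hx]

/-- `r1W` reads `u τᵤ τ₀ τ₁`. [folklore] -/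
theorem r1W_wit (hx : x.length = nn) : r1W PT (boolPair z (wit x u τu τ0 τ1)) = u ++ (τu ++ (τ0 ++ τ1)) := by
  simp [r1W, wit, ← hx]

/-- `jW` reads `1^{|u|}`. [folklore] -/
theorem jW_wit (hx : x.length = nn) (hu : τu.length = DD) (h0 : τ0.length = DD) (h1 : τ1.length = DD) :
    jW p PT (boolPair z (wit x u τu τ0 τ1)) = ones u.length := by
  simp only [jW, Function.comp_apply, fanoutFn_apply, fstF_boolPair, dropFn_boolPair]
  rw [r1W_wit hx]
  simp only [d3F, d0F_apply, onesFn, unaryEncodeNat_eq_replicate, List.length_append, ones, ← List.replicate_add,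
    List.drop_replicate, hu, h0, h1, List.length_replicate]
  congr 1; omega

/-- `uW` reads `u`. [folklore] -/
theorem uW_wit (hx : x.length = nn) (hu : τu.length = DD) (h0 : τ0.length = DD) (h1 : τ1.length = DD) :
    uW p PT (boolPair z (wit x u τu τ0 τ1)) = u := by
  rw [uW, Function.comp_apply, fanoutFn_apply, jW_wit hx hu h0 h1, r1W_wit hx, takeFn_boolPair]
  simp [ones]

/-- `r2W` reads `τᵤ τ₀ τ₁`. [folklore] -/
theorem r2W_wit (hx : x.length = nn) (hu : τu.length = DD) (h0 : τ0.length = DD) (h1 : τ1.length = DD) :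
    r2W p PT (boolPair z (wit x u τu τ0 τ1)) = τu ++ (τ0 ++ τ1) := by
  rw [r2W, Function.comp_apply, fanoutFn_apply, jW_wit hx hu h0 h1, r1W_wit hx, dropFn_boolPair]
  simp [ones]

/-- `tauW 0, 1, 2` read `τᵤ, τ₀, τ₁`. [folklore] -/
theorem tauW_wit (hx : x.length = nn) (hu : τu.length = DD) (h0 : τ0.length = DD) (h1 : τ1.length = DD) :
    tauW p PT 0 (boolPair z (wit x u τu τ0 τ1)) = τu ∧ tauW p PT 1 (boolPair z (wit x u τu τ0 τ1)) = τ0 ∧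
      tauW p PT 2 (boolPair z (wit x u τu τ0 τ1)) = τ1 := by
  have hr := r2W_wit (p := p) (u := u) hx hu h0 h1
  refine ⟨?_, ?_, ?_⟩
  · change blkW p PT (r2W p PT) (boolPair z (wit x u τu τ0 τ1)) = τu
    simp only [blkW, Function.comp_apply, fanoutFn_apply, fstF_boolPair, hr, d0F_apply, takeFn_boolPair, ones,
      List.length_replicate]
    exact List.take_left' hu
  · change blkW p PT (shiftW p PT (r2W p PT)) (boolPair z (wit x u τu τ0 τ1)) = τ0
    simp only [blkW, shiftW, Function.comp_apply, fanoutFn_apply, fstF_boolPair, hr, d0F_apply, takeFn_boolPair,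
      dropFn_boolPair, ones, List.length_replicate]
    rw [List.drop_left' hu, List.take_left' h0]
  · change blkW p PT (shiftW p PT (shiftW p PT (r2W p PT))) (boolPair z (wit x u τu τ0 τ1)) = τ1
    simp only [blkW, shiftW, Function.comp_apply, fanoutFn_apply, fstF_boolPair, hr, d0F_apply, takeFn_boolPair,
      dropFn_boolPair, ones, List.length_replicate]
    rw [List.drop_left' hu, List.drop_left' h0, List.take_of_length_le h1.le]

/-- `valW i` reads the reversed transcripts. [folklore] -/
theorem valW_wit (hx : x.length = nn) (hu : τu.length = DD) (h0 : τ0.length = DD) (h1 : τ1.length = DD) :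
    valW p PT 0 (boolPair z (wit x u τu τ0 τ1)) = τu.reverse ∧ valW p PT 1 (boolPair z (wit x u τu τ0 τ1)) = τ0.reverse ∧
      valW p PT 2 (boolPair z (wit x u τu τ0 τ1)) = τ1.reverse := by
  obtain ⟨ha, hb, hc⟩ := tauW_wit (p := p) (u := u) hx hu h0 h1
  exact ⟨by simp [valW, ha], by simp [valW, hb], by simp [valW, hc]⟩

/-- `wfW` on a well-formed witness is `[j ≤ m]`. [folklore] -/
theorem wfW_wit (hx : x.length = nn) (hu : τu.length = DD) (h0 : τ0.length = DD) (h1 : τ1.length = DD) :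
    wfW p PT (boolPair z (wit x u τu τ0 τ1)) = [decide (u.length ≤ mm)] := by
  have hc : (lenLeFn X ∘ fanoutFn (r1W PT) (d3F p PT ∘ fstF)) (boolPair z (wit x u τu τ0 τ1)) = [true] := by
    rw [Function.comp_apply, fanoutFn_apply, r1W_wit hx, lenLeFn_boolPair]
    simp [d3F, hu, h0, h1]
  have hd : (lenLeFn X ∘ fanoutFn (mF p PT ∘ fstF) (jW p PT)) (boolPair z (wit x u τu τ0 τ1)) = [decide (u.length ≤ mm)] := by
    rw [Function.comp_apply, fanoutFn_apply, jW_wit hx hu h0 h1, lenLeFn_boolPair]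
    simp [ones]
  rw [wfW, andFn_apply hc hd, Bool.true_and]

/-- `innerW` on a well-formed witness is `[j < m]`. [folklore] -/
theorem innerW_wit (hx : x.length = nn) (hu : τu.length = DD) (h0 : τ0.length = DD) (h1 : τ1.length = DD) :
    innerW p PT (boolPair z (wit x u τu τ0 τ1)) = [decide (u.length < mm)] := by
  simp only [innerW, Function.comp_apply, fanoutFn_apply]
  rw [jW_wit hx hu h0 h1, lenLeFn_boolPair]
  simp [ones]

/-- Value of `kW`: `2^{m - j}`. [folklore] -/
theorem bitsToNat_kW_wit (hx : x.length = nn) (hu : τu.length = DD) (h0 : τ0.length = DD) (h1 : τ1.length = DD) :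
    bitsToNat (kW p PT (boolPair z (wit x u τu τ0 τ1))) = 2 ^ (mm - u.length) := by
  simp only [kW, Function.comp_apply, fanoutFn_apply, fstF_boolPair]
  rw [jW_wit hx hu h0 h1, dropFn_boolPair, bitsToNat_append]
  simp [ones]

/-- Value of `k2W`: `2^{m - (j+1)}`. [folklore] -/
theorem bitsToNat_k2W_wit (hx : x.length = nn) (hu : τu.length = DD) (h0 : τ0.length = DD) (h1 : τ1.length = DD) :
    bitsToNat (k2W p PT (boolPair z (wit x u τu τ0 τ1))) = 2 ^ (mm - (u.length + 1)) := by
  simp only [k2W, Function.comp_apply, fanoutFn_apply, fstF_boolPair]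
  rw [jW_wit hx hu h0 h1, dropFn_boolPair, bitsToNat_append]
  simp [ones]

/-- Value of `indW`: the indicator of `⟨x, u⟩ ∈ L'`. [folklore] -/
theorem bitsToNat_indW_wit (hx : x.length = nn) (hu : τu.length = DD) (h0 : τ0.length = DD) (h1 : τ1.length = DD) :
    bitsToNat (indW p PT L' (boolPair z (wit x u τu τ0 τ1))) = (L'.boolIndicator (boolPair x u)).toNat := by
  rw [indW, Function.comp_apply, fanoutFn_apply, xW_wit hx, uW_wit hx hu h0 h1]
  cases L'.boolIndicator (boolPair x u) <;> rfl

/-- **Value of the local inconsistency bit** on a well-formed witness with `j ≤ m`: with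
`c, a, b` the values of the reversed transcripts, `badW = [badNode c a b 2^{m-j}]` if `j < m`, and
`badW = [c ≠ [⟨x,u⟩ ∈ L']]` if `j = m`. [cite: ChenEtAl2022, §5.3 (proof of Thm. 6)] -/
theorem badW_wit (hx : x.length = nn) (hu : τu.length = DD) (h0 : τ0.length = DD) (h1 : τ1.length = DD) :
    badW p PT L' (boolPair z (wit x u τu τ0 τ1)) =
      [if u.length < mm then
        badNode (bitsToNat τu.reverse) (bitsToNat τ0.reverse) (bitsToNat τ1.reverse) (2 ^ (mm - u.length))
       else decide (bitsToNat τu.reverse ≠ (L'.boolIndicator (boolPair x u)).toNat)] := by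
  obtain ⟨hc, ha, hb⟩ := valW_wit (p := p) (u := u) hx hu h0 h1
  have hsum : bitsToNat (sumW p PT (boolPair z (wit x u τu τ0 τ1))) = bitsToNat τ0.reverse + bitsToNat τ1.reverse := by
    simp [sumW, ha, hb]
  by_cases hj : u.length < mm
  · rw [badW, iteFn_apply_true (by rw [innerW_wit hx hu h0 h1, decide_eq_true hj]), if_pos hj, badNodeW,
      orFn_apply (ltW_apply _ _ _) (orFn_apply (ltW_apply _ _ _) (orFn_apply (ltW_apply _ _ _) (neW_apply _ _ _))),
      hc, ha, hb, hsum, bitsToNat_kW_wit hx hu h0 h1, bitsToNat_k2W_wit hx hu h0 h1]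
    have hK2 : 2 ^ (mm - (u.length + 1)) = 2 ^ (mm - u.length) / 2 := by
      rw [show mm - u.length = (mm - (u.length + 1)) + 1 by omega, pow_succ]; simp
    rw [hK2]
    simp only [List.cons.injEq, and_true]
    by_cases h1' : 2 ^ (mm - u.length) < bitsToNat τu.reverse <;>
    by_cases h2' : 2 ^ (mm - u.length) / 2 < bitsToNat τ0.reverse <;>
    by_cases h3' : 2 ^ (mm - u.length) / 2 < bitsToNat τ1.reverse <;>
    by_cases h4' : bitsToNat τu.reverse ≠ bitsToNat τ0.reverse + bitsToNat τ1.reverse <;>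
    simp [badNode, h1', h2', h3', h4']
  · rw [badW, iteFn_apply_false (by rw [innerW_wit hx hu h0 h1, decide_eq_false hj]), if_neg hj, badLeafW,
      neW_apply, hc, bitsToNat_indW_wit hx hu h0 h1]

end Values

end Parse

end PPRefuter

end Literature.Computability.MetaComplexity

end


/-!
# Part 3. The witness language of the `PP` refuter is in `P^{A}`: transcripts checked by a truth table

Topic `Computability/MetaComplexity` (refuters for `PP`, Chen–Jin–Santhanam–Williams [ChenEtAl2022],
§5.3), machine layer.

A witness `w' = x u τᵤ τ₀ τ₁` (Part 2) certifies a locally inconsistent node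
`(x, u)` of the refuted algorithm `A` when (i) the three transcripts are the ones `A` really produces
on the threshold queries of the binary searches at `u, u0, u1` — `τₜ[k] = [tq t (qryNum D₀ (τₜ ↾ k)) ∈ A]`
for all `k < D₀`, a NON-ADAPTIVE family of `3D₀` oracle questions determined by `w'` — and (ii) the
claimed values are inconsistent (`badW`). So the language

  `B0 … A = {⟨z, w'⟩ | w' well formed at the level of |z|, (i), (ii)}`

is a polynomial-time TRUTH-TABLE reduction to `A` (`TruthTableClosure.ttLang`: query generator
`qttF`, evaluator `DttL ∈ P`), hence in `P^A` (`B0_mem_PRel`); the value of the query generator on a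
parsed witness is `qttF_wit`. The existential projection
`QL … A = {⟨z, y⟩ | ∃ s, ⟨z, y s⟩ ∈ B0}` — the `NP`-type question "does a bad node extend the prefix
`y`?" that drives the refuter's search-to-decision ([ChenEtAl2022, §5.3]: "we can try to find such a
`φ` by a search-to-decision reduction using `A`") — is defined here; its semantics, the prefix
recursion and `QL ∈ NP^A` are proved further below in this file.

## References

* L. Chen, C. Jin, R. Santhanam, R. Williams, *Constructive separations and their consequences*,
  FOCS 2021 = TheoretiCS 3 (2024), §5.3 (proof of Thm. 6) [ChenEtAl2022].
* R. E. Ladner, N. A. Lynch, A. L. Selman, *A comparison of polynomial time reducibilities*, TCS 1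
  (1975), §3 (truth-table reducibility), as in `TruthTableClosure.lean`.
-/

noncomputable section

namespace Literature.Computability.MetaComplexity

open _root_.Computability Polynomial Literature.Computability.Complexity
  Literature.Computability.Complexity.Brick Literature.Computability.Complexity.Plumb
  Literature.Computability.Complexity.BinSearchPP

namespace PPRefuter

/-! ### Transcripts determined by their own queries -/

/-- **A string that answers its own binary-search queries is the transcript**: `|τ| = D` and
`τ[k] = ans (qryNum D (τ ↾ k))` for all `k < D` iff `τ = bsBits D ans D`. [folklore] -/
theorem eq_bsBits_iff {D : ℕ} {ans : List Bool → Bool} {τ : List Bool} (hτ : τ.length = D) :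
    (∀ (k : ℕ) (hk : k < D), τ[k]'(by omega) = ans (qryNum D (τ.take k))) ↔ τ = bsBits D ans D := by
  constructor
  · intro h
    have key : ∀ k ≤ D, τ.take k = bsBits D ans k := by
      intro k
      induction k with
      | zero => intro; rfl
      | succ k ih =>
        intro hk
        rw [List.take_succ_eq_append_getElem (by omega), ih (by omega), bsBits_succ, h k (by omega), ← ih (by omega)]
    have := key D le_rfl
    rwa [List.take_of_length_le (by omega)] at this
  · intro h k hk
    obtain ⟨c, hc, -⟩ := bsBits_decomp (ans := ans) hk
    have htake : τ.take k = bsBits D ans k := by rw [h, bsBits_take hk.le]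
    rw [htake]
    simp only [h]
    rw [List.getElem_of_eq hc, List.getElem_append_right (by simp)]
    simp

/-! ### The truth-table reduction -/

section TT

variable (p PT : Polynomial ℕ) (pad : List Bool × ℕ → List Bool) (hT : List Bool → List Bool) (L' : Language Bool)

/-- `⟨1^{blk}, 1ᵏ⟩ = divMod (i, D₀)` read off `⟨⟨z, w'⟩, 1ⁱ⟩`. [folklore] -/
def dmA : List Bool → List Bool := divModFn ∘ fanoutFn (d0F p PT ∘ fstF ∘ fstF) sndF
/-- The block index `1^{blk}`. [folklore] -/
def blkA : List Bool → List Bool := fstF ∘ dmA p PT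
/-- The digit index `1ᵏ`. [folklore] -/
def kA : List Bool → List Bool := sndF ∘ dmA p PT
/-- The tag suffix of the block: `ε`, `0`, `1` for `blk = 0, 1, 2`. [folklore] -/
def selA : List Bool → List Bool :=
  iteFn (isNilFn ∘ blkA p PT) (fun _ => []) (iteFn (isNilFn ∘ List.tail ∘ blkA p PT) (fun _ => [false]) (fun _ => [true]))
/-- The tag `u · suffix`. [folklore] -/
def tagA : List Bool → List Bool := fun w => (uW p PT ∘ fstF) w ++ selA p PT w
/-- The claimed transcript of the block: `(τᵤτ₀τ₁ ⇂ (i - k)) ↾ D₀`. [folklore] -/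
def tauA : List Bool → List Bool :=
  takeFn ∘ fanoutFn (d0F p PT ∘ fstF ∘ fstF) (dropFn ∘ fanoutFn (dropFn ∘ fanoutFn (kA p PT) sndF) (r2W p PT ∘ fstF))
/-- The numeral `qryNum D₀ (τ ↾ k) = 1^{D₀-1-k} 0 (τ ↾ k)ᴿ`. [folklore] -/
def numA : List Bool → List Bool :=
  fun w => (dropFn ∘ fanoutFn (kA p PT) (List.tail ∘ d0F p PT ∘ fstF ∘ fstF)) w ++
    (List.cons false ∘ List.reverse ∘ takeFn ∘ fanoutFn (kA p PT) (tauA p PT)) w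
/-- **The query generator of the transcript check**: query `i = blk·D₀ + k` is the threshold query
`tq (tag blk) (qryNum D₀ (τ_blk ↾ k))`, padded to `|z|`. [cite: ChenEtAl2022, §5.3 (proof of Thm. 6)] -/
def qttF : List Bool → List Bool :=
  padRed pad hT ∘ fanoutFn (fanoutFn (xW PT ∘ fstF) (fanoutFn (tagA p PT) (numA p PT))) (fstF ∘ fstF)

/-- The evaluator's one-bit function on `⟨⟨z, w'⟩, bits⟩`: well formed, the first `3D₀` answer bits
are the claimed transcripts, and the claimed values are locally inconsistent. [cite: ChenEtAl2022, §5.3 (proof of Thm. 6)] -/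
def dttF : List Bool → List Bool :=
  andFn (wfW p PT ∘ fstF) (andFn (eqPairFn ∘ fanoutFn (takeFn ∘ fanoutFn (d3F p PT ∘ fstF ∘ fstF) sndF) (r2W p PT ∘ fstF))
    (badW p PT L' ∘ fstF))

/-- The evaluator language. [folklore] -/
def DttL : Language Bool := {w | dttF p PT L' w = [true]}

/-- The round polynomial `3(p + 2)` (`≥ 3D₀`). [folklore] -/
def qtt : Polynomial ℕ := 3 * (p + 2)

/-- **The witness language** `B0 = {⟨z, w'⟩ | w' is a well-formed, correctly transcribed, locally
inconsistent witness at the level of |z| against `A`}`, as a truth-table reduction to `A`.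
[cite: ChenEtAl2022, §5.3 (proof of Thm. 6)] -/
def B0 (A : Language Bool) : Language Bool := ttLang (qttF p PT pad hT) (qtt p) (DttL p PT L') A

/-- **The search language** `QL = {⟨z, y⟩ | ∃ s, ⟨z, y ++ s⟩ ∈ B0}` ("is there a bad node below the
prefix `y`?"), read through the total projections. [cite: ChenEtAl2022, §5.3 (proof of Thm. 6)] -/
def QL (A : Language Bool) : Language Bool := {v | ∃ s : List Bool, boolPair (fstF v) (sndF v ++ s) ∈ B0 p PT pad hT L' A}

variable {p PT pad hT L'}

/-! #### `FP` / `P` membership -/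

/-- `dmA ∈ FP`. [folklore] -/
theorem dmA_mem_FP : dmA p PT ∈ FP :=
  comp_mem_FP divModFn_mem_FP (fanoutFn_mem_FP (comp_mem_FP d0F_mem_FP (comp_mem_FP fstF_mem_FP fstF_mem_FP)) sndF_mem_FP)
/-- `blkA ∈ FP`. [folklore] -/
theorem blkA_mem_FP : blkA p PT ∈ FP := comp_mem_FP fstF_mem_FP dmA_mem_FP
/-- `kA ∈ FP`. [folklore] -/
theorem kA_mem_FP : kA p PT ∈ FP := comp_mem_FP sndF_mem_FP dmA_mem_FP
/-- `selA ∈ FP`. [folklore] -/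
theorem selA_mem_FP : selA p PT ∈ FP :=
  iteFn_mem_FP (comp_mem_FP isNilFn_mem_FP blkA_mem_FP) (const_mem_FP _)
    (iteFn_mem_FP (comp_mem_FP isNilFn_mem_FP (comp_mem_FP PRelSigma.tail_mem_FP blkA_mem_FP)) (const_mem_FP _) (const_mem_FP _))
/-- `tagA ∈ FP`. [folklore] -/
theorem tagA_mem_FP : tagA p PT ∈ FP := append_mem_FP (comp_mem_FP uW_mem_FP fstF_mem_FP) selA_mem_FP
/-- `tauA ∈ FP`. [folklore] -/
theorem tauA_mem_FP : tauA p PT ∈ FP :=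
  comp_mem_FP takeFn_mem_FP (fanoutFn_mem_FP (comp_mem_FP d0F_mem_FP (comp_mem_FP fstF_mem_FP fstF_mem_FP))
    (comp_mem_FP dropFn_mem_FP (fanoutFn_mem_FP (comp_mem_FP dropFn_mem_FP (fanoutFn_mem_FP kA_mem_FP sndF_mem_FP))
      (comp_mem_FP r2W_mem_FP fstF_mem_FP))))
/-- `numA ∈ FP`. [folklore] -/
theorem numA_mem_FP : numA p PT ∈ FP :=
  append_mem_FP (comp_mem_FP dropFn_mem_FP (fanoutFn_mem_FP kA_mem_FP
      (comp_mem_FP PRelSigma.tail_mem_FP (comp_mem_FP d0F_mem_FP (comp_mem_FP fstF_mem_FP fstF_mem_FP)))))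
    (comp_mem_FP (cons_mem_FP false) (comp_mem_FP reverse_mem_FP (comp_mem_FP takeFn_mem_FP (fanoutFn_mem_FP kA_mem_FP tauA_mem_FP))))
/-- **`qttF ∈ FP`** when `pad` is polynomial time and `hT ∈ FP`. [folklore] -/
theorem qttF_mem_FP
    (hpad : PolyTimeComputable (fun q : List Bool × ℕ => boolPair q.1 (unaryEncodeNat q.2)) (id : List Bool → List Bool) pad)
    (hh : hT ∈ FP) : qttF p PT pad hT ∈ FP :=
  comp_mem_FP (padRed_mem_FP hpad hh) (fanoutFn_mem_FP (fanoutFn_mem_FP (comp_mem_FP xW_mem_FP fstF_mem_FP)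
    (fanoutFn_mem_FP tagA_mem_FP numA_mem_FP)) (comp_mem_FP fstF_mem_FP fstF_mem_FP))
/-- `dttF ∈ FP` for `L' ∈ P`. [folklore] -/
theorem dttF_mem_FP (hL' : L' ∈ Classes.P) : dttF p PT L' ∈ FP :=
  andFn_mem_FP (comp_mem_FP wfW_mem_FP fstF_mem_FP) (andFn_mem_FP
    (comp_mem_FP eqPairFn_mem_FP (fanoutFn_mem_FP (comp_mem_FP takeFn_mem_FP
      (fanoutFn_mem_FP (comp_mem_FP d3F_mem_FP (comp_mem_FP fstF_mem_FP fstF_mem_FP)) sndF_mem_FP)) (comp_mem_FP r2W_mem_FP fstF_mem_FP)))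
    (comp_mem_FP (badW_mem_FP hL') fstF_mem_FP))

/-- `wfW` is one-bit. [folklore] -/
theorem oneBit_wfW : OneBit (wfW p PT) := by
  refine OneBit.ite (fun v => ?_) (fun v => ?_) (oneBit_const false)
  · rcases lenLeFn_eq_or X (fanoutFn (r1W PT) (d3F p PT ∘ fstF) v) with h | h
    · exact ⟨true, h⟩
    · exact ⟨false, h⟩
  · rcases lenLeFn_eq_or X (fanoutFn (mF p PT ∘ fstF) (jW p PT) v) with h | h
    · exact ⟨true, h⟩
    · exact ⟨false, h⟩

/-- `dttF` is one-bit. [folklore] -/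
theorem oneBit_dttF : OneBit (dttF p PT L') := by
  refine oneBit_andFn (oneBit_wfW.comp _) (oneBit_andFn (fun w => ?_) (oneBit_badW.comp _))
  rcases eqPairFn_eq_or (fanoutFn (takeFn ∘ fanoutFn (d3F p PT ∘ fstF ∘ fstF) sndF) (r2W p PT ∘ fstF) w) with h | h
  · exact ⟨true, h⟩
  · exact ⟨false, h⟩

/-- **`DttL ∈ P`** for `L' ∈ P`. [folklore] -/
theorem DttL_mem_P (hL' : L' ∈ Classes.P) : DttL p PT L' ∈ Classes.P :=
  mem_P_of_mem_FP (dttF_mem_FP hL') _ fun w =>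
    ⟨fun h => h, fun h => by
      obtain ⟨b, hb⟩ := oneBit_dttF (p := p) (PT := PT) (L' := L') w
      cases b
      · exact hb
      · exact absurd hb h⟩

/-- **`B0 ∈ P^A`.** [cite: ChenEtAl2022, §5.3 (proof of Thm. 6)] -/
theorem B0_mem_PRel
    (hpad : PolyTimeComputable (fun q : List Bool × ℕ => boolPair q.1 (unaryEncodeNat q.2)) (id : List Bool → List Bool) pad)
    (hh : hT ∈ FP) (hL' : L' ∈ Classes.P) (A : Language Bool) : B0 p PT pad hT L' A ∈ PRel (Oracle.ofLanguage A) :=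
  ttLang_mem_PRel (qttF_mem_FP hpad hh) (DttL_mem_P hL') A

/-! #### Values of the query generator on a parsed witness -/

section Values

variable {z x u τu τ0 τ1 : List Bool} {A : Language Bool}

local notation "nn" => lev PT (List.length z)
local notation "mm" => Polynomial.eval (lev PT (List.length z)) p
local notation "DD" => Polynomial.eval (lev PT (List.length z)) p + 2

/-- The tag and transcript of block `blk`. [folklore] -/
def tagOf (u : List Bool) : ℕ → List Bool
  | 0 => u
  | 1 => u ++ [false]
  | _ => u ++ [true]

/-- The transcript of block `blk`. [folklore] -/
def tauOf (τu τ0 τ1 : List Bool) : ℕ → List Bool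
  | 0 => τu
  | 1 => τ0
  | _ => τ1

/-- `u ++ tagOf [] b = tagOf u b`. [folklore] -/
theorem append_tagOf_nil (u : List Bool) : ∀ b, u ++ tagOf [] b = tagOf u b
  | 0 => by simp [tagOf]
  | 1 => by simp [tagOf]
  | _ + 2 => by simp [tagOf]

/-- `|tauOf τᵤ τ₀ τ₁ b|` when all three have length `D`. [folklore] -/
theorem length_tauOf {D : ℕ} (hu : τu.length = D) (h0 : τ0.length = D) (h1 : τ1.length = D) :
    ∀ b, (tauOf τu τ0 τ1 b).length = D
  | 0 => hu
  | 1 => h0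
  | _ + 2 => h1

/-- A number below `3` is `0`, `1` or `2`. [folklore] -/
theorem lt_three_cases {q : ℕ} (h : q < 3) : q = 0 ∨ q = 1 ∨ q = 2 := by omega

/-- `isNilFn (1ⁿ) = [n = 0]`. [folklore] -/
theorem isNilFn_ones (n : ℕ) : isNilFn (ones n) = [decide (n = 0)] := by
  cases n <;> simp [isNilFn, ones, List.replicate_succ]

/-- `isNilFn ((1ⁿ).tail) = [n ≤ 1]`. [folklore] -/
theorem isNilFn_tail_ones (n : ℕ) : isNilFn (ones n).tail = [decide (n ≤ 1)] := by
  rcases n with _ | _ | n <;> simp [isNilFn, ones, List.replicate_succ]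

/-- **Value of the query generator**: on `⟨⟨z, wit x u τᵤ τ₀ τ₁⟩, 1ⁱ⟩` with `i / D₀ < 3` the query is
`tq pad hT |z| x (tagOf u (i / D₀)) (qryNum D₀ ((tauOf τᵤ τ₀ τ₁ (i / D₀)) ↾ (i % D₀)))`.
[cite: ChenEtAl2022, §5.3 (proof of Thm. 6)] -/
theorem qttF_wit (hx : x.length = nn) (hu : τu.length = DD) (h0 : τ0.length = DD) (h1 : τ1.length = DD)
    {i : ℕ} (hblk : i / (DD) < 3) :
    qttF p PT pad hT (boolPair (boolPair z (wit x u τu τ0 τ1)) (ones i)) =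
      tq pad hT z.length x (tagOf u (i / (DD))) (qryNum (DD) ((tauOf τu τ0 τ1 (i / (DD))).take (i % (DD)))) := by
  have hk : i % (DD) < DD := Nat.mod_lt _ (by omega)
  have hdm : dmA p PT (boolPair (boolPair z (wit x u τu τ0 τ1)) (ones i)) = boolPair (ones (i / (DD))) (ones (i % (DD))) := by
    simp only [dmA, Function.comp_apply, fanoutFn_apply, fstF_boolPair, sndF_boolPair, d0F_apply]
    exact divModFn_boolPair _ _
  have hblkA : blkA p PT (boolPair (boolPair z (wit x u τu τ0 τ1)) (ones i)) = ones (i / (DD)) := by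
    rw [blkA, Function.comp_apply, hdm, fstF_boolPair]
  have hkA : kA p PT (boolPair (boolPair z (wit x u τu τ0 τ1)) (ones i)) = ones (i % (DD)) := by
    rw [kA, Function.comp_apply, hdm, sndF_boolPair]
  have hc1 : (isNilFn ∘ blkA p PT) (boolPair (boolPair z (wit x u τu τ0 τ1)) (ones i)) = [decide (i / (DD) = 0)] := by
    rw [Function.comp_apply, hblkA, isNilFn_ones]
  have hc2 : (isNilFn ∘ List.tail ∘ blkA p PT) (boolPair (boolPair z (wit x u τu τ0 τ1)) (ones i)) =
      [decide (i / (DD) ≤ 1)] := by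
    rw [Function.comp_apply, Function.comp_apply, hblkA, isNilFn_tail_ones]
  have hsel : selA p PT (boolPair (boolPair z (wit x u τu τ0 τ1)) (ones i)) = tagOf [] (i / (DD)) := by
    obtain hb | hb | hb := lt_three_cases hblk
    · rw [selA, iteFn_apply_true (by rw [hc1, hb]; rfl), hb]; rfl
    · rw [selA, iteFn_apply_false (by rw [hc1, hb]; rfl), iteFn_apply_true (by rw [hc2, hb]; rfl), hb]; rfl
    · rw [selA, iteFn_apply_false (by rw [hc1, hb]; rfl), iteFn_apply_false (by rw [hc2, hb]; rfl), hb]; rfl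
  have htag : tagA p PT (boolPair (boolPair z (wit x u τu τ0 τ1)) (ones i)) = tagOf u (i / (DD)) := by
    rw [tagA, Function.comp_apply, fstF_boolPair, uW_wit hx hu h0 h1, hsel, append_tagOf_nil]
  have hsub : i - i % (DD) = (DD) * (i / (DD)) := (Nat.eq_sub_of_add_eq (Nat.div_add_mod i (DD))).symm
  have htau : tauA p PT (boolPair (boolPair z (wit x u τu τ0 τ1)) (ones i)) = tauOf τu τ0 τ1 (i / (DD)) := by
    simp only [tauA, Function.comp_apply, fanoutFn_apply, fstF_boolPair, sndF_boolPair, hkA, d0F_apply,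
      r2W_wit hx hu h0 h1, dropFn_boolPair, takeFn_boolPair, List.length_replicate, List.length_drop]
    rw [hsub]
    obtain hb | hb | hb := lt_three_cases hblk
    · rw [hb, Nat.mul_zero, List.drop_zero, List.take_left' hu]; rfl
    · rw [hb, Nat.mul_one, List.drop_left' hu, List.take_left' h0]; rfl
    · rw [hb, Nat.mul_two, ← List.drop_drop, List.drop_left' hu, List.drop_left' h0, List.take_of_length_le h1.le]; rfl
  have hnum : numA p PT (boolPair (boolPair z (wit x u τu τ0 τ1)) (ones i)) =
      qryNum (DD) ((tauOf τu τ0 τ1 (i / (DD))).take (i % (DD))) := by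
    have hlen : ((tauOf τu τ0 τ1 (i / (DD))).take (i % (DD))).length = i % (DD) := by
      rw [List.length_take, length_tauOf hu h0 h1, min_eq_left hk.le]
    simp only [numA, Function.comp_apply, fanoutFn_apply, fstF_boolPair, hkA, htau, d0F_apply, dropFn_boolPair,
      takeFn_boolPair, List.length_replicate, qryNum, hlen, ones, List.tail_replicate, List.drop_replicate]
  simp only [qttF, Function.comp_apply, fanoutFn_apply, fstF_boolPair]
  rw [htag, hnum, xW_wit hx, padRed_apply, tq]

end Values

end TT

end PPRefuter

end Literature.Computability.MetaComplexity

end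


/-!
# Part 4. Semantics of the witness language and of the search language of the `PP` refuter

Topic `Computability/MetaComplexity` (refuters for `PP`, Chen–Jin–Santhanam–Williams [ChenEtAl2022],
§5.3), semantics of `B0` and `QL` (continuing the previous section of this file).

* `mem_B0_wit_iff` — a parsed witness `⟨z, x u τᵤ τ₀ τ₁⟩` is in `B0 … A` iff `|u| ≤ m`, the three
  transcripts are `A`'s binary-search transcripts at `u, u0, u1` through the padded threshold
  embedding `tq` (`PPRefuter.bsBits`; test `transOK`), and the claimed values are locally inconsistent
  (`badVal`: `badNode` / leaf mismatch);
* `exists_wit_of_mem_B0` — every member decomposes as such a witness; `length_le_of_mem_B0`;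
* `mem_QL_iff`, `mem_QL_iff_or` (the prefix recursion of the descent), `length_le_of_mem_QL`,
  and **`QL_mem_NPRel`**: `QL … A ∈ NP^A`.

## References

* L. Chen, C. Jin, R. Santhanam, R. Williams, *Constructive separations and their consequences*,
  FOCS 2021 = TheoretiCS 3 (2024), §5.3 (proof of Thm. 6) [ChenEtAl2022].
-/

noncomputable section

namespace Literature.Computability.MetaComplexity

open _root_.Computability Polynomial Literature.Computability.Complexity
  Literature.Computability.Complexity.Brick Literature.Computability.Complexity.Plumb
  Literature.Computability.Complexity.BinSearchPP

namespace PPRefuter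

section Sem

variable {p PT : Polynomial ℕ} {pad : List Bool × ℕ → List Bool} {hT : List Bool → List Bool} {L' A : Language Bool}
variable {z x u τu τ0 τ1 : List Bool}

local notation "nn" => lev PT (List.length z)
local notation "mm" => Polynomial.eval (lev PT (List.length z)) p
local notation "DD" => Polynomial.eval (lev PT (List.length z)) p + 2

/-! ### Blocks of the truth table -/

/-- The answer bits are a `map` over `range`: taking a prefix. [folklore] -/
theorem take_ttBits (Q : List Bool → List Bool) (A : Language Bool) (v : List Bool) (M K : ℕ) :
    (ttBits Q A v M).take K = ttBits Q A v (min K M) := by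
  simp [ttBits, ← List.map_take, List.take_range]

/-- The answer bits of an interval: `ttBits (a + b) = ttBits a ++ (answers a … a+b-1)`. [folklore] -/
theorem ttBits_add (Q : List Bool → List Bool) (A : Language Bool) (v : List Bool) (a b : ℕ) :
    ttBits Q A v (a + b) = ttBits Q A v a ++ (List.range b).map fun k => A.boolIndicator (Q (boolPair v (ones (a + k)))) := by
  simp [ttBits, List.range_add, ones]

/-- **A block of answer bits is a transcript iff it satisfies the search recursion.** For `|τ| = D`:
`τ = [ans(q₀)], …, [ans(q_{D-1})]` with `q_k = qryNum D (τ ↾ k)` iff `τ = bsBits D ans D`. [folklore] -/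
theorem eq_map_range_iff_eq_bsBits {D : ℕ} {ans : List Bool → Bool} {τ : List Bool} (hτ : τ.length = D) :
    τ = (List.range D).map (fun k => ans (qryNum D (τ.take k))) ↔ τ = bsBits D ans D := by
  rw [← eq_bsBits_iff hτ]
  constructor
  · intro h k hk
    rw [List.getElem_of_eq h]
    simp
  · intro h
    refine List.ext_getElem (by simp [hτ]) fun k h1 h2 => ?_
    rw [h k (by omega)]
    simp

/-! ### Membership of a parsed witness -/

/-- The local-inconsistency test of a parsed witness (values read off the transcripts): `badNode` at
an inner node, the leaf mismatch `c ≠ [⟨x,u⟩ ∈ L']` at a leaf. [cite: ChenEtAl2022, §5.3 (proof of Thm. 6)] -/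
def badVal (L' : Language Bool) (m : ℕ) (x u τu τ0 τ1 : List Bool) : Bool :=
  if u.length < m then
    badNode (bitsToNat τu.reverse) (bitsToNat τ0.reverse) (bitsToNat τ1.reverse) (2 ^ (m - u.length))
  else decide (bitsToNat τu.reverse ≠ (L'.boolIndicator (boolPair x u)).toNat)

/-- The transcript test: the three blocks are `A`'s transcripts through `tq`. [cite: ChenEtAl2022, §5.3 (proof of Thm. 6)] -/
def transOK (pad : List Bool × ℕ → List Bool) (hT : List Bool → List Bool) (A : Language Bool) (N D : ℕ)
    (x u τu τ0 τ1 : List Bool) : Bool :=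
  decide (τu = bsBits D (ansOf A (tq pad hT N x) u) D) && (decide (τ0 = bsBits D (ansOf A (tq pad hT N x) (u ++ [false])) D) &&
    decide (τ1 = bsBits D (ansOf A (tq pad hT N x) (u ++ [true])) D))

/-- Reading the transcript test. [folklore] -/
theorem transOK_eq_true_iff (pad : List Bool × ℕ → List Bool) (hT : List Bool → List Bool) (A : Language Bool) (N D : ℕ)
    (x u τu τ0 τ1 : List Bool) :
    transOK pad hT A N D x u τu τ0 τ1 = true ↔
      τu = bsBits D (ansOf A (tq pad hT N x) u) D ∧ τ0 = bsBits D (ansOf A (tq pad hT N x) (u ++ [false])) D ∧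
        τ1 = bsBits D (ansOf A (tq pad hT N x) (u ++ [true])) D := by
  simp only [transOK, Bool.and_eq_true, decide_eq_true_eq]

/-- Membership in the evaluator language (definitional). [folklore] -/
theorem mem_DttL_iff (w : List Bool) : w ∈ DttL p PT L' ↔ dttF p PT L' w = [true] := Iff.rfl

/-- **Membership of a parsed witness in `B0`.** [cite: ChenEtAl2022, §5.3 (proof of Thm. 6)] -/
theorem mem_B0_wit_iff (hx : x.length = nn) (hu : τu.length = DD) (h0 : τ0.length = DD) (h1 : τ1.length = DD) :
    boolPair z (wit x u τu τ0 τ1) ∈ B0 p PT pad hT L' A ↔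
      u.length ≤ mm ∧ transOK pad hT A z.length (DD) x u τu τ0 τ1 = true ∧ badVal L' (mm) x u τu τ0 τ1 = true := by
  set v := boolPair z (wit x u τu τ0 τ1) with hv
  -- the three conjuncts of the evaluator
  have hwf : (wfW p PT ∘ fstF) (boolPair v (ttBits (qttF p PT pad hT) A v ((qtt p).eval v.length))) =
      [decide (u.length ≤ mm)] := by
    rw [Function.comp_apply, fstF_boolPair, hv, wfW_wit hx hu h0 h1]
  have hbad : (badW p PT L' ∘ fstF) (boolPair v (ttBits (qttF p PT pad hT) A v ((qtt p).eval v.length))) =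
      [badVal L' (mm) x u τu τ0 τ1] := by
    rw [Function.comp_apply, fstF_boolPair, hv, badW_wit hx hu h0 h1]
    unfold badVal
    split_ifs <;> rfl
  -- the first `3D₀` answer bits
  have hlev : nn ≤ v.length := by
    rw [hv, length_boolPair]; exact (lev_le _).trans (by omega)
  have hrounds : 3 * (DD) ≤ (qtt p).eval v.length := by
    simp only [qtt, eval_mul, eval_add, eval_ofNat]
    have := TM2Iter.eval_mono p hlev
    omega
  have htake : (ttBits (qttF p PT pad hT) A v ((qtt p).eval v.length)).take (3 * (DD)) =
      ttBits (qttF p PT pad hT) A v (3 * (DD)) := by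
    rw [take_ttBits, min_eq_left hrounds]
  set blkBits : ℕ → List Bool := fun t => (List.range (DD)).map fun k =>
    ansOf A (tq pad hT z.length x) (tagOf u t) (qryNum (DD) ((tauOf τu τ0 τ1 t).take k)) with hblk
  have hblock : ∀ t < 3, ∀ o : ℕ, o = t * (DD) →
      ((List.range (DD)).map fun k => A.boolIndicator (qttF p PT pad hT (boolPair v (ones (o + k))))) = blkBits t := by
    intro t ht o ho
    refine List.map_congr_left fun k hk => ?_
    rw [List.mem_range] at hk
    have hdiv : (o + k) / (DD) = t := by
      rw [ho, Nat.add_comm, Nat.add_mul_div_right _ _ (by omega), Nat.div_eq_of_lt hk, Nat.zero_add]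
    have hmod : (o + k) % (DD) = k := by
      rw [ho, Nat.add_comm, Nat.add_mul_mod_self_right, Nat.mod_eq_of_lt hk]
    rw [hv, qttF_wit hx hu h0 h1 (by rw [hdiv]; exact ht), hdiv, hmod]
    rfl
  have hblock0 : ttBits (qttF p PT pad hT) A v (DD) = blkBits 0 := by
    rw [← hblock 0 (by norm_num) 0 (by ring)]
    simp [ttBits, ones]
  have hbits : ttBits (qttF p PT pad hT) A v (3 * (DD)) = blkBits 0 ++ (blkBits 1 ++ blkBits 2) := by
    rw [show 3 * (DD) = (DD) + (DD) + (DD) by ring, ttBits_add, ttBits_add, hblock0, hblock 1 (by norm_num) _ (by ring),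
      hblock 2 (by norm_num) _ (by ring), List.append_assoc]
  have heqt : (eqPairFn ∘ fanoutFn (takeFn ∘ fanoutFn (d3F p PT ∘ fstF ∘ fstF) sndF) (r2W p PT ∘ fstF))
      (boolPair v (ttBits (qttF p PT pad hT) A v ((qtt p).eval v.length))) =
      [transOK pad hT A z.length (DD) x u τu τ0 τ1] := by
    simp only [Function.comp_apply, fanoutFn_apply, fstF_boolPair, sndF_boolPair, hv, r2W_wit hx hu h0 h1, takeFn_boolPair,
      eqPairFn_boolPair]
    rw [← hv]
    have hlen3 : (d3F p PT z).length = 3 * (DD) := by simp [d3F]; ring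
    rw [hlen3, htake, hbits]
    congr 1
    rw [Bool.eq_iff_iff, decide_eq_true_eq, transOK_eq_true_iff]
    have hl0 : (blkBits 0).length = τu.length := by simp [hblk, hu]
    have hl1 : (blkBits 1).length = τ0.length := by simp [hblk, h0]
    constructor
    · intro h
      obtain ⟨e0, e12⟩ := List.append_inj h.symm hl0.symm
      obtain ⟨e1, e2⟩ := List.append_inj e12 hl1.symm
      exact ⟨(eq_map_range_iff_eq_bsBits hu).1 e0, (eq_map_range_iff_eq_bsBits h0).1 e1, (eq_map_range_iff_eq_bsBits h1).1 e2⟩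
    · rintro ⟨e0, e1, e2⟩
      have f0 : blkBits 0 = τu := ((eq_map_range_iff_eq_bsBits hu).2 e0).symm
      have f1 : blkBits 1 = τ0 := ((eq_map_range_iff_eq_bsBits h0).2 e1).symm
      have f2 : blkBits 2 = τ1 := ((eq_map_range_iff_eq_bsBits h1).2 e2).symm
      rw [f0, f1, f2]
  rw [B0, mem_ttLang_iff, mem_DttL_iff, dttF, andFn_apply hwf (andFn_apply heqt hbad)]
  simp only [List.cons.injEq, and_true, Bool.and_eq_true, decide_eq_true_eq]

/-! ### Decomposing an arbitrary member -/

/-- `r1W` on any pair. [folklore] -/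
theorem r1W_apply (w : List Bool) : r1W PT (boolPair z w) = w.drop (nn) := by
  simp [r1W]

/-- A string long enough is a witness string with the intended field lengths. [folklore] -/
theorem exists_eq_wit {w : List Bool} (hw : nn + 3 * (DD) ≤ w.length) :
    ∃ x u τu τ0 τ1 : List Bool, w = wit x u τu τ0 τ1 ∧ x.length = nn ∧ τu.length = DD ∧ τ0.length = DD ∧ τ1.length = DD ∧
      u.length = w.length - nn - 3 * (DD) := by
  refine ⟨w.take (nn), (w.drop (nn)).take (w.length - nn - 3 * (DD)),
    (((w.drop (nn)).drop (w.length - nn - 3 * (DD)))).take (DD),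
    ((((w.drop (nn)).drop (w.length - nn - 3 * (DD)))).drop (DD)).take (DD),
    ((((w.drop (nn)).drop (w.length - nn - 3 * (DD)))).drop (DD)).drop (DD), ?_, ?_, ?_, ?_, ?_, ?_⟩
  · simp only [wit, List.take_append_drop]
  all_goals simp <;> omega

/-- Short strings are not witnesses: the well-formedness bit is `0`. [folklore] -/
theorem wfW_of_short {w : List Bool} (hw : w.length < nn + 3 * (DD)) : wfW p PT (boolPair z w) = [false] := by
  have hc : (lenLeFn X ∘ fanoutFn (r1W PT) (d3F p PT ∘ fstF)) (boolPair z w) = [false] := by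
    rw [Function.comp_apply, fanoutFn_apply, r1W_apply, lenLeFn_boolPair]
    simp [d3F]; omega
  rw [wfW, andFn, iteFn_apply_false hc]

/-- **Every member of `B0` is a parsed witness** with `|u| ≤ m`, correct transcripts and a local
inconsistency. [cite: ChenEtAl2022, §5.3 (proof of Thm. 6)] -/
theorem exists_wit_of_mem_B0 {w : List Bool} (hw : boolPair z w ∈ B0 p PT pad hT L' A) :
    ∃ x u τu τ0 τ1 : List Bool, w = wit x u τu τ0 τ1 ∧ x.length = nn ∧ τu.length = DD ∧ τ0.length = DD ∧ τ1.length = DD ∧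
      u.length ≤ mm ∧ transOK pad hT A z.length (DD) x u τu τ0 τ1 = true ∧ badVal L' (mm) x u τu τ0 τ1 = true := by
  by_cases hlen : nn + 3 * (DD) ≤ w.length
  · obtain ⟨x, u, τu, τ0, τ1, rfl, hx, hu, h0, h1, -⟩ := exists_eq_wit (p := p) hlen
    obtain ⟨hum, ht, hb⟩ := (mem_B0_wit_iff hx hu h0 h1).1 hw
    exact ⟨x, u, τu, τ0, τ1, rfl, hx, hu, h0, h1, hum, ht, hb⟩
  · exfalso
    rw [B0, mem_ttLang_iff, mem_DttL_iff, dttF, andFn, iteFn_apply_false] at hw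
    · exact Bool.false_ne_true (List.cons.inj hw).1
    · rw [Function.comp_apply, fstF_boolPair, wfW_of_short (by omega)]

/-- Members of `B0` are short: `|w| ≤ n + m + 3D₀`. [folklore] -/
theorem length_le_of_mem_B0 {w : List Bool} (hw : boolPair z w ∈ B0 p PT pad hT L' A) :
    w.length ≤ nn + mm + 3 * (DD) := by
  obtain ⟨x, u, τu, τ0, τ1, rfl, hx, hu, h0, h1, hum, -, -⟩ := exists_wit_of_mem_B0 hw
  simp [wit, hx, hu, h0, h1]; omega

/-! ### The search language -/

/-- Membership in `QL` of a well-formed pair. [folklore] -/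
theorem mem_QL_iff (z y : List Bool) :
    boolPair z y ∈ QL p PT pad hT L' A ↔ ∃ s : List Bool, boolPair z (y ++ s) ∈ B0 p PT pad hT L' A := by
  change (∃ s : List Bool, boolPair (fstF (boolPair z y)) (sndF (boolPair z y) ++ s) ∈ B0 p PT pad hT L' A) ↔ _
  rw [fstF_boolPair, sndF_boolPair]

/-- **The prefix recursion of the descent**: a bad node lies below `y` iff `y` is itself a witness, or
a bad node lies below `y0`, or below `y1`. [cite: ChenEtAl2022, §5.3 (proof of Thm. 6)] -/
theorem mem_QL_iff_or (z y : List Bool) :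
    boolPair z y ∈ QL p PT pad hT L' A ↔ boolPair z y ∈ B0 p PT pad hT L' A ∨
      boolPair z (y ++ [false]) ∈ QL p PT pad hT L' A ∨ boolPair z (y ++ [true]) ∈ QL p PT pad hT L' A := by
  rw [mem_QL_iff, mem_QL_iff, mem_QL_iff]
  constructor
  · rintro ⟨s, hs⟩
    rcases s with _ | ⟨b, s⟩
    · left; simpa using hs
    · rw [List.append_cons] at hs
      cases b
      · exact Or.inr (Or.inl ⟨s, hs⟩)
      · exact Or.inr (Or.inr ⟨s, hs⟩)
  · rintro (h | ⟨s, hs⟩ | ⟨s, hs⟩)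
    · exact ⟨[], by simpa using h⟩
    · exact ⟨false :: s, by rwa [List.append_cons]⟩
    · exact ⟨true :: s, by rwa [List.append_cons]⟩

/-- Prefixes with a bad node below are short. [folklore] -/
theorem length_le_of_mem_QL {y : List Bool} (hy : boolPair z y ∈ QL p PT pad hT L' A) : y.length ≤ nn + mm + 3 * (DD) := by
  obtain ⟨s, hs⟩ := (mem_QL_iff z y).1 hy
  have := length_le_of_mem_B0 hs
  rw [List.length_append] at this
  omega

/-- **`QL ∈ NP^A`**: the witness `s` has polynomial length (members of `B0` are short) and the verifier
`{⟨v, s⟩ | ⟨fst v, snd v ++ s⟩ ∈ B0}` is a polynomial-time preimage of `B0 ∈ P^A`.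
[cite: ChenEtAl2022, §5.3 (proof of Thm. 6: "an NP question … since NP ⊆ PP")] -/
theorem QL_mem_NPRel
    (hpad : PolyTimeComputable (fun q : List Bool × ℕ => boolPair q.1 (unaryEncodeNat q.2)) (id : List Bool → List Bool) pad)
    (hh : hT ∈ FP) (hL' : L' ∈ Classes.P) (A : Language Bool) : QL p PT pad hT L' A ∈ NPRel (Oracle.ofLanguage A) := by
  set g : List Bool → List Bool := fanoutFn (fstF ∘ fstF) (appF ∘ fanoutFn (sndF ∘ fstF) sndF) with hg
  have hgFP : g ∈ FP := fanoutFn_mem_FP (comp_mem_FP fstF_mem_FP fstF_mem_FP)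
    (comp_mem_FP appF_mem_FP (fanoutFn_mem_FP (comp_mem_FP sndF_mem_FP fstF_mem_FP) sndF_mem_FP))
  have hg_apply : ∀ v s : List Bool, g (boolPair v s) = boolPair (fstF v) (sndF v ++ s) := by
    intro v s; simp [hg, appF]
  refine ⟨g ⁻¹' B0 p PT pad hT L' A, preimage_mem_PRel (B0_mem_PRel hpad hh hL' A) hgFP, X + p + 3 * (p + 2), fun v => ?_⟩
  constructor
  · rintro ⟨s, hs⟩
    refine ⟨s, ?_, by rw [memL_preimage, hg_apply]; exact hs⟩
    have hb := length_le_of_mem_B0 hs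
    have h1 : (fstF v).length ≤ v.length := by have := length_fstF_sndF_le v; omega
    have h2 : lev PT (fstF v).length ≤ v.length := (lev_le _).trans h1
    have h3 := TM2Iter.eval_mono p h2
    rw [List.length_append] at hb
    simp only [eval_add, eval_X, eval_mul, eval_ofNat]
    omega
  · rintro ⟨s, -, hs⟩
    rw [memL_preimage, hg_apply] at hs
    exact ⟨s, hs⟩

end Sem

end PPRefuter

end Literature.Computability.MetaComplexity

end


/-!
# Part 5. The core of the `PP` refuter: the prefix descent as one adaptive transducer, and its stopping level

Topic `Computability/MetaComplexity` (refuters for `PP`, Chen–Jin–Santhanam–Williams [ChenEtAl2022],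
§5.3 with §5.1), machine layer.

The refuter's interaction with the refuted algorithm `A` is ONE bounded adaptive oracle transducer
(`AdaptiveFunctions.adFn`, so that `AdaptiveBPPSimulation.exists_randAlg_adFn_unary` turns it into a
pseudo-deterministic `BPP` computation): on input `z = 1ᴺ` (level `n`, depth `Δ = n + m + 3D₀`,
`RefuterParams`), with the search questions `qq y = pad (hQ ⟨z, y⟩, N')` (padded Karp images of the
search language `QL` of Parts 3–4),

* rounds `d < Δ` (the DESCENT, adaptive): ask `qq (y_d · 1)` where `y_d` = the answers so far, so
  the answers ARE the path `Y` ("we gradually extend the prefix … in the same way", [ChenEtAl2022,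
  §5.2–5.3]); against `A` the path is `pathBits A … d` (`adBits_coreQ_of_le`);
* round `Δ`: ask `qq ε`; rounds `Δ + 1 + d`, `d < Δ`: ask `qq (y_d · 0)` (non-adaptive given `Y`);
  the first `2Δ + 1` answer bits after any `R ≥ 2Δ + 1` rounds are `path ++ phaseB` (`adBits_coreQ_take`).

The query generator `coreQ` is in `FP` (`coreQ_mem_FP`, value `coreQ_apply`). The output side begins
here with the **stopping level** `d*` = the first `d ≤ Δ` with `(d = 0 ∧ α(ε) = 0)`, or
`(d < Δ ∧ α(y_d0) = α(y_d1) = 0)`, or `d = Δ` — computed by a counted fold (`dstarF`, value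
`dstarF_apply` on the true answer string) — and the record `⟨z, y_{d*}⟩` handed to the slot builders
(`prepF`; the slot builders follow below).

## References

* L. Chen, C. Jin, R. Santhanam, R. Williams, *Constructive separations and their consequences*,
  FOCS 2021 = TheoretiCS 3 (2024), §5.1 (Algorithm 1, the list-refuter), §5.3 [ChenEtAl2022].
-/

noncomputable section

namespace Literature.Computability.MetaComplexity

open _root_.Computability Polynomial Literature.Computability.Complexity
  Literature.Computability.Complexity.Brick Literature.Computability.Complexity.Plumb
  Literature.Computability.Complexity.AdQuery

namespace PPRefuter

section Core

variable (p PT PQ : Polynomial ℕ) (pad : List Bool × ℕ → List Bool) (hQ : List Bool → List Bool)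

/-! ### The search question and the query generator -/

/-- **The search question** on the prefix `y` at input `z`: `qq z y = pad (hQ ⟨z, y⟩, PQ |z|)` — the
Karp image of the `QL`-instance `⟨z, y⟩`, padded to the `Q`-padding length `N' = PQ(N)`.
[cite: ChenEtAl2022, §5.3 (proof of Thm. 6)] -/
def qq (z y : List Bool) : List Bool := pad (hQ (boolPair z y), PQ.eval z.length)

/-- The prefix to ask about in the round with `bits` answers: `bits·1` during the descent
(`|bits| < Δ`), `ε` at round `Δ`, and `(bits ↾ Δ) ↾ (|bits| - Δ - 1) · 0` afterwards. [cite: ChenEtAl2022, §5.3 (proof of Thm. 6)] -/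
def yselF : List Bool → List Bool :=
  iteFn (lenLeFn X ∘ fanoutFn (dmF p PT ∘ fstF) (List.cons true ∘ sndF)) (fun w => sndF w ++ [true])
    (iteFn (lenLeFn X ∘ fanoutFn (dmF p PT ∘ fstF) sndF) (fun _ => [])
      (fun w => (takeFn ∘ fanoutFn (dropFn ∘ fanoutFn (List.cons true ∘ dmF p PT ∘ fstF) (onesFn ∘ sndF))
        (takeFn ∘ fanoutFn (dmF p PT ∘ fstF) sndF)) w ++ [false]))

/-- **The query generator of the core**: `⟨z, bits⟩ ↦ qq z (ysel)`. [cite: ChenEtAl2022, §5.3 (proof of Thm. 6)] -/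
def coreQ : List Bool → List Bool := padRed pad hQ ∘ fanoutFn (fanoutFn fstF (yselF p PT)) (polyFn PQ ∘ fstF)

variable {p PT PQ pad hQ}

/-- `yselF ∈ FP`. [folklore] -/
theorem yselF_mem_FP : yselF p PT ∈ FP := by
  refine iteFn_mem_FP (comp_mem_FP (lenLeFn_mem_FP X) (fanoutFn_mem_FP (comp_mem_FP dmF_mem_FP fstF_mem_FP)
    (comp_mem_FP (cons_mem_FP true) sndF_mem_FP))) (append_mem_FP sndF_mem_FP (const_mem_FP _)) ?_
  refine iteFn_mem_FP (comp_mem_FP (lenLeFn_mem_FP X) (fanoutFn_mem_FP (comp_mem_FP dmF_mem_FP fstF_mem_FP) sndF_mem_FP))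
    (const_mem_FP _) (append_mem_FP ?_ (const_mem_FP _))
  exact comp_mem_FP takeFn_mem_FP (fanoutFn_mem_FP
    (comp_mem_FP dropFn_mem_FP (fanoutFn_mem_FP (comp_mem_FP (cons_mem_FP true) (comp_mem_FP dmF_mem_FP fstF_mem_FP))
      (comp_mem_FP onesFn_mem_FP sndF_mem_FP)))
    (comp_mem_FP takeFn_mem_FP (fanoutFn_mem_FP (comp_mem_FP dmF_mem_FP fstF_mem_FP) sndF_mem_FP)))

/-- **`coreQ ∈ FP`** when `pad` is polynomial time and `hQ ∈ FP`. [folklore] -/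
theorem coreQ_mem_FP
    (hpad : PolyTimeComputable (fun q : List Bool × ℕ => boolPair q.1 (unaryEncodeNat q.2)) (id : List Bool → List Bool) pad)
    (hh : hQ ∈ FP) : coreQ p PT PQ pad hQ ∈ FP :=
  comp_mem_FP (padRed_mem_FP hpad hh)
    (fanoutFn_mem_FP (fanoutFn_mem_FP fstF_mem_FP yselF_mem_FP) (comp_mem_FP (polyFn_mem_FP PQ) fstF_mem_FP))

/-- Value of the prefix selector. [folklore] -/
theorem yselF_apply (z bits : List Bool) :
    yselF p PT (boolPair z bits) =
      if bits.length < depth p PT z.length then bits ++ [true]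
      else if bits.length = depth p PT z.length then []
      else (bits.take (depth p PT z.length)).take (bits.length - depth p PT z.length - 1) ++ [false] := by
  have hc1 : (lenLeFn X ∘ fanoutFn (dmF p PT ∘ fstF) (List.cons true ∘ sndF)) (boolPair z bits) =
      [decide (bits.length < depth p PT z.length)] := by
    simp only [Function.comp_apply, fanoutFn_apply, fstF_boolPair, sndF_boolPair, lenLeFn_boolPair, dmF_apply, ones,
      List.length_replicate, List.length_cons, eval_X, Nat.succ_le_iff]
  have hc2 : (lenLeFn X ∘ fanoutFn (dmF p PT ∘ fstF) sndF) (boolPair z bits) = [decide (bits.length ≤ depth p PT z.length)] := by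
    simp only [Function.comp_apply, fanoutFn_apply, fstF_boolPair, sndF_boolPair, lenLeFn_boolPair, dmF_apply, ones,
      List.length_replicate, eval_X]
  by_cases h1 : bits.length < depth p PT z.length
  · rw [yselF, iteFn_apply_true (by rw [hc1, decide_eq_true h1]), if_pos h1, sndF_boolPair]
  · rw [yselF, iteFn_apply_false (by rw [hc1, decide_eq_false h1]), if_neg h1]
    by_cases h2 : bits.length = depth p PT z.length
    · rw [iteFn_apply_true (by rw [hc2, decide_eq_true h2.le]), if_pos h2]
    · rw [iteFn_apply_false (by rw [hc2, decide_eq_false (by omega)]), if_neg h2]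
      simp only [Function.comp_apply, fanoutFn_apply, fstF_boolPair, sndF_boolPair, dmF_apply, takeFn_boolPair,
        dropFn_boolPair, onesFn, unaryEncodeNat_eq_replicate, ones, List.length_replicate, List.length_cons,
        List.drop_replicate]
      congr 2

/-- **Value of the query generator.** [cite: ChenEtAl2022, §5.3 (proof of Thm. 6)] -/
theorem coreQ_apply (z bits : List Bool) :
    coreQ p PT PQ pad hQ (boolPair z bits) = qq PQ pad hQ z (yselF p PT (boolPair z bits)) := by
  simp [coreQ, qq, ones]

/-! ### The true answer string -/

variable (p PT PQ pad hQ)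

/-- **The path of the descent** against `A`: `y₀ = ε`, `y_{d+1} = y_d · [qq z (y_d 1) ∈ A]`.
[cite: ChenEtAl2022, §5.3 (proof of Thm. 6)] -/
def pathBits (A : Language Bool) (z : List Bool) : ℕ → List Bool
  | 0 => []
  | d + 1 => pathBits A z d ++ [A.boolIndicator (qq PQ pad hQ z (pathBits A z d ++ [true]))]

/-- The answers of the second phase: `α(ε)`, then `α(y_d 0)` for `d < Δ`. [cite: ChenEtAl2022, §5.3 (proof of Thm. 6)] -/
def phaseB (A : Language Bool) (z : List Bool) (Δ : ℕ) : List Bool :=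
  A.boolIndicator (qq PQ pad hQ z []) ::
    (List.range Δ).map fun d => A.boolIndicator (qq PQ pad hQ z ((pathBits PQ pad hQ A z Δ).take d ++ [false]))

variable {p PT PQ pad hQ}

/-- `pathBits … d` has length `d`. [folklore] -/
@[simp] theorem length_pathBits (A : Language Bool) (z : List Bool) : ∀ d, (pathBits PQ pad hQ A z d).length = d
  | 0 => rfl
  | d + 1 => by rw [pathBits, List.length_append, length_pathBits A z d, List.length_singleton]

/-- Prefixes of the path are the path. [folklore] -/
theorem pathBits_take (A : Language Bool) (z : List Bool) {i j : ℕ} (h : i ≤ j) :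
    (pathBits PQ pad hQ A z j).take i = pathBits PQ pad hQ A z i := by
  induction j with
  | zero => obtain rfl : i = 0 := Nat.le_zero.1 h; rfl
  | succ j ih =>
    rcases Nat.lt_or_eq_of_le h with hlt | rfl
    · rw [pathBits, List.take_append_of_le_length (by rw [length_pathBits]; omega)]; exact ih (by omega)
    · rw [List.take_of_length_le (by rw [length_pathBits])]

/-- **Phase A: the answers are the path.** [cite: ChenEtAl2022, §5.3 (proof of Thm. 6)] -/
theorem adBits_coreQ_of_le (A : Language Bool) (z : List Bool) :
    ∀ d ≤ depth p PT z.length, adBits (coreQ p PT PQ pad hQ) A z d = pathBits PQ pad hQ A z d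
  | 0, _ => rfl
  | d + 1, hd => by
    rw [adBits_succ, adBits_coreQ_of_le A z d (by omega), pathBits, coreQ_apply, yselF_apply, length_pathBits, if_pos (by omega)]

/-- **The whole answer string** after `2Δ + 1 + e` rounds begins with the path and the phase-B answers.
[cite: ChenEtAl2022, §5.3 (proof of Thm. 6)] -/
theorem adBits_coreQ_phaseB (A : Language Bool) (z : List Bool) :
    ∀ k ≤ depth p PT z.length + 1, adBits (coreQ p PT PQ pad hQ) A z (depth p PT z.length + k) =
      pathBits PQ pad hQ A z (depth p PT z.length) ++ (phaseB PQ pad hQ A z (depth p PT z.length)).take k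
  | 0, _ => by rw [Nat.add_zero, adBits_coreQ_of_le A z _ le_rfl, List.take_zero, List.append_nil]
  | k + 1, hk => by
    rw [← Nat.add_assoc, adBits_succ, adBits_coreQ_phaseB A z k (by omega), coreQ_apply, yselF_apply]
    have hlen : (pathBits PQ pad hQ A z (depth p PT z.length) ++ (phaseB PQ pad hQ A z (depth p PT z.length)).take k).length =
        depth p PT z.length + k := by
      simp [phaseB]; omega
    rw [hlen, if_neg (by omega), List.append_assoc]
    congr 1
    rcases k with _ | k
    · simp [phaseB]
    · rw [if_neg (by omega), List.take_append_of_le_length (by rw [length_pathBits]),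
        show depth p PT z.length + (k + 1) - depth p PT z.length - 1 = k by omega, pathBits_take A z (by omega),
        phaseB, List.take_succ_cons, List.take_succ_cons, List.take_succ_eq_append_getElem (by simp; omega)]
      simp

/-- The phase-B answer string has length `Δ + 1`. [folklore] -/
@[simp] theorem length_phaseB (A : Language Bool) (z : List Bool) (Δ : ℕ) : (phaseB PQ pad hQ A z Δ).length = Δ + 1 := by
  simp [phaseB]

/-- **The answer string after all `2Δ + 1` scheduled rounds, plus any extra rounds**: its first
`2Δ + 1` bits are `path ++ phaseB`. [cite: ChenEtAl2022, §5.3 (proof of Thm. 6)] -/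
theorem adBits_coreQ_take (A : Language Bool) (z : List Bool) {R : ℕ} (hR : 2 * depth p PT z.length + 1 ≤ R) :
    (adBits (coreQ p PT PQ pad hQ) A z R).take (2 * depth p PT z.length + 1) =
      pathBits PQ pad hQ A z (depth p PT z.length) ++ phaseB PQ pad hQ A z (depth p PT z.length) := by
  rw [adBits_take A z hR, show 2 * depth p PT z.length + 1 = depth p PT z.length + (depth p PT z.length + 1) by ring,
    adBits_coreQ_phaseB A z _ le_rfl, List.take_of_length_le (by simp)]

/-! ### The stopping level -/

section Stop

variable (p PT)

/-- Answer bit lookups on `⟨⟨z, bits⟩, 1ᵈ⟩`: `α(ε) = bits[Δ]`. [folklore] -/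
def aEpsF : List Bool → List Bool := bitAtFn ∘ fanoutFn (dmF p PT ∘ fstF ∘ fstF) (sndF ∘ fstF)
/-- `α(y_d 0) = bits[Δ + 1 + d]`. [folklore] -/
def aZeroF : List Bool → List Bool :=
  bitAtFn ∘ fanoutFn (List.cons true ∘ (fun w => (dmF p PT ∘ fstF ∘ fstF) w ++ sndF w)) (sndF ∘ fstF)
/-- `α(y_d 1) = bits[d]` (for `d < Δ`). [folklore] -/
def aOneF : List Bool → List Bool := bitAtFn ∘ fanoutFn sndF (sndF ∘ fstF)

/-- **The stopping test** at level `d` (one bit): `(d = 0 ∧ ¬α(ε)) ∨ (d < Δ ∧ ¬α(y_d0) ∧ ¬α(y_d1)) ∨ d = Δ`.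
[cite: ChenEtAl2022, §5.1 (Algorithm 1) with §5.3] -/
def stopF : List Bool → List Bool :=
  orFn (andFn (isNilFn ∘ sndF) (notFn (aEpsF p PT)))
    (orFn (andFn (lenLeFn X ∘ fanoutFn (dmF p PT ∘ fstF ∘ fstF) (List.cons true ∘ sndF))
        (andFn (notFn (aZeroF p PT)) (notFn aOneF)))
      (eqPairFn ∘ fanoutFn sndF (dmF p PT ∘ fstF ∘ fstF)))

/-- The piece of round `d`: `⟨[stop d], 1ᵈ⟩`. [folklore] -/
def stopPiece : List Bool → List Bool := fanoutFn (stopF p PT) sndF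

/-- The fold operation on `⟨acc, ⟨[b], 1ᵈ⟩⟩`: record the first level where the test fires,
`acc := 1·1ᵈ` if `acc = ε ∧ b`. [folklore] -/
def stopOp : List Bool → List Bool :=
  iteFn (andFn (isNilFn ∘ fstF) (HashBricks.headBitFn ∘ fstF ∘ sndF)) (List.cons true ∘ sndF ∘ sndF) fstF

/-- **The stopping level** `1^{d*}`: a fold over `d = 0, …, Δ` of `⟨z, bits⟩`. [cite: ChenEtAl2022, §5.1 (Algorithm 1)] -/
def dstarF : List Bool → List Bool :=
  List.tail ∘ sndPow 2 ∘ foldLoop (stopOp) (clipF 1 (stopPiece p PT)) (2 * (X + p + 3 * (p + 2)) + 1) ∘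
    fanoutFn id (fanoutFn (lenBinF ∘ List.cons true ∘ dmF p PT ∘ fstF) (fun _ => boolPair [] []))

/-- **The record handed to the slot builders**: `⟨z, y_{d*}⟩` with `y_{d*} = bits ↾ d*`. [folklore] -/
def prepF : List Bool → List Bool := fanoutFn fstF (takeFn ∘ fanoutFn (dstarF p PT) sndF)

variable {p PT}

/-- `stopF ∈ FP`. [folklore] -/
theorem stopF_mem_FP : stopF p PT ∈ FP := by
  have hdm : (dmF p PT ∘ fstF ∘ fstF) ∈ FP := comp_mem_FP dmF_mem_FP (comp_mem_FP fstF_mem_FP fstF_mem_FP)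
  have hb : (sndF ∘ fstF) ∈ FP := comp_mem_FP sndF_mem_FP fstF_mem_FP
  have h1 : aEpsF p PT ∈ FP := comp_mem_FP bitAtFn_mem_FP (fanoutFn_mem_FP hdm hb)
  have h2 : aZeroF p PT ∈ FP := comp_mem_FP bitAtFn_mem_FP
    (fanoutFn_mem_FP (comp_mem_FP (cons_mem_FP true) (append_mem_FP hdm sndF_mem_FP)) hb)
  have h3 : aOneF ∈ FP := comp_mem_FP bitAtFn_mem_FP (fanoutFn_mem_FP sndF_mem_FP hb)
  exact orFn_mem_FP (andFn_mem_FP (comp_mem_FP isNilFn_mem_FP sndF_mem_FP) (notFn_mem_FP h1))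
    (orFn_mem_FP (andFn_mem_FP (comp_mem_FP (lenLeFn_mem_FP X) (fanoutFn_mem_FP hdm (comp_mem_FP (cons_mem_FP true) sndF_mem_FP)))
      (andFn_mem_FP (notFn_mem_FP h2) (notFn_mem_FP h3))) (comp_mem_FP eqPairFn_mem_FP (fanoutFn_mem_FP sndF_mem_FP hdm)))

/-- Growth of the fold operation. [folklore] -/
theorem length_stopOp_le (w : List Bool) : (stopOp w).length ≤ (fstF w).length + (sndF w).length + 1 := by
  rw [stopOp, iteFn_of_oneBit (oneBit_andFn (oneBit_isNilFn.comp _) (HashBricks.oneBit_headBitFn.comp _))]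
  split_ifs
  · have := length_fstF_sndF_le (sndF w); simp only [Function.comp_apply, List.length_cons]; omega
  · omega

/-- `dstarF ∈ FP`. [cite: ChenEtAl2022, §5.1 (Algorithm 1 runs in polynomial time)] -/
theorem dstarF_mem_FP : dstarF p PT ∈ FP := by
  have hop : stopOp ∈ FP := iteFn_mem_FP (andFn_mem_FP (comp_mem_FP isNilFn_mem_FP fstF_mem_FP)
    (comp_mem_FP HashBricks.headBitFn_mem_FP (comp_mem_FP fstF_mem_FP sndF_mem_FP)))
    (comp_mem_FP (cons_mem_FP true) (comp_mem_FP sndF_mem_FP sndF_mem_FP)) fstF_mem_FP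
  have hpiece : stopPiece p PT ∈ FP := fanoutFn_mem_FP stopF_mem_FP sndF_mem_FP
  refine comp_mem_FP PRelSigma.tail_mem_FP (comp_mem_FP (sndPow_mem_FP 2) (comp_mem_FP
    (foldLoop_clipF_mem_FP 1 hop length_stopOp_le hpiece _) ?_))
  exact fanoutFn_mem_FP OracleCompose.id_mem_FP (fanoutFn_mem_FP
    (comp_mem_FP lenBinF_mem_FP (comp_mem_FP (cons_mem_FP true) (comp_mem_FP dmF_mem_FP fstF_mem_FP))) (const_mem_FP _))

/-- `prepF ∈ FP`. [folklore] -/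
theorem prepF_mem_FP : prepF p PT ∈ FP :=
  fanoutFn_mem_FP fstF_mem_FP (comp_mem_FP takeFn_mem_FP (fanoutFn_mem_FP dstarF_mem_FP sndF_mem_FP))

/-! #### Value of the stopping level -/

/-- The abstract stopping test on an answer string `bits` (indices as read by the bricks).
[cite: ChenEtAl2022, §5.1 (Algorithm 1)] -/
def stopAt (Δ : ℕ) (bits : List Bool) (d : ℕ) : Bool :=
  (decide (d = 0) && !(bits.getD Δ false)) ||
    ((decide (d < Δ) && (!(bits.getD (Δ + 1 + d) false) && !(bits.getD d false))) || decide (d = Δ))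

/-- The first level `≤ Δ` where the test fires (it fires at `Δ`). [cite: ChenEtAl2022, §5.1 (Algorithm 1)] -/
def dstar (Δ : ℕ) (bits : List Bool) : ℕ := Nat.find (p := fun d => stopAt Δ bits d = true) ⟨Δ, by simp [stopAt]⟩

/-- `dstar ≤ Δ`. [folklore] -/
theorem dstar_le (Δ : ℕ) (bits : List Bool) : dstar Δ bits ≤ Δ := Nat.find_min' _ (by simp [stopAt])

/-- The test fires at `dstar`. [folklore] -/
theorem stopAt_dstar (Δ : ℕ) (bits : List Bool) : stopAt Δ bits (dstar Δ bits) = true := Nat.find_spec (p := fun d => stopAt Δ bits d = true) _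

/-- The test does not fire below `dstar`. [folklore] -/
theorem stopAt_of_lt_dstar {Δ : ℕ} {bits : List Bool} {d : ℕ} (h : d < dstar Δ bits) : stopAt Δ bits d = false :=
  Bool.eq_false_iff.2 (Nat.find_min (p := fun d => stopAt Δ bits d = true) _ h)

/-- A bit lookup with `bitAtFn` is `getD`. [folklore] -/
theorem bitAtFn_getD (a b : List Bool) (h : a.length < b.length) : bitAtFn (boolPair a b) = [b.getD a.length false] := by
  rw [bitAtFn_boolPair_of_lt a b h, List.getD_eq_getElem _ _ h]

/-- Value of `aEpsF`. [folklore] -/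
theorem aEpsF_apply (z bits : List Bool) (d : ℕ) (hlen : depth p PT z.length < bits.length) :
    aEpsF p PT (boolPair (boolPair z bits) (ones d)) = [bits.getD (depth p PT z.length) false] := by
  simp only [aEpsF, Function.comp_apply, fanoutFn_apply, fstF_boolPair, sndF_boolPair, dmF_apply]
  rw [bitAtFn_getD _ _ (by rw [List.length_replicate]; exact hlen), List.length_replicate]

/-- Value of `aZeroF`. [folklore] -/
theorem aZeroF_apply (z bits : List Bool) (d : ℕ) (hlen : depth p PT z.length + 1 + d < bits.length) :
    aZeroF p PT (boolPair (boolPair z bits) (ones d)) = [bits.getD (depth p PT z.length + 1 + d) false] := by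
  have hl : (true :: (dmF p PT z ++ ones d)).length = depth p PT z.length + 1 + d := by
    simp only [List.length_cons, List.length_append, dmF_apply, List.length_replicate]; ring
  simp only [aZeroF, Function.comp_apply, fanoutFn_apply, fstF_boolPair, sndF_boolPair]
  rw [bitAtFn_getD _ _ (by rw [hl]; exact hlen), hl]

/-- Value of `aOneF`. [folklore] -/
theorem aOneF_apply (z bits : List Bool) (d : ℕ) (hlen : d < bits.length) :
    aOneF (boolPair (boolPair z bits) (ones d)) = [bits.getD d false] := by
  simp only [aOneF, Function.comp_apply, fanoutFn_apply, fstF_boolPair, sndF_boolPair]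
  rw [bitAtFn_getD _ _ (by rw [List.length_replicate]; exact hlen), List.length_replicate]

/-- Value of the `d < Δ` test. [folklore] -/
theorem ltTest_apply (z bits : List Bool) (d : ℕ) :
    (lenLeFn X ∘ fanoutFn (dmF p PT ∘ fstF ∘ fstF) (List.cons true ∘ sndF)) (boolPair (boolPair z bits) (ones d)) =
      [decide (d < depth p PT z.length)] := by
  simp only [Function.comp_apply, fanoutFn_apply, fstF_boolPair, sndF_boolPair, lenLeFn_boolPair, dmF_apply,
    List.length_replicate, List.length_cons, eval_X, Nat.succ_le_iff]

/-- Value of the `d = Δ` test. [folklore] -/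
theorem eqTest_apply (z bits : List Bool) (d : ℕ) :
    (eqPairFn ∘ fanoutFn sndF (dmF p PT ∘ fstF ∘ fstF)) (boolPair (boolPair z bits) (ones d)) = [decide (d = depth p PT z.length)] := by
  simp only [Function.comp_apply, fanoutFn_apply, fstF_boolPair, sndF_boolPair, eqPairFn_boolPair, dmF_apply]
  congr 1
  apply Bool.decide_congr
  constructor
  · intro h; have := congrArg List.length h; simpa using this
  · rintro rfl; rfl

/-- **Value of the stopping test** on `⟨⟨z, bits⟩, 1ᵈ⟩` for `d ≤ Δ` and `|bits| ≥ 2Δ + 2`. [cite: ChenEtAl2022, §5.1 (Algorithm 1)] -/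
theorem stopF_apply (z bits : List Bool) {d : ℕ} (hd : d ≤ depth p PT z.length) (hlen : 2 * depth p PT z.length + 2 ≤ bits.length) :
    stopF p PT (boolPair (boolPair z bits) (ones d)) = [stopAt (depth p PT z.length) bits d] := by
  have hnil : (isNilFn ∘ sndF) (boolPair (boolPair z bits) (ones d)) = [decide (d = 0)] := by
    rw [Function.comp_apply, sndF_boolPair, isNilFn_ones]
  rw [stopF, orFn_apply (andFn_apply hnil (notFn_apply (aEpsF_apply z bits d (by omega))))
    (orFn_apply (andFn_apply (ltTest_apply z bits d) (andFn_apply (notFn_apply (aZeroF_apply z bits d (by omega)))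
      (notFn_apply (aOneF_apply z bits d (by omega))))) (eqTest_apply z bits d))]
  rfl

/-- Value of the fold operation. [folklore] -/
theorem stopOp_apply (acc : List Bool) (b : Bool) (u : List Bool) :
    stopOp (boolPair acc (boolPair [b] u)) = if acc = [] ∧ b = true then true :: u else acc := by
  have hc : (andFn (isNilFn ∘ fstF) (HashBricks.headBitFn ∘ fstF ∘ sndF)) (boolPair acc (boolPair [b] u)) =
      [decide (acc = []) && b] := by
    rw [andFn_apply (b := decide (acc = [])) (b' := b)] <;> simp [isNilFn]
  rw [stopOp, iteFn_apply hc]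
  by_cases h : acc = [] ∧ b = true
  · rw [if_pos h, if_pos (by simp [h.1, h.2])]; simp
  · rw [if_neg h, if_neg (by
      intro h'
      simp only [Bool.and_eq_true, decide_eq_true_eq] at h'
      exact h h')]
    simp

/-- The model of the fold: the first firing level below `k`, if any. [folklore] -/
theorem foldAcc_stopOp (z bits : List Bool) (hlen : 2 * depth p PT z.length + 2 ≤ bits.length) :
    ∀ k ≤ depth p PT z.length + 1,
      foldAcc stopOp (stopPiece p PT) (boolPair z bits) 0 k [] =
        if dstar (depth p PT z.length) bits < k then true :: ones (dstar (depth p PT z.length) bits) else []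
  | 0, _ => by simp
  | k + 1, hk => by
    rw [foldAcc_succ', foldAcc_stopOp z bits hlen k (by omega), Nat.zero_add, stopPiece, fanoutFn_apply, sndF_boolPair,
      stopF_apply z bits (by omega) hlen, stopOp_apply]
    by_cases hlt : dstar (depth p PT z.length) bits < k
    · rw [if_pos hlt, if_neg (by simp), if_pos (by omega)]
    · rw [if_neg hlt]
      by_cases heq : dstar (depth p PT z.length) bits = k
      · rw [if_pos ⟨rfl, by rw [← heq]; exact stopAt_dstar _ _⟩, if_pos (by omega), heq]
      · rw [if_neg (by rw [stopAt_of_lt_dstar (by omega)]; simp), if_neg (by omega)]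

/-- **Value of the stopping-level brick** on the true answer string (`|bits| ≥ 2Δ + 2`): `1^{d*}`.
[cite: ChenEtAl2022, §5.1 (Algorithm 1)] -/
theorem dstarF_apply (z bits : List Bool) (hlen : 2 * depth p PT z.length + 2 ≤ bits.length) :
    dstarF p PT (boolPair z bits) = ones (dstar (depth p PT z.length) bits) := by
  set Δ := depth p PT z.length with hΔ
  have hinit : (fanoutFn id (fanoutFn (lenBinF ∘ List.cons true ∘ dmF p PT ∘ fstF) (fun _ => boolPair [] [])) (boolPair z bits)) =
      boolPair (boolPair z bits) (boolPair (encodeNat (Δ + 1)) (boolPair (ones 0) [])) := by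
    simp [dmF_apply, ← hΔ, ones]
  have hrounds : Δ + 1 ≤ (2 * (X + p + 3 * (p + 2)) + 1 : Polynomial ℕ).eval (boolPair z bits).length := by
    have h1 : z.length ≤ (boolPair z bits).length := by rw [length_boolPair]; omega
    have h2 : lev PT z.length ≤ (boolPair z bits).length := (lev_le _).trans h1
    have h3 := TM2Iter.eval_mono p h2
    simp only [eval_add, eval_mul, eval_ofNat, eval_X, hΔ, depth]
    omega
  have hclip : foldAcc stopOp (clipF 1 (stopPiece p PT)) (boolPair z bits) 0 (Δ + 1) [] =
      foldAcc stopOp (stopPiece p PT) (boolPair z bits) 0 (Δ + 1) [] :=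
    foldAcc_clipF fun j _ hj => by
      rw [stopPiece, fanoutFn_apply, stopF_apply z bits (by omega) hlen, length_boolPair, sndF_boolPair, length_boolPair]
      simp [ones]; omega
  rw [dstarF, Function.comp_apply, Function.comp_apply, Function.comp_apply, hinit, foldLoop_apply _ _ hrounds, hclip,
    foldAcc_stopOp z bits hlen _ le_rfl, if_pos (Nat.lt_succ_of_le (dstar_le _ _))]
  simp [hΔ]

/-- **Value of the record**: `prepF ⟨z, bits⟩ = ⟨z, bits ↾ d*⟩`. [folklore] -/
theorem prepF_apply (z bits : List Bool) (hlen : 2 * depth p PT z.length + 2 ≤ bits.length) :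
    prepF p PT (boolPair z bits) = boolPair z (bits.take (dstar (depth p PT z.length) bits)) := by
  simp [prepF, dstarF_apply z bits hlen, ones]

end Stop

end Core

end PPRefuter

end Literature.Computability.MetaComplexity

end


/-!
# Part 6. The six output slots of the `PP` refuter

Topic `Computability/MetaComplexity` (refuters for `PP`, Chen–Jin–Santhanam–Williams [ChenEtAl2022],
§5.3 with §5.1 Lemma 6), machine layer.

At its stopping level the core holds the record `⟨z, y⟩` (`prepF`, Part 5). The constant-size
list of the paper's list-refuter ([ChenEtAl2022, §5.1 Def. 4 / Lemma 6]: "prints a list of `c`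
strings … for infinitely many `n` there exists `i ∈ [c]` for which `A(xₙ⁽ⁱ⁾) ≠ f(xₙ⁽ⁱ⁾)`") is here a
fixed SIX-tuple of strings, each computed by its own `FP` builder (so that the `i`-th refuter is just
core-then-builder-`i`, no list coding):

* the three **search slots** `qSlotF j ⟨z, y⟩ = qq z (y·sfx j)`, `sfx = ε, 0, 1` — the search questions
  at the stopping prefix and its children (length `N' = PQ(N)`);
* the three **threshold slots** `tSlotF j ⟨z, y⟩` — reading `y` as a witness `x u τᵤ τ₀ τ₁`
  (Part 2), the threshold queries `tq (tagOf u j) (natBits D₀ νⱼ)` of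
  `RefuterLocalConsistency.nodeList` (`ν₀ = nuU` at an inner node / `nuLeaf` at a leaf, `ν₁ = nuZero`,
  `ν₂ = nuOne`), padded to length `N` — "a list of three strings that contains at least one
  counterexample" ([ChenEtAl2022, §5.3]).

Values on well-formed records (`qSlotF_apply`, `tSlotF_wit`) and `FP` membership; finally the six
**output maps** `slotG i = builder i ∘ prepF` of the adaptive transducer (`slotG_mem_FP`).

## References

* L. Chen, C. Jin, R. Santhanam, R. Williams, *Constructive separations and their consequences*,
  FOCS 2021 = TheoretiCS 3 (2024), §5.1 (Def. 4, Lemma 6), §5.3 (proof of Thm. 6) [ChenEtAl2022].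
-/

noncomputable section

namespace Literature.Computability.MetaComplexity

open _root_.Computability Polynomial Literature.Computability.Complexity
  Literature.Computability.Complexity.Brick Literature.Computability.Complexity.Plumb
  Literature.Computability.Complexity.CoinEnum

namespace PPRefuter

/-! ### Numerals of bounded width -/

/-- Appending zeros does not change the value. [folklore] -/
theorem bitsToNat_append_replicate_false (s : List Bool) (k : ℕ) : bitsToNat (s ++ List.replicate k false) = bitsToNat s := by
  rw [bitsToNat_append, bitsToNat_replicate_false, Nat.mul_zero, Nat.add_zero]

/-- `takeD` of a short list pads it. [folklore] -/
theorem takeD_eq_append_replicate (s : List Bool) : ∀ D : ℕ, s.length ≤ D → s.takeD D false = s ++ List.replicate (D - s.length) false := by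
  induction s with
  | nil => intro D _; simp
  | cons b s ih =>
    intro D hD
    cases D with
    | zero => simp at hD
    | succ D =>
      simp [List.takeD_succ, ih D (by simpa using hD)]

/-- **Padding a short numeral to width `D` gives the canonical numeral of its value.** [folklore] -/
theorem takeD_eq_natBits {s : List Bool} {D : ℕ} (h : s.length ≤ D) : s.takeD D false = natBits D (bitsToNat s) := by
  rw [takeD_eq_append_replicate s D h]
  have hl : (s ++ List.replicate (D - s.length) false).length = D := by simp; omega
  rw [eq_natBits_of_length hl, bitsToNat_append_replicate_false]

section Slots

variable (p PT PQ : Polynomial ℕ) (pad : List Bool × ℕ → List Bool) (hT hQ : List Bool → List Bool) (L' : Language Bool)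

/-- The child suffix of slot `j`: `ε`, `0`, `1`. [folklore] -/
def sfx : ℕ → List Bool
  | 0 => []
  | 1 => [false]
  | _ => [true]

/-! ### The search slots -/

/-- **Search slot `j`** on `⟨z, y⟩`: `qq z (y · sfx j)`. [cite: ChenEtAl2022, §5.3 (proof of Thm. 6)] -/
def qSlotF (j : ℕ) : List Bool → List Bool :=
  padRed pad hQ ∘ fanoutFn (fanoutFn fstF (fun v => sndF v ++ sfx j)) (polyFn PQ ∘ fstF)

/-! ### The threshold slots -/

/-- `c - 1` from the numeral brick `f`. [folklore] -/
def predW (f : List Bool → List Bool) : List Bool → List Bool := subFn ∘ fanoutFn f (fun _ => [true])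

/-- The numeral of `nuU c a b K`. [cite: ChenEtAl2022, §5.3 (proof of Thm. 6)] -/
def nuUW : List Bool → List Bool :=
  iteFn (orFn (ltW (kW p PT) (valW p PT 0)) (ltW (sumW p PT) (valW p PT 0))) (predW (valW p PT 0)) (valW p PT 0)

/-- The numeral of `nuZero c a b K`. [cite: ChenEtAl2022, §5.3 (proof of Thm. 6)] -/
def nuZeroW : List Bool → List Bool :=
  iteFn (orFn (ltW (k2W p PT) (valW p PT 1)) (andFn (ltW (valW p PT 0) (sumW p PT)) (ltW (fun _ => []) (valW p PT 1))))
    (predW (valW p PT 1)) (valW p PT 1)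

/-- The numeral of `nuOne c a b K`. [cite: ChenEtAl2022, §5.3 (proof of Thm. 6)] -/
def nuOneW : List Bool → List Bool :=
  iteFn (orFn (ltW (k2W p PT) (valW p PT 2)) (andFn (ltW (valW p PT 0) (sumW p PT)) (ltW (fun _ => []) (valW p PT 2))))
    (predW (valW p PT 2)) (valW p PT 2)

/-- The numeral of `nuLeaf c [⟨x,u⟩ ∈ L']`. [cite: ChenEtAl2022, §5.3 (proof of Thm. 6)] -/
def nuLeafW : List Bool → List Bool := iteFn (ltW (indW p PT L') (valW p PT 0)) (predW (valW p PT 0)) (valW p PT 0)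

/-- The numeral of slot `j`: `ν₀` (inner node: `nuU`, leaf: `nuLeaf`), `ν₁ = nuZero`, `ν₂ = nuOne`. [cite: ChenEtAl2022, §5.3 (proof of Thm. 6)] -/
def nuW : ℕ → List Bool → List Bool
  | 0 => iteFn (innerW p PT) (nuUW p PT) (nuLeafW p PT L')
  | 1 => nuZeroW p PT
  | _ + 2 => nuOneW p PT

/-- Normalising a numeral to width `D₀`: `(takeD D₀ · 0)`. [folklore] -/
def normW (f : List Bool → List Bool) : List Bool → List Bool := fstF ∘ padTakeFn ∘ fanoutFn (d0F p PT ∘ fstF) f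

/-- **Threshold slot `j`** on `⟨z, y⟩`: `pad (hT ⟨x, ⟨u · sfx j, natBits D₀ νⱼ⟩⟩, |z|)`. [cite: ChenEtAl2022, §5.3 (proof of Thm. 6)] -/
def tSlotF (j : ℕ) : List Bool → List Bool :=
  padRed pad hT ∘ fanoutFn (fanoutFn (xW PT) (fanoutFn (fun v => uW p PT v ++ sfx j) (normW p PT (nuW p PT L' j)))) fstF

/-- **The six output maps** of the adaptive transducer: slots `0,1,2` = threshold slots, `3,4,5` =
search slots, each after `prepF`. [cite: ChenEtAl2022, §5.1 (Lemma 6) with §5.3] -/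
def slotG (i : ℕ) : List Bool → List Bool :=
  (if i < 3 then tSlotF p PT pad hT L' i else qSlotF PQ pad hQ (i - 3)) ∘ prepF p PT

variable {p PT PQ pad hT hQ L'}

/-! ### `FP` membership -/

/-- `qSlotF j ∈ FP`. [folklore] -/
theorem qSlotF_mem_FP
    (hpad : PolyTimeComputable (fun q : List Bool × ℕ => boolPair q.1 (unaryEncodeNat q.2)) (id : List Bool → List Bool) pad)
    (hh : hQ ∈ FP) (j : ℕ) : qSlotF PQ pad hQ j ∈ FP :=
  comp_mem_FP (padRed_mem_FP hpad hh) (fanoutFn_mem_FP (fanoutFn_mem_FP fstF_mem_FP (append_mem_FP sndF_mem_FP (const_mem_FP _)))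
    (comp_mem_FP (polyFn_mem_FP PQ) fstF_mem_FP))

/-- `predW f ∈ FP`. [folklore] -/
theorem predW_mem_FP {f : List Bool → List Bool} (hf : f ∈ FP) : predW f ∈ FP :=
  comp_mem_FP subFn_mem_FP (fanoutFn_mem_FP hf (const_mem_FP _))

/-- `nuW j ∈ FP` for `L' ∈ P`. [folklore] -/
theorem nuW_mem_FP (hL' : L' ∈ Classes.P) : ∀ j, nuW p PT L' j ∈ FP
  | 0 => iteFn_mem_FP innerW_mem_FP
      (iteFn_mem_FP (orFn_mem_FP (ltW_mem_FP kW_mem_FP (valW_mem_FP 0)) (ltW_mem_FP sumW_mem_FP (valW_mem_FP 0)))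
        (predW_mem_FP (valW_mem_FP 0)) (valW_mem_FP 0))
      (iteFn_mem_FP (ltW_mem_FP (indW_mem_FP hL') (valW_mem_FP 0)) (predW_mem_FP (valW_mem_FP 0)) (valW_mem_FP 0))
  | 1 => iteFn_mem_FP (orFn_mem_FP (ltW_mem_FP k2W_mem_FP (valW_mem_FP 1))
      (andFn_mem_FP (ltW_mem_FP (valW_mem_FP 0) sumW_mem_FP) (ltW_mem_FP (const_mem_FP _) (valW_mem_FP 1))))
      (predW_mem_FP (valW_mem_FP 1)) (valW_mem_FP 1)
  | _ + 2 => iteFn_mem_FP (orFn_mem_FP (ltW_mem_FP k2W_mem_FP (valW_mem_FP 2))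
      (andFn_mem_FP (ltW_mem_FP (valW_mem_FP 0) sumW_mem_FP) (ltW_mem_FP (const_mem_FP _) (valW_mem_FP 2))))
      (predW_mem_FP (valW_mem_FP 2)) (valW_mem_FP 2)

/-- `normW f ∈ FP`. [folklore] -/
theorem normW_mem_FP {f : List Bool → List Bool} (hf : f ∈ FP) : normW p PT f ∈ FP :=
  comp_mem_FP fstF_mem_FP (comp_mem_FP padTakeFn_mem_FP (fanoutFn_mem_FP (comp_mem_FP d0F_mem_FP fstF_mem_FP) hf))

/-- `tSlotF j ∈ FP` for `L' ∈ P`, `pad` polynomial time, `hT ∈ FP`. [folklore] -/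
theorem tSlotF_mem_FP
    (hpad : PolyTimeComputable (fun q : List Bool × ℕ => boolPair q.1 (unaryEncodeNat q.2)) (id : List Bool → List Bool) pad)
    (hh : hT ∈ FP) (hL' : L' ∈ Classes.P) (j : ℕ) : tSlotF p PT pad hT L' j ∈ FP :=
  comp_mem_FP (padRed_mem_FP hpad hh) (fanoutFn_mem_FP (fanoutFn_mem_FP xW_mem_FP
    (fanoutFn_mem_FP (append_mem_FP uW_mem_FP (const_mem_FP _)) (normW_mem_FP (nuW_mem_FP hL' j)))) fstF_mem_FP)

/-- **`slotG i ∈ FP`.** [cite: ChenEtAl2022, §5.1 (the refuter runs in polynomial time)] -/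
theorem slotG_mem_FP
    (hpad : PolyTimeComputable (fun q : List Bool × ℕ => boolPair q.1 (unaryEncodeNat q.2)) (id : List Bool → List Bool) pad)
    (hhT : hT ∈ FP) (hhQ : hQ ∈ FP) (hL' : L' ∈ Classes.P) (i : ℕ) : slotG p PT PQ pad hT hQ L' i ∈ FP := by
  unfold slotG
  split_ifs
  · exact comp_mem_FP (tSlotF_mem_FP hpad hhT hL' i) prepF_mem_FP
  · exact comp_mem_FP (qSlotF_mem_FP hpad hhQ _) prepF_mem_FP

/-! ### Values -/

/-- **Value of the search slots.** [cite: ChenEtAl2022, §5.3 (proof of Thm. 6)] -/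
theorem qSlotF_apply (j : ℕ) (z y : List Bool) : qSlotF PQ pad hQ j (boolPair z y) = qq PQ pad hQ z (y ++ sfx j) := by
  simp [qSlotF, qq]

section TVal

variable {z x u τu τ0 τ1 : List Bool}

local notation "nn" => lev PT (List.length z)
local notation "mm" => Polynomial.eval (lev PT (List.length z)) p
local notation "DD" => Polynomial.eval (lev PT (List.length z)) p + 2

/-- `u ++ sfx j = tagOf u j`. [folklore] -/
theorem append_sfx (u : List Bool) : ∀ j, u ++ sfx j = tagOf u j
  | 0 => by simp [sfx, tagOf]
  | 1 => rfl
  | _ + 2 => rfl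

/-- Value of `predW`. [folklore] -/
theorem predW_apply (f : List Bool → List Bool) (v : List Bool) : predW f v = encodeNat (bitsToNat (f v) - 1) := by
  simp [predW]

/-- A branch selecting between `c - 1` (canonical) and the raw numeral of `c`: value. [folklore] -/
theorem bitsToNat_iteFn_pred {cond f : List Bool → List Bool} {v : List Bool} {P : Prop} [Decidable P]
    (hc : cond v = [decide P]) :
    bitsToNat (iteFn cond (predW f) f v) = if P then bitsToNat (f v) - 1 else bitsToNat (f v) := by
  by_cases hP : P
  · rw [iteFn_apply_true (by rw [hc, decide_eq_true hP]), if_pos hP, predW_apply, bitsToNat_encodeNat]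
  · rw [iteFn_apply_false (by rw [hc, decide_eq_false hP]), if_neg hP]

/-- The same branch: width. [folklore] -/
theorem length_iteFn_pred_le {cond f : List Bool → List Bool} {v : List Bool} {P : Prop} [Decidable P]
    (hc : cond v = [decide P]) {D : ℕ} (hf : (f v).length = D) : (iteFn cond (predW f) f v).length ≤ D := by
  by_cases hP : P
  · rw [iteFn_apply_true (by rw [hc, decide_eq_true hP]), predW_apply]
    exact (length_encodeNat_mono (Nat.sub_le _ _)).trans ((length_encodeNat_bitsToNat_le _).trans hf.le)
  · rw [iteFn_apply_false (by rw [hc, decide_eq_false hP]), hf]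

/-- The numeric index of slot `j` on a parsed witness (`nodeList` / `nuLeaf`): `ν₀ = nuU` at an inner
node and `nuLeaf` at a leaf, `ν₁ = nuZero`, `ν₂ = nuOne` (with `K/2` rendered as `2^{m-j-1}`).
[cite: ChenEtAl2022, §5.3 (proof of Thm. 6)] -/
def nuOf (L' : Language Bool) (m : ℕ) (x u τu τ0 τ1 : List Bool) (j : ℕ) : ℕ :=
  if j = 0 then
    (if u.length < m then nuU (bitsToNat τu.reverse) (bitsToNat τ0.reverse) (bitsToNat τ1.reverse) (2 ^ (m - u.length))
     else nuLeaf (bitsToNat τu.reverse) (L'.boolIndicator (boolPair x u)).toNat)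
  else if j = 1 then
    (if 2 ^ (m - (u.length + 1)) < bitsToNat τ0.reverse ∨
        (bitsToNat τu.reverse < bitsToNat τ0.reverse + bitsToNat τ1.reverse ∧ 0 < bitsToNat τ0.reverse)
     then bitsToNat τ0.reverse - 1 else bitsToNat τ0.reverse)
  else
    (if 2 ^ (m - (u.length + 1)) < bitsToNat τ1.reverse ∨
        (bitsToNat τu.reverse < bitsToNat τ0.reverse + bitsToNat τ1.reverse ∧ 0 < bitsToNat τ1.reverse)
     then bitsToNat τ1.reverse - 1 else bitsToNat τ1.reverse)

/-- At an inner node, `ν₁ = nuZero c a b 2^{m-|u|}`. [folklore] -/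
theorem nuOf_one {L' : Language Bool} {m : ℕ} {x u τu τ0 τ1 : List Bool} (hu : u.length < m) :
    nuOf L' m x u τu τ0 τ1 1 = nuZero (bitsToNat τu.reverse) (bitsToNat τ0.reverse) (bitsToNat τ1.reverse) (2 ^ (m - u.length)) := by
  have hK2 : 2 ^ (m - (u.length + 1)) = 2 ^ (m - u.length) / 2 := by
    rw [show m - u.length = (m - (u.length + 1)) + 1 by omega, pow_succ]; simp
  simp only [nuOf, Nat.one_ne_zero, if_false, if_true, nuZero, hK2]

/-- At an inner node, `ν₂ = nuOne c a b 2^{m-|u|}`. [folklore] -/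
theorem nuOf_two {L' : Language Bool} {m : ℕ} {x u τu τ0 τ1 : List Bool} (hu : u.length < m) :
    nuOf L' m x u τu τ0 τ1 2 = nuOne (bitsToNat τu.reverse) (bitsToNat τ0.reverse) (bitsToNat τ1.reverse) (2 ^ (m - u.length)) := by
  have hK2 : 2 ^ (m - (u.length + 1)) = 2 ^ (m - u.length) / 2 := by
    rw [show m - u.length = (m - (u.length + 1)) + 1 by omega, pow_succ]; simp
  simp only [nuOf, show (2 : ℕ) ≠ 0 from two_ne_zero, show (2 : ℕ) ≠ 1 by norm_num, if_false, nuOne, hK2]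

/-- **The numeral of slot `j` on a parsed witness**: value `nuOf j` and width `≤ D₀`. [cite: ChenEtAl2022, §5.3 (proof of Thm. 6)] -/
theorem nuW_wit (hx : x.length = nn) (hu : τu.length = DD) (h0 : τ0.length = DD) (h1 : τ1.length = DD) (j : ℕ) :
    bitsToNat (nuW p PT L' j (boolPair z (wit x u τu τ0 τ1))) = nuOf L' (mm) x u τu τ0 τ1 j ∧
      (nuW p PT L' j (boolPair z (wit x u τu τ0 τ1))).length ≤ DD := by
  obtain ⟨hc, ha, hb⟩ := valW_wit (p := p) (u := u) hx hu h0 h1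
  have hsum : bitsToNat (sumW p PT (boolPair z (wit x u τu τ0 τ1))) = bitsToNat τ0.reverse + bitsToNat τ1.reverse := by
    simp [sumW, ha, hb]
  have hK := bitsToNat_kW_wit (p := p) (u := u) hx hu h0 h1
  have hK2 := bitsToNat_k2W_wit (p := p) (u := u) hx hu h0 h1
  have hlc : (valW p PT 0 (boolPair z (wit x u τu τ0 τ1))).length = DD := by rw [hc, List.length_reverse, hu]
  have hla : (valW p PT 1 (boolPair z (wit x u τu τ0 τ1))).length = DD := by rw [ha, List.length_reverse, h0]
  have hlb : (valW p PT 2 (boolPair z (wit x u τu τ0 τ1))).length = DD := by rw [hb, List.length_reverse, h1]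
  rcases j with _ | _ | j
  · by_cases hin : u.length < mm
    · have hcond : (orFn (ltW (kW p PT) (valW p PT 0)) (ltW (sumW p PT) (valW p PT 0))) (boolPair z (wit x u τu τ0 τ1)) =
          [decide (2 ^ (mm - u.length) < bitsToNat τu.reverse ∨ bitsToNat τ0.reverse + bitsToNat τ1.reverse < bitsToNat τu.reverse)] := by
        rw [orFn_apply (ltW_apply _ _ _) (ltW_apply _ _ _), hK, hc, hsum, Bool.decide_or]
      have e : nuW p PT L' 0 (boolPair z (wit x u τu τ0 τ1)) = nuUW p PT (boolPair z (wit x u τu τ0 τ1)) := by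
        rw [nuW, iteFn_apply_true (by rw [innerW_wit hx hu h0 h1, decide_eq_true hin])]
      rw [e, nuUW]
      refine ⟨?_, length_iteFn_pred_le hcond hlc⟩
      rw [bitsToNat_iteFn_pred hcond, hc, nuOf, if_pos rfl, if_pos hin, nuU]
    · have hcond : (ltW (indW p PT L') (valW p PT 0)) (boolPair z (wit x u τu τ0 τ1)) =
          [decide ((L'.boolIndicator (boolPair x u)).toNat < bitsToNat τu.reverse)] := by
        rw [ltW_apply, bitsToNat_indW_wit hx hu h0 h1, hc]
      have e : nuW p PT L' 0 (boolPair z (wit x u τu τ0 τ1)) = nuLeafW p PT L' (boolPair z (wit x u τu τ0 τ1)) := by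
        rw [nuW, iteFn_apply_false (by rw [innerW_wit hx hu h0 h1, decide_eq_false hin])]
      rw [e, nuLeafW]
      refine ⟨?_, length_iteFn_pred_le hcond hlc⟩
      rw [bitsToNat_iteFn_pred hcond, hc, nuOf, if_pos rfl, if_neg hin, nuLeaf]
  · have hcond : (orFn (ltW (k2W p PT) (valW p PT 1)) (andFn (ltW (valW p PT 0) (sumW p PT)) (ltW (fun _ => []) (valW p PT 1))))
        (boolPair z (wit x u τu τ0 τ1)) =
        [decide (2 ^ (mm - (u.length + 1)) < bitsToNat τ0.reverse ∨
          (bitsToNat τu.reverse < bitsToNat τ0.reverse + bitsToNat τ1.reverse ∧ 0 < bitsToNat τ0.reverse))] := by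
      rw [orFn_apply (ltW_apply _ _ _) (andFn_apply (ltW_apply _ _ _) (ltW_apply _ _ _)), hK2, ha, hc, hsum, bitsToNat_nil,
        Bool.decide_or, Bool.decide_and]
    rw [nuW, nuZeroW]
    refine ⟨?_, length_iteFn_pred_le hcond hla⟩
    rw [bitsToNat_iteFn_pred hcond, ha, nuOf, if_neg Nat.one_ne_zero, if_pos rfl]
  · have hcond : (orFn (ltW (k2W p PT) (valW p PT 2)) (andFn (ltW (valW p PT 0) (sumW p PT)) (ltW (fun _ => []) (valW p PT 2))))
        (boolPair z (wit x u τu τ0 τ1)) =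
        [decide (2 ^ (mm - (u.length + 1)) < bitsToNat τ1.reverse ∨
          (bitsToNat τu.reverse < bitsToNat τ0.reverse + bitsToNat τ1.reverse ∧ 0 < bitsToNat τ1.reverse))] := by
      rw [orFn_apply (ltW_apply _ _ _) (andFn_apply (ltW_apply _ _ _) (ltW_apply _ _ _)), hK2, hb, hc, hsum, bitsToNat_nil,
        Bool.decide_or, Bool.decide_and]
    rw [nuW, nuOneW]
    refine ⟨?_, length_iteFn_pred_le hcond hlb⟩
    rw [bitsToNat_iteFn_pred hcond, hb, nuOf, if_neg (show j + 1 + 1 ≠ 0 by omega), if_neg (show j + 1 + 1 ≠ 1 by omega)]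

/-- Value of the normaliser on a short numeral. [folklore] -/
theorem normW_apply {f : List Bool → List Bool} {v z' : List Bool} (hz : fstF v = z') (hf : (f v).length ≤ p.eval (lev PT z'.length) + 2) :
    normW p PT f v = natBits (p.eval (lev PT z'.length) + 2) (bitsToNat (f v)) := by
  simp only [normW, Function.comp_apply, fanoutFn_apply, hz, d0F_apply, padTakeFn_boolPair, fstF_boolPair]
  rw [List.length_replicate]
  exact takeD_eq_natBits hf

/-- **Value of the threshold slots on a parsed witness**: the threshold query at tag `tagOf u j` and
numeral `natBits D₀ (nuOf j)`, padded to `|z|`. [cite: ChenEtAl2022, §5.3 (proof of Thm. 6)] -/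
theorem tSlotF_wit (hx : x.length = nn) (hu : τu.length = DD) (h0 : τ0.length = DD) (h1 : τ1.length = DD) (j : ℕ) :
    tSlotF p PT pad hT L' j (boolPair z (wit x u τu τ0 τ1)) =
      tq pad hT z.length x (tagOf u j) (natBits (DD) (nuOf L' (mm) x u τu τ0 τ1 j)) := by
  obtain ⟨hv, hl⟩ := nuW_wit (p := p) (PT := PT) (L' := L') (z := z) (u := u) hx hu h0 h1 j
  simp only [tSlotF, Function.comp_apply, fanoutFn_apply, fstF_boolPair, xW_wit hx, uW_wit hx hu h0 h1, append_sfx,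
    normW_apply (fstF_boolPair z (wit x u τu τ0 τ1)) hl, hv, padRed_apply, tq]

end TVal

/-- **Value of the output maps** on `⟨z, bits⟩` with `|bits| ≥ 2Δ + 2`: builder on `⟨z, bits ↾ d*⟩`.
[cite: ChenEtAl2022, §5.1 (Lemma 6) with §5.3] -/
theorem slotG_apply (i : ℕ) (z bits : List Bool) (hlen : 2 * depth p PT z.length + 2 ≤ bits.length) :
    slotG p PT PQ pad hT hQ L' i (boolPair z bits) =
      (if i < 3 then tSlotF p PT pad hT L' i else qSlotF PQ pad hQ (i - 3))
        (boolPair z (bits.take (dstar (depth p PT z.length) bits))) := by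
  rw [slotG, Function.comp_apply, prepF_apply z bits hlen]

end Slots

end PPRefuter

end Literature.Computability.MetaComplexity

end


/-!
# Part 7. Correctness of the `PP` refuter: if a bad node exists, one of the six slots is a counterexample

Topic `Computability/MetaComplexity` (refuters for `PP`, Chen–Jin–Santhanam–Williams [ChenEtAl2022],
§5.3 with §5.1), the analysis of the core + slots of Parts 5–6.

Fix the oracle `A` (the language of the refuted algorithm), the truth `L`, the level data of the input
`z` (`|z| = N`), and assume the two reductions are truthful at this level: the padded threshold
queries answer the counting questions (`HT`, from `tq_truth`, Part 1) and the padded search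
questions answer membership in the search language `QL … A` (`HQ`). Then:

* `bits_getD_*` — the answer string of the core (`adBits coreQ A z R`, `R ≥ 2Δ+2`) at the positions
  read by the stopping test: the path bits, `α(ε)`, `α(y_d 0)`;
* `alpha_prefix` — the descent invariant: for `0 < d ≤ d*` the search question at the current prefix
  was answered YES ("we find the smallest length `m` such that … returns YES", [ChenEtAl2022, §5.2]);
* `exists_tSlot_disagree` — a witness in `B0` yields a threshold slot answered differently by `A` and
  `L` (the node analysis `exists_mem_nodeList_disagree` / `leaf_disagree` of
  `RefuterLocalConsistency.lean`, through `transOK` and `badVal`);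
* **`exists_slot_disagree`** — if `⟨z, ε⟩ ∈ QL` (some node of level `n` is locally inconsistent for
  `A`) then some slot `i < 6` satisfies `¬ (slot ∈ A ↔ slot ∈ L)` — the paper's case analysis of
  Algorithm 1 ([ChenEtAl2022, §5.1, proof of Thm. 4, three cases] with §5.3).

## References

* L. Chen, C. Jin, R. Santhanam, R. Williams, *Constructive separations and their consequences*,
  FOCS 2021 = TheoretiCS 3 (2024), §5.1 (proof of Thm. 4), §5.3 (proof of Thm. 6) [ChenEtAl2022].
-/

noncomputable section

namespace Literature.Computability.MetaComplexity

open _root_.Computability Polynomial Literature.Computability.Complexity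
  Literature.Computability.Complexity.Brick Literature.Computability.Complexity.AdQuery

namespace PPRefuter

section Analysis

variable {p PT PQ : Polynomial ℕ} {pad : List Bool × ℕ → List Bool} {hT hQ : List Bool → List Bool} {L L' A : Language Bool}
variable {z : List Bool}

local notation "nn" => lev PT (List.length z)
local notation "mm" => Polynomial.eval (lev PT (List.length z)) p
local notation "DD" => Polynomial.eval (lev PT (List.length z)) p + 2
local notation "Δ" => depth p PT (List.length z)

/-! ### Reading the answer string -/

/-- `getD` inside a known prefix. [folklore] -/
theorem getD_eq_of_take_eq {l pre : List Bool} {K : ℕ} (h : l.take K = pre) {i : ℕ} (hi : i < pre.length) :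
    l.getD i false = pre.getD i false := by
  subst h
  have hil : i < l.length := by rw [List.length_take] at hi; omega
  rw [List.getD_eq_getElem _ _ hi, List.getElem_take, List.getD_eq_getElem _ _ hil]

/-- The path bits satisfy the path recursion. [folklore] -/
theorem pathBits_getD (A : Language Bool) (z : List Bool) : ∀ {D d : ℕ}, d < D →
    (pathBits PQ pad hQ A z D).getD d false = A.boolIndicator (qq PQ pad hQ z (pathBits PQ pad hQ A z d ++ [true]))
  | 0, _, h => absurd h (Nat.not_lt_zero _)
  | D + 1, d, h => by
    rw [pathBits]
    rcases Nat.lt_or_ge d D with hlt | hge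
    · rw [List.getD_append _ _ _ _ (by simp; omega)]; exact pathBits_getD A z hlt
    · obtain rfl : d = D := by omega
      rw [List.getD_append_right _ _ _ _ (by simp)]; simp

/-- The path bit `d < Δ`: `[qq z (y_d 1) ∈ A]`, `y_d = path ↾ d`. [cite: ChenEtAl2022, §5.3 (proof of Thm. 6)] -/
theorem bits_getD_path {R d : ℕ} (hR : 2 * Δ + 1 ≤ R) (hd : d < Δ) :
    (adBits (coreQ p PT PQ pad hQ) A z R).getD d false =
      A.boolIndicator (qq PQ pad hQ z ((pathBits PQ pad hQ A z (Δ)).take d ++ [true])) := by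
  rw [getD_eq_of_take_eq (adBits_coreQ_take A z hR) (by simp; omega), List.getD_append _ _ _ _ (by simp; omega),
    pathBits_getD A z hd, pathBits_take A z hd.le]

/-- The bit `α(ε) = [qq z ε ∈ A]` at position `Δ`. [cite: ChenEtAl2022, §5.3 (proof of Thm. 6)] -/
theorem bits_getD_eps {R : ℕ} (hR : 2 * Δ + 1 ≤ R) :
    (adBits (coreQ p PT PQ pad hQ) A z R).getD (Δ) false = A.boolIndicator (qq PQ pad hQ z []) := by
  rw [getD_eq_of_take_eq (adBits_coreQ_take A z hR) (by simp), List.getD_append_right _ _ _ _ (by simp)]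
  simp [phaseB]

/-- The bit `α(y_d 0)` at position `Δ + 1 + d`, `d < Δ`. [cite: ChenEtAl2022, §5.3 (proof of Thm. 6)] -/
theorem bits_getD_zero {R d : ℕ} (hR : 2 * Δ + 1 ≤ R) (hd : d < Δ) :
    (adBits (coreQ p PT PQ pad hQ) A z R).getD (Δ + 1 + d) false =
      A.boolIndicator (qq PQ pad hQ z ((pathBits PQ pad hQ A z (Δ)).take d ++ [false])) := by
  rw [getD_eq_of_take_eq (adBits_coreQ_take A z hR) (by simp; omega), List.getD_append_right _ _ _ _ (by simp; omega)]
  simp only [length_pathBits, phaseB, show Δ + 1 + d - Δ = d + 1 by omega, List.getD_cons_succ]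
  rw [List.getD_eq_getElem _ _ (by simp; exact hd)]
  simp

/-- `[q ∈ A]` as a Boolean is `true` iff `q ∈ A`. [folklore] -/
theorem boolIndicator_eq_true_iff' (X : Language Bool) (q : List Bool) : X.boolIndicator q = true ↔ q ∈ X :=
  (Set.mem_iff_boolIndicator X q).symm

/-- `[q ∈ A] = false` iff `q ∉ A`. [folklore] -/
theorem boolIndicator_eq_false_iff' (X : Language Bool) (q : List Bool) : X.boolIndicator q = false ↔ q ∉ X :=
  (Set.notMem_iff_boolIndicator X q).symm

/-! ### The descent invariant -/

/-- **The descent invariant**: writing `bits` for the answer string and `d* = dstar Δ bits`, for every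
`0 < d ≤ d*` the search question on the prefix `path ↾ d` is answered YES by `A`.
[cite: ChenEtAl2022, §5.1 (proof of Thm. 4: "extend the prefix x one bit at a time")] -/
theorem alpha_prefix {R : ℕ} (hR : 2 * Δ + 2 ≤ R) {d : ℕ} (hd0 : 0 < d)
    (hd : d ≤ dstar (Δ) (adBits (coreQ p PT PQ pad hQ) A z R)) :
    qq PQ pad hQ z ((pathBits PQ pad hQ A z (Δ)).take d) ∈ A := by
  set bits := adBits (coreQ p PT PQ pad hQ) A z R with hbits
  obtain ⟨e, rfl⟩ : ∃ e, d = e + 1 := ⟨d - 1, by omega⟩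
  have he : e < Δ := by have := dstar_le (Δ) bits; omega
  have hstop := stopAt_of_lt_dstar (show e < dstar (Δ) bits by omega)
  have htake : (pathBits PQ pad hQ A z (Δ)).take (e + 1) =
      (pathBits PQ pad hQ A z (Δ)).take e ++ [bits.getD e false] := by
    rw [List.take_succ_eq_append_getElem (by simp; omega), ← List.getD_eq_getElem _ false (by simp; omega),
      getD_eq_of_take_eq (adBits_coreQ_take A z (by omega : 2 * Δ + 1 ≤ R)) (i := e) (by simp; omega),
      List.getD_append _ _ _ _ (by simp; omega)]
  rw [htake]
  cases hb : bits.getD e false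
  · -- went to the child `0`: the stop test did not fire, so `α(y_e 0)` was YES
    have h0 : bits.getD (Δ + 1 + e) false = true := by
      simp only [stopAt, he, decide_true, Bool.true_and, hb, Bool.not_false, Bool.and_true, Bool.or_eq_false_iff,
        Bool.not_eq_false'] at hstop
      exact hstop.2.1
    rw [hbits, bits_getD_zero (by omega) he, boolIndicator_eq_true_iff'] at h0
    exact h0
  · -- went to the child `1`: that answer was YES
    rw [hbits, bits_getD_path (by omega) he, boolIndicator_eq_true_iff'] at hb
    exact hb

/-! ### Threshold slots of a witness -/

/-- **A witness yields an incriminating threshold slot.** If `⟨z, wit x u τᵤ τ₀ τ₁⟩ ∈ B0 … A`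
(well formed, transcripts correct, locally inconsistent), then for some `j < 3` the threshold slot
`tSlotF j` is answered by `A` differently from `L`. [cite: ChenEtAl2022, §5.3 (proof of Thm. 6)] -/
theorem exists_tSlot_disagree
    (hpad : ∀ (q : List Bool) (N : ℕ), q.length ≤ N → (pad (q, N)).length = N ∧ (pad (q, N) ∈ L ↔ q ∈ L))
    (hTred : ∀ v, v ∈ ThresholdPP.TLang (Vpre L') p ↔ hT v ∈ L)
    (hTfit : ∀ x t s : List Bool, x.length = nn → t.length ≤ mm + 1 → s.length = DD →
      (hT (boolPair x (boolPair t s))).length ≤ z.length)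
    {x u τu τ0 τ1 : List Bool} (hx : x.length = nn) (hu : τu.length = DD) (h0 : τ0.length = DD)
    (h1 : τ1.length = DD) (hum : u.length ≤ mm) (ht : transOK pad hT A z.length (DD) x u τu τ0 τ1 = true)
    (hb : badVal L' (mm) x u τu τ0 τ1 = true) :
    ∃ j < 3, ¬ (tSlotF p PT pad hT L' j (boolPair z (wit x u τu τ0 τ1)) ∈ A ↔
        tSlotF p PT pad hT L' j (boolPair z (wit x u τu τ0 τ1)) ∈ L) ∧
      (tSlotF p PT pad hT L' j (boolPair z (wit x u τu τ0 τ1))).length = z.length := by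
  -- the threshold embedding of `x` is truthful, and its queries have length `|z|`
  have hxm : p.eval x.length = mm := by rw [hx]
  have hlenslot : ∀ j, (tSlotF p PT pad hT L' j (boolPair z (wit x u τu τ0 τ1))).length = z.length := by
    intro j
    rw [tSlotF_wit hx hu h0 h1 j]
    refine length_tq hpad hTred (hTfit x _ _ hx ?_ (length_natBits _ _))
    rcases j with _ | _ | j <;> simp [tagOf] <;> omega
  have htruth : ∀ t s : List Bool, t.length ≤ mm → s.length = DD →
      (tq pad hT z.length x t s ∈ L ↔ bitsToNat s < pcnt L' x (mm) t) := by
    intro t s htl hs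
    have := tq_truth (p := p) (D := DD) (x := x) (N := z.length) hpad hTred
      (fun t s ht' hs' => hTfit x t s hx (by rw [hxm] at ht'; omega) hs') t s (by rw [hxm]; exact htl) hs
    rwa [hxm] at this
  obtain ⟨eu, e0, e1⟩ := (transOK_eq_true_iff pad hT A z.length (DD) x u τu τ0 τ1).1 ht
  -- the claimed values are the `bsVal`s
  have hcv : bitsToNat τu.reverse = bsVal (DD) (ansOf A (tq pad hT z.length x) u) := by rw [eu]; rfl
  have hav : bitsToNat τ0.reverse = bsVal (DD) (ansOf A (tq pad hT z.length x) (u ++ [false])) := by rw [e0]; rfl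
  have hbv : bitsToNat τ1.reverse = bsVal (DD) (ansOf A (tq pad hT z.length x) (u ++ [true])) := by rw [e1]; rfl
  by_cases hin : u.length < mm
  · -- inner node
    have hbad : badNode (bsVal (DD) (ansOf A (tq pad hT z.length x) u)) (bsVal (DD) (ansOf A (tq pad hT z.length x) (u ++ [false])))
        (bsVal (DD) (ansOf A (tq pad hT z.length x) (u ++ [true]))) (2 ^ (mm - u.length)) = true := by
      rw [badVal, if_pos hin] at hb; rwa [← hcv, ← hav, ← hbv]
    have hKD : 2 ^ (mm - u.length) < 2 ^ (DD) - 1 := by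
      have h1' : 2 ^ (mm - u.length) ≤ 2 ^ (mm) := Nat.pow_le_pow_right (by norm_num) (Nat.sub_le _ _)
      have h2' : 2 ^ (DD) = 2 ^ (mm) * 4 := by rw [pow_add]; norm_num
      have h3' : 1 ≤ 2 ^ (mm) := Nat.one_le_two_pow
      omega
    obtain ⟨e, he, hne⟩ := exists_mem_nodeList_disagree (R := L') (x := x) (A := A) (L := L) hin hKD
      (fun t s htl hs => htruth t s htl hs) hbad
    simp only [nodeList, List.mem_cons, List.mem_nil_iff, or_false] at he
    rcases he with rfl | rfl | rfl
    · refine ⟨0, by norm_num, ?_, hlenslot 0⟩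
      rw [tSlotF_wit hx hu h0 h1 0, nuOf, if_pos rfl, if_pos hin, hcv, hav, hbv]; exact hne
    · refine ⟨1, by norm_num, ?_, hlenslot 1⟩
      rw [tSlotF_wit hx hu h0 h1 1, nuOf_one hin, hcv, hav, hbv]; exact hne
    · refine ⟨2, by norm_num, ?_, hlenslot 2⟩
      rw [tSlotF_wit hx hu h0 h1 2, nuOf_two hin, hcv, hav, hbv]; exact hne
  · -- leaf
    have hum' : u.length = mm := by omega
    have hleaf : pcnt L' x (mm) u = (L'.boolIndicator (boolPair x u)).toNat := pcnt_leaf hum'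
    have hbad : bsVal (DD) (ansOf A (tq pad hT z.length x) u) ≠ pcnt L' x (mm) u := by
      rw [badVal, if_neg hin, decide_eq_true_eq] at hb; rwa [← hcv, hleaf]
    have hD : 1 < 2 ^ (DD) - 1 := by
      have : 4 ≤ 2 ^ (DD) := by rw [pow_add]; have := Nat.one_le_two_pow (n := mm); norm_num; omega
      omega
    have hne := leaf_disagree (R := L') (x := x) (A := A) (L := L) hum' hD (fun t s htl hs => htruth t s htl hs) hbad
    refine ⟨0, by norm_num, ?_, hlenslot 0⟩
    rw [tSlotF_wit hx hu h0 h1 0, nuOf, if_pos rfl, if_neg hin, hcv, ← hleaf]; exact hne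

/-! ### The case analysis -/

/-- **If a bad node exists, some slot is a counterexample.** Let `bits = adBits coreQ A z R` with
`R ≥ 2Δ + 2` scheduled rounds. If `⟨z, ε⟩ ∈ QL … A` then for some `i < 6` the slot `slotG i ⟨z, bits⟩`
is answered by `A` differently from `L`. (Case analysis of the stopping level of Algorithm 1,
[ChenEtAl2022, §5.1], with the node analysis of §5.3.) [cite: ChenEtAl2022, §5.3 (proof of Thm. 6)] -/
theorem exists_slot_disagree
    (hpad : ∀ (q : List Bool) (N : ℕ), q.length ≤ N → (pad (q, N)).length = N ∧ (pad (q, N) ∈ L ↔ q ∈ L))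
    (hTred : ∀ v, v ∈ ThresholdPP.TLang (Vpre L') p ↔ hT v ∈ L)
    (hTfit : ∀ x t s : List Bool, x.length = nn → t.length ≤ mm + 1 → s.length = DD →
      (hT (boolPair x (boolPair t s))).length ≤ z.length)
    (hQred : ∀ y : List Bool, y.length ≤ Δ + 1 → (qq PQ pad hQ z y ∈ L ↔ boolPair z y ∈ QL p PT pad hT L' A))
    (hQfit : ∀ y : List Bool, y.length ≤ Δ + 1 → (hQ (boolPair z y)).length ≤ PQ.eval z.length)
    {R : ℕ} (hR : 2 * Δ + 2 ≤ R) (hQL : boolPair z [] ∈ QL p PT pad hT L' A) :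
    ∃ i < 6, ¬ (slotG p PT PQ pad hT hQ L' i (boolPair z (adBits (coreQ p PT PQ pad hQ) A z R)) ∈ A ↔
      slotG p PT PQ pad hT hQ L' i (boolPair z (adBits (coreQ p PT PQ pad hQ) A z R)) ∈ L) ∧
      (slotG p PT PQ pad hT hQ L' i (boolPair z (adBits (coreQ p PT PQ pad hQ) A z R))).length =
        (if i < 3 then z.length else PQ.eval z.length) := by
  set bits := adBits (coreQ p PT PQ pad hQ) A z R with hbits
  have hlen : 2 * Δ + 2 ≤ bits.length := by rw [hbits, length_adBits]; exact hR
  set ds := dstar (Δ) bits with hds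
  have hdsle : ds ≤ Δ := dstar_le _ _
  set ys := (pathBits PQ pad hQ A z (Δ)).take ds with hys
  have hys_len : ys.length = ds := by rw [hys, List.length_take, length_pathBits, min_eq_left hdsle]
  have htakebits : bits.take ds = ys := by
    have h := congrArg (List.take ds) (adBits_coreQ_take (p := p) (PT := PT) (PQ := PQ) (pad := pad) (hQ := hQ) A z (R := R) (by omega))
    rw [List.take_take, min_eq_left (by omega)] at h
    rw [hbits, h, List.take_append_of_le_length (by rw [length_pathBits]; exact hdsle)]
  -- values of the slots
  have hslot : ∀ i, slotG p PT PQ pad hT hQ L' i (boolPair z bits) =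
      (if i < 3 then tSlotF p PT pad hT L' i else qSlotF PQ pad hQ (i - 3)) (boolPair z ys) := by
    intro i; rw [slotG_apply i z bits hlen, htakebits]
  have hq : ∀ j, qSlotF PQ pad hQ j (boolPair z ys) = qq PQ pad hQ z (ys ++ sfx j) := fun j => qSlotF_apply j z ys
  -- lengths of the search questions
  have hsfx : ∀ j, (sfx j).length ≤ 1 := by
    intro j; rcases j with _ | _ | j <;> simp [sfx]
  have hqlen : ∀ j, (qq PQ pad hQ z (ys ++ sfx j)).length = PQ.eval z.length := fun j =>
    (hpad _ _ (hQfit _ (by rw [List.length_append, hys_len]; have := hsfx j; omega))).1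
  -- the goal, abbreviated
  set Goal := ∃ i < 6, ¬ (slotG p PT PQ pad hT hQ L' i (boolPair z bits) ∈ A ↔ slotG p PT PQ pad hT hQ L' i (boolPair z bits) ∈ L) ∧
      (slotG p PT PQ pad hT hQ L' i (boolPair z bits)).length = (if i < 3 then z.length else PQ.eval z.length) with hGoal
  -- the three ways to conclude
  have concludeT : (∃ j < 3, ¬ (tSlotF p PT pad hT L' j (boolPair z ys) ∈ A ↔ tSlotF p PT pad hT L' j (boolPair z ys) ∈ L) ∧
      (tSlotF p PT pad hT L' j (boolPair z ys)).length = z.length) → Goal := by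
    rintro ⟨j, hj, hne, hl⟩
    refine ⟨j, by omega, ?_, ?_⟩
    · rw [hslot, if_pos hj]; exact hne
    · rw [hslot, if_pos hj, if_pos (by omega)]; exact hl
  have concludeQ : ∀ j < 3, ¬ (qq PQ pad hQ z (ys ++ sfx j) ∈ A ↔ qq PQ pad hQ z (ys ++ sfx j) ∈ L) → Goal := by
    intro j hj hne
    refine ⟨j + 3, by omega, ?_, ?_⟩
    · rw [hslot, if_neg (by omega), Nat.add_sub_cancel, hq]; exact hne
    · rw [hslot, if_neg (by omega), if_neg (by omega), Nat.add_sub_cancel, hq]; exact hqlen j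
  -- a witness at the stopping prefix gives a threshold slot
  have caseB0 : boolPair z ys ∈ B0 p PT pad hT L' A → Goal := by
    intro hB
    obtain ⟨x, u, τu, τ0, τ1, hw, hx, hu, h0, h1, hum, ht, hb⟩ := exists_wit_of_mem_B0 hB
    apply concludeT
    rw [hw]
    exact exists_tSlot_disagree hpad hTred hTfit hx hu h0 h1 hum ht hb
  -- the stop test fired at `ds`
  have hfire := stopAt_dstar (Δ) bits
  rw [← hds] at hfire
  -- truthfulness of the search questions at the prefixes involved
  have hQ0 := hQred ys (by omega)
  have hQf := hQred (ys ++ [false]) (by simp; omega)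
  have hQt := hQred (ys ++ [true]) (by simp; omega)
  by_cases hB : boolPair z ys ∈ B0 p PT pad hT L' A
  · exact caseB0 hB
  -- not a witness: `QL ys ↔ QL (ys0) ∨ QL (ys1)`
  have hrec : boolPair z ys ∈ QL p PT pad hT L' A ↔
      boolPair z (ys ++ [false]) ∈ QL p PT pad hT L' A ∨ boolPair z (ys ++ [true]) ∈ QL p PT pad hT L' A := by
    rw [mem_QL_iff_or]; simp [hB]
  -- `QL ys` holds and `α(ys) ↔ QL ys` unless slot 3 is a counterexample
  by_cases hagree : (qq PQ pad hQ z ys ∈ A ↔ qq PQ pad hQ z ys ∈ L)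
  swap
  · exact concludeQ 0 (by norm_num) (by simpa [sfx] using hagree)
  have hQLys : boolPair z ys ∈ QL p PT pad hT L' A := by
    rcases Nat.eq_zero_or_pos ds with h0 | hpos
    · have : ys = [] := List.eq_nil_of_length_eq_zero (by rw [hys_len, h0])
      rw [this]; exact hQL
    · exact hQ0.1 (hagree.1 (by rw [hys]; exact alpha_prefix hR hpos le_rfl))
  -- read the firing clause
  simp only [stopAt, Bool.or_eq_true, Bool.and_eq_true, decide_eq_true_eq, Bool.not_eq_true'] at hfire
  rcases hfire with ⟨hds0, heps⟩ | ⟨hlt, hz0, hz1⟩ | hlast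
  · -- `d* = 0` and `α(ε) = NO`, but `QL ε` is true: slot 3 = `qq ε`
    rw [hbits, bits_getD_eps (by omega), boolIndicator_eq_false_iff'] at heps
    have : ys = [] := List.eq_nil_of_length_eq_zero (by rw [hys_len, hds0])
    refine concludeQ 0 (by norm_num) ?_
    rw [this]; simp only [sfx, List.append_nil]
    exact fun h => heps (h.2 ((hQred [] (by simp)).2 hQL))
  · -- both children answered NO but one of them has a bad node below
    rw [hbits, bits_getD_zero (by omega) hlt, boolIndicator_eq_false_iff', ← hys] at hz0
    rw [hbits, bits_getD_path (by omega) hlt, boolIndicator_eq_false_iff', ← hys] at hz1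
    rcases hrec.1 hQLys with hf | htr
    · exact concludeQ 1 (by norm_num) (fun h => hz0 (h.2 (hQf.2 hf)))
    · exact concludeQ 2 (by norm_num) (fun h => hz1 (h.2 (hQt.2 htr)))
  · -- full depth: the children are too long to have bad nodes below, so `QL ys` is false — contradiction
    exfalso
    have hlong : ∀ b : Bool, boolPair z (ys ++ [b]) ∉ QL p PT pad hT L' A := by
      intro b hb
      have := length_le_of_mem_QL hb
      rw [List.length_append, List.length_singleton, hys_len, hlast] at this
      simp only [depth] at this
      omega
    rcases hrec.1 hQLys with hf | htr
    · exact hlong false hf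
    · exact hlong true htr

end Analysis

end PPRefuter

end Literature.Computability.MetaComplexity

end


/-!
# Part 8. If no bad node exists, the refuted algorithm decides the `PP`-complete language at that level

Topic `Computability/MetaComplexity` (refuters for `PP`, Chen–Jin–Santhanam–Williams [ChenEtAl2022],
§5.3), the contrapositive half of "`D^A` cannot correctly solve `#SAT` on all possible `φ`, since
otherwise it would contradict the assumption `PP ⊄ P`" ([ChenEtAl2022, §5.3]) in the tree's
rendering, plus three small tools of the final assembly.

* `decQ`, `decD`, `Ldec` — the bounded adaptive reduction that runs ONE binary search at the root
  `(x, ε)` through the padded threshold embedding at padding length `PT(|x|)` and accepts iff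
  `2^{p|x|} < 2 ·(claimed count)`; `Ldec … A ∈ BPP` for `A ∈ BPP` (`AdaptiveBPPSimulation.adLang_mem_BPP`);
* **`mem_Ldec_iff`** — if `⟨1^{PT|x|}, ε⟩ ∉ QL … A` (no node of level `|x|` is locally inconsistent for
  `A`), then `x ∈ Ldec … A ↔ x ∈ L` (`bsVal_nil_eq_countWitnesses`: consistent claims are the count;
  majority threshold `half_lt_uniformProb_iff`) — no truthfulness of the reductions is needed here;
* `mem_BPP_of_eqOn_le` — `BPP` is invariant under finite variations (hard-wire the short inputs);
* `adBits_precomp` — precomposing the input of a query generator; `slotG_eq_of_take_eq` — the slots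
  only depend on the first `2Δ + 2` answer bits (so extra scheduled rounds are harmless).

## References

* L. Chen, C. Jin, R. Santhanam, R. Williams, *Constructive separations and their consequences*,
  FOCS 2021 = TheoretiCS 3 (2024), §5.3 (proof of Thm. 6) [ChenEtAl2022].
* S. Arora, B. Barak, *Computational Complexity: A Modern Approach*, CUP 2009, §17.2.1, proof of
  Lemma 17.7 [AroraBarak2009].
-/

noncomputable section

namespace Literature.Computability.MetaComplexity

open _root_.Computability Polynomial Literature.Computability.Complexity
  Literature.Computability.Complexity.Brick Literature.Computability.Complexity.Plumb
  Literature.Computability.Complexity.AdQuery Literature.Computability.Complexity.BinSearchPP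
  Literature.Computability.Complexity.CoinEnum Literature.Computability.Complexity.PPSharpP

namespace PPRefuter

/-! ### The root decider -/

section Decider

variable (p PT : Polynomial ℕ) (pad : List Bool × ℕ → List Bool) (hT : List Bool → List Bool)

/-- **Query generator of the root binary search**: `⟨x, a⟩ ↦ tq pad hT (PT |x|) x ε (qryNum (p|x|+2) a)`.
[cite: ChenEtAl2022, §5.3 (proof of Thm. 6: the algorithm `D^A`)] -/
def decQ : List Bool → List Bool :=
  padRed pad hT ∘ fanoutFn (fanoutFn fstP (fanoutFn (fun _ => []) (numFn (p + 1) sndP))) (polyFn PT ∘ fstP)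

/-- **The acceptance test**: `2^{p|x|} < 2 · val(aᴿ)` on `⟨x, a⟩` (majority threshold of the claimed count).
[cite: ChenEtAl2022, §5.3 (proof of Thm. 6)] -/
def decTest : List Bool → List Bool :=
  ltFn ∘ fanoutFn (fun w => (Kannan.zerosFn ∘ polyFn p ∘ fstF) w ++ [true]) (List.cons false ∘ List.reverse ∘ sndF)

/-- The acceptance language. [folklore] -/
def decD : Language Bool := {w | decTest p w = [true]}

/-- **The root decider** as a bounded adaptive reduction to `A`: `p + 2` rounds of `decQ`, then `decD`.
[cite: ChenEtAl2022, §5.3 (proof of Thm. 6)] -/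
def Ldec (A : Language Bool) : Language Bool := adLang (decQ p PT pad hT) (p + 2) (decD p) A

variable {p PT pad hT}

/-- `decQ ∈ FP`. [folklore] -/
theorem decQ_mem_FP
    (hpad : PolyTimeComputable (fun q : List Bool × ℕ => boolPair q.1 (unaryEncodeNat q.2)) (id : List Bool → List Bool) pad)
    (hh : hT ∈ FP) : decQ p PT pad hT ∈ FP :=
  comp_mem_FP (padRed_mem_FP hpad hh) (fanoutFn_mem_FP (fanoutFn_mem_FP fstP_mem_FP
    (fanoutFn_mem_FP (const_mem_FP _) (numFn_mem_FP sndP_mem_FP))) (comp_mem_FP (polyFn_mem_FP PT) fstP_mem_FP))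

/-- `decTest ∈ FP`. [folklore] -/
theorem decTest_mem_FP : decTest p ∈ FP :=
  comp_mem_FP ltFn_mem_FP (fanoutFn_mem_FP
    (append_mem_FP (comp_mem_FP Kannan.zerosFn_mem_FP (comp_mem_FP (polyFn_mem_FP p) fstF_mem_FP)) (const_mem_FP _))
    (comp_mem_FP (cons_mem_FP false) (comp_mem_FP reverse_mem_FP sndF_mem_FP)))

/-- **`decD ∈ P`.** [folklore] -/
theorem decD_mem_P : decD p ∈ Classes.P :=
  mem_P_of_mem_FP decTest_mem_FP _ fun w => ⟨fun h => h, fun h => by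
    obtain ⟨b, hb⟩ := (oneBit_ltFn.comp _ : OneBit (decTest p)) w
    cases b
    · exact hb
    · exact absurd hb h⟩

/-- Value of the query generator. [folklore] -/
theorem decQ_apply (x a : List Bool) :
    decQ p PT pad hT (boolPair x a) = tq pad hT (PT.eval x.length) x [] (qryNum (p.eval x.length + 2) a) := by
  simp only [decQ, Function.comp_apply, fanoutFn_apply, fstP_boolPair, numFn_apply, sndP_boolPair, polyFn_apply, padRed_apply,
    List.length_replicate, eval_add, eval_one, tq]

/-- Membership in the acceptance language. [folklore] -/
theorem mem_decD_iff (x a : List Bool) : boolPair x a ∈ decD p ↔ 2 ^ p.eval x.length < 2 * bitsToNat a.reverse := by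
  change decTest p (boolPair x a) = [true] ↔ _
  simp only [decTest, Function.comp_apply, fanoutFn_apply, fstF_boolPair, sndF_boolPair, polyFn_apply, Kannan.zerosFn_apply,
    List.length_replicate, ltFn_boolPair, bitsToNat_append, bitsToNat_replicate_false, bitsToNat_cons, List.cons.injEq,
    and_true, decide_eq_true_eq]
  simp

/-- **`Ldec … A ∈ BPP`** for `A ∈ BPP`. [cite: AroraBarak2009, §7.4.1 with Thm. 7.10] -/
theorem Ldec_mem_BPP
    (hpad : PolyTimeComputable (fun q : List Bool × ℕ => boolPair q.1 (unaryEncodeNat q.2)) (id : List Bool → List Bool) pad)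
    (hh : hT ∈ FP) {A : Language Bool} (hA : A ∈ BPP) : Ldec p PT pad hT A ∈ BPP :=
  AdBPPSim.adLang_mem_BPP hA (decQ_mem_FP hpad hh) (p + 2) decD_mem_P

/-- **The answers of the root search are the transcript** at the tag `ε`. [cite: ChenEtAl2022, §5.3 (proof of Thm. 6)] -/
theorem adBits_decQ (A : Language Bool) (x : List Bool) :
    ∀ k, adBits (decQ p PT pad hT) A x k = bsBits (p.eval x.length + 2) (ansOf A (tq pad hT (PT.eval x.length) x) []) k
  | 0 => rfl
  | k + 1 => by rw [adBits_succ, adBits_decQ A x k, bsBits_succ, decQ_apply]; rfl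

/-- **If no node of level `|x|` is bad, the decider is right on `x`.** Let `PT` be strictly increasing
with `PT(i) ≥ i` (so the level of `N = PT(|x|)` is `|x|`), `L` have the majority-vote witness
`L', p`, and suppose `⟨1ᴺ, ε⟩ ∉ QL … A`. Then `x ∈ Ldec … A ↔ x ∈ L`.
[cite: ChenEtAl2022, §5.3 (proof of Thm. 6)] -/
theorem mem_Ldec_iff {L L' A : Language Bool} (hmono : StrictMono fun i => PT.eval i) (hge : ∀ i, i ≤ PT.eval i)
    (hL : ∀ x : List Bool, x ∈ L ↔ 1 / 2 < uniformProb (p.eval x.length) {y | boolPair x y ∈ L'})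
    (x : List Bool) (hgood : boolPair (ones (PT.eval x.length)) [] ∉ QL p PT pad hT L' A) :
    x ∈ Ldec p PT pad hT A ↔ x ∈ L := by
  set N := PT.eval x.length with hN
  set z : List Bool := ones N with hz
  have hzl : z.length = N := by simp [hz]
  have hlev : lev PT z.length = x.length := by rw [hzl, hN]; exact pinv_eval PT hmono hge _
  set D := p.eval x.length + 2 with hD
  set τ' := tq pad hT N x with hτ
  -- every node has locally consistent claimed values
  have key : ∀ u : List Bool, u.length ≤ p.eval x.length →
      badVal L' (p.eval x.length) x u (bsBits D (ansOf A τ' u) D) (bsBits D (ansOf A τ' (u ++ [false])) D)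
        (bsBits D (ansOf A τ' (u ++ [true])) D) = false := by
    intro u hu
    by_contra hb
    rw [Bool.not_eq_false] at hb
    apply hgood
    rw [mem_QL_iff]
    refine ⟨wit x u (bsBits D (ansOf A τ' u) D) (bsBits D (ansOf A τ' (u ++ [false])) D) (bsBits D (ansOf A τ' (u ++ [true])) D), ?_⟩
    rw [List.nil_append, mem_B0_wit_iff (p := p) (PT := PT) (by rw [hlev]) (by rw [length_bsBits, hlev])
      (by rw [length_bsBits, hlev]) (by rw [length_bsBits, hlev])]
    refine ⟨by rw [hlev]; exact hu, ?_, by rw [hlev]; exact hb⟩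
    rw [transOK_eq_true_iff, hlev, hzl]
    exact ⟨rfl, rfl, rfl⟩
  -- hence the root claim is the witness count
  have hroot : bsVal D (ansOf A τ' []) = countWitnesses L' (p.eval x.length) x := by
    refine bsVal_nil_eq_countWitnesses (R := L') (x := x) (m := p.eval x.length) (fun u hu => ?_) (fun u hu => ?_)
    · have h := key u hu.le
      rw [badVal, if_pos hu] at h
      exact h
    · have h := key u hu.le
      rw [badVal, if_neg (by omega)] at h
      simp only [decide_eq_false_iff_not, not_not] at h
      rw [bsVal, h, pcnt_leaf hu]
  rw [Ldec, mem_adLang_iff, show (p + 2 : Polynomial ℕ).eval x.length = D by simp [hD], adBits_decQ, mem_decD_iff, ← bsVal,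
    hroot, hL x, half_lt_uniformProb_iff, countWitnesses_eq_cnt]

end Decider

/-! ### `BPP` is invariant under finite variations -/

/-- Events agreeing on the strings of length `m` have the same probability. [folklore] -/
theorem uniformProb_congr' {m : ℕ} {E E' : Set (List Bool)} (h : ∀ y : List Bool, y.length = m → (y ∈ E ↔ y ∈ E')) :
    uniformProb m E = uniformProb m E' := by
  rw [uniformProb_eq_cnt_div, uniformProb_eq_cnt_div, cnt_congr h]

/-- A sure event has probability `1`. [folklore] -/
theorem uniformProb_eq_one_of_forall' {m : ℕ} {E : Set (List Bool)} (h : ∀ y : List Bool, y.length = m → y ∈ E) :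
    uniformProb m E = 1 := by
  rw [uniformProb_eq_cnt_div, cnt_eq_two_pow_of_forall h]
  simp

/-- The short part `{x ∈ L | |x| < n₀}` of any language is in `P` (hard-wired). [folklore] -/
theorem shortPart_mem_P' (L : Language Bool) (n₀ : ℕ) : ({x | x ∈ L ∧ x.length < n₀} : Language Bool) ∈ Classes.P := by
  refine mem_P_of_mem_FP (g := fun x => if n₀ ≤ x.length then [false] else encodeBool (L.boolIndicator x))
    (mem_FP_of_eqOn_le (const_mem_FP [false]) n₀ fun z hz => if_pos hz) _ fun w => ⟨fun hw => ?_, fun hw => ?_⟩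
  · obtain ⟨hwL, hwn⟩ := hw
    show (if n₀ ≤ w.length then [false] else encodeBool (L.boolIndicator w)) = [true]
    rw [if_neg (Nat.not_le.2 hwn), (Set.mem_iff_boolIndicator _ _).1 hwL]; rfl
  · show (if n₀ ≤ w.length then [false] else encodeBool (L.boolIndicator w)) = [false]
    by_cases hn : n₀ ≤ w.length
    · rw [if_pos hn]
    · have hwL : w ∉ L := fun hwL => hw ⟨hwL, Nat.not_le.1 hn⟩
      rw [if_neg hn, (Set.notMem_iff_boolIndicator _ _).1 hwL]; rfl

/-- The inputs of length `≥ n₀` form a `P` language. [folklore] -/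
theorem setOf_le_length_mem_P' (n₀ : ℕ) : ({x | n₀ ≤ x.length} : Language Bool) ∈ Classes.P :=
  mem_P_of_mem_FP (g := fun x => if n₀ ≤ x.length then [true] else [false])
    (mem_FP_of_eqOn_le (const_mem_FP [true]) n₀ fun _ hz => if_pos hz) _ fun _ => ⟨fun hw => if_pos hw, fun hw => if_neg hw⟩

/-- **`BPP` is invariant under finite variations**: if `L` agrees with some `L₁ ∈ BPP` on every input
of length `≥ n₀` then `L ∈ BPP` (patch the witness language: long inputs as before, short inputs
decided outright). [cite: AroraBarak2009, §7.1 (with §1.3: hard-wiring finitely many inputs)] -/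
theorem mem_BPP_of_eqOn_le {L L₁ : Language Bool} (hL₁ : L₁ ∈ BPP) (n₀ : ℕ)
    (h : ∀ x : List Bool, n₀ ≤ x.length → (x ∈ L ↔ x ∈ L₁)) : L ∈ BPP := by
  obtain ⟨B₁, hB₁, q, hq⟩ := hL₁
  set B : Language Bool := ((fstF ⁻¹' {x | n₀ ≤ x.length}) ⊓ B₁) ⊔ (fstF ⁻¹' {x | x ∈ L ∧ x.length < n₀}) with hB
  have hBP : B ∈ Classes.P :=
    union_mem_P (inter_mem_P (preimage_mem_P (setOf_le_length_mem_P' n₀) fstF_mem_FP) hB₁)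
      (preimage_mem_P (shortPart_mem_P' L n₀) fstF_mem_FP)
  have hmem : ∀ x y : List Bool, boolPair x y ∈ B ↔ (n₀ ≤ x.length ∧ boolPair x y ∈ B₁) ∨ (x ∈ L ∧ x.length < n₀) := by
    intro x y
    simp only [hB, PPSharpP.memL_sup, ThresholdPP.memL_inf', memL_preimage, fstF_boolPair]
    rfl
  refine ⟨B, hBP, q, fun x => ?_⟩
  by_cases hn : n₀ ≤ x.length
  · refine le_trans (hq x) (le_of_eq (uniformProb_congr' ?_))
    intro y _
    have hor : ((n₀ ≤ x.length ∧ boolPair x y ∈ B₁) ∨ (x ∈ L ∧ x.length < n₀)) ↔ boolPair x y ∈ B₁ :=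
      ⟨fun h' => h'.elim And.right (fun h'' => absurd h''.2 (by omega)), fun h' => Or.inl ⟨hn, h'⟩⟩
    rw [Set.mem_setOf_eq, Set.mem_setOf_eq, hmem, hor, h x hn]
  · have hall : ∀ y : List Bool, y ∈ {y : List Bool | boolPair x y ∈ B ↔ x ∈ L} := by
      intro y
      rw [Set.mem_setOf_eq, hmem]
      constructor
      · rintro (⟨h1, -⟩ | ⟨h1, -⟩)
        · omega
        · exact h1
      · intro hx; exact Or.inr ⟨hx, by omega⟩
    rw [uniformProb_eq_one_of_forall' (fun y _ => hall y)]
    norm_num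

/-! ### Two invariances of the core -/

/-- **Precomposing the input**: if `Qg' ⟨x', b⟩ = Qg ⟨f x', b⟩` for all `b` then the answer bits of
`Qg'` on `x'` are those of `Qg` on `f x'`. [folklore] -/
theorem adBits_precomp {Qg Qg' : List Bool → List Bool} {f : List Bool → List Bool} {A : Language Bool} {x' : List Bool}
    (h : ∀ b : List Bool, Qg' (boolPair x' b) = Qg (boolPair (f x') b)) : ∀ k, adBits Qg' A x' k = adBits Qg A (f x') k
  | 0 => rfl
  | k + 1 => by rw [adBits_succ, adBits_succ, adBits_precomp h k, h]

section Invariance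

variable {p PT PQ : Polynomial ℕ} {pad : List Bool × ℕ → List Bool} {hT hQ : List Bool → List Bool} {L' : Language Bool}

/-- The stop test reads only the first `2Δ + 2` bits. [folklore] -/
theorem stopAt_eq_of_take_eq {Δ : ℕ} {bits bits' : List Bool} (h : bits.take (2 * Δ + 2) = bits'.take (2 * Δ + 2))
    (hl : 2 * Δ + 2 ≤ bits.length) (hl' : 2 * Δ + 2 ≤ bits'.length) {d : ℕ} (hd : d ≤ Δ) : stopAt Δ bits d = stopAt Δ bits' d := by
  have hget : ∀ i < 2 * Δ + 2, bits.getD i false = bits'.getD i false := by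
    intro i hi
    rw [getD_eq_of_take_eq (rfl : bits.take (2 * Δ + 2) = _) (by rw [List.length_take]; omega),
      getD_eq_of_take_eq (rfl : bits'.take (2 * Δ + 2) = _) (by rw [List.length_take]; omega), h]
  simp only [stopAt, hget Δ (by omega), hget (Δ + 1 + d) (by omega), hget d (by omega)]

/-- The stopping level reads only the first `2Δ + 2` bits. [folklore] -/
theorem dstar_eq_of_take_eq {Δ : ℕ} {bits bits' : List Bool} (h : bits.take (2 * Δ + 2) = bits'.take (2 * Δ + 2))
    (hl : 2 * Δ + 2 ≤ bits.length) (hl' : 2 * Δ + 2 ≤ bits'.length) : dstar Δ bits = dstar Δ bits' := by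
  apply le_antisymm
  · exact Nat.find_min' _ (by rw [stopAt_eq_of_take_eq h hl hl' (dstar_le _ _)]; exact stopAt_dstar _ _)
  · exact Nat.find_min' _ (by rw [← stopAt_eq_of_take_eq h hl hl' (dstar_le _ _)]; exact stopAt_dstar _ _)

/-- **The slots read only the first `2Δ + 2` answer bits.** [folklore] -/
theorem slotG_eq_of_take_eq (i : ℕ) (z : List Bool) {bits bits' : List Bool}
    (h : bits.take (2 * depth p PT z.length + 2) = bits'.take (2 * depth p PT z.length + 2))
    (hl : 2 * depth p PT z.length + 2 ≤ bits.length) (hl' : 2 * depth p PT z.length + 2 ≤ bits'.length) :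
    slotG p PT PQ pad hT hQ L' i (boolPair z bits) = slotG p PT PQ pad hT hQ L' i (boolPair z bits') := by
  rw [slotG_apply i z bits hl, slotG_apply i z bits' hl', dstar_eq_of_take_eq h hl hl']
  have hle : dstar (depth p PT z.length) bits' ≤ 2 * depth p PT z.length + 2 := (dstar_le _ _).trans (by omega)
  have : bits.take (dstar (depth p PT z.length) bits') = bits'.take (dstar (depth p PT z.length) bits') := by
    have h1 := congrArg (List.take (dstar (depth p PT z.length) bits')) h
    rwa [List.take_take, List.take_take, min_eq_left hle] at h1
  rw [this]

end Invariance

end PPRefuter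

end Literature.Computability.MetaComplexity

end


/-!
# Part 9. Thm. 1.2 of Chen–Jin–Santhanam–Williams for `(𝒞, 𝒟) = (BPP, PP)`: the discharge

Topic `Computability/MetaComplexity`. Proof of the named fact
`constructiveSeparation_of_not_subset_BPP_PP` of `ConstructiveSeparations.lean`:

  `PP ⊄ BPP →` every paddable `PP`-complete language `L` has, against every `L'' ∈ BPP`, a
  `BPP`-refuter ([ChenEtAl2022], Thm. 1.2 = Thm. 6 of §5.3, with Lemma 6 of §5.1 and the amplification
  remark closing the proof of Thm. 4).

Assembly of Parts 1–8 above (with the landed layers `RefuterBinarySearch`, `RefuterLocalConsistency`,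
`RefuterParams` of this directory and `Complexity/AdaptiveBPPSimulation.lean`):

1. Data: the majority-vote witness `L' ∈ P`, `p` of `L ∈ PP`; the padding `pad`; the Karp reduction
   `hT` of the threshold language `TLang (Vpre L') p ∈ PP` to `L` (hardness); the padding polynomial
   `PT` (strictly increasing, fits all threshold queries of a level); the search language
   `QL … L'' ∈ NP^{L''} ⊆ PP^{L''} ⊆ PP` (`QL_mem_NPRel`; `polyExists_subset_pMajority`; `BPP` is low
   for `PP`: `BPP ⊆ AWPP` (`BPP_subset_AWPP`, the witness count as a `GapP` function) and
   `AWPP_low_PP`, in the tree) and its Karp reduction `hQ`, padding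
   polynomial `PQ`. (The paper reduces an `r`-dependent `NP` question; reducing the `L''`-dependent one
   instead keeps the refuter's run canonical, which Lemma 6 needs — see Parts 3–4.)
2. Infinitely many levels have a bad node (`exists_bad_level`): otherwise the root decider
   (`mem_Ldec_iff`, Part 8, in `BPP` by `adLang_mem_BPP`) decides `L` on all long inputs, so
   `L ∈ BPP` (`mem_BPP_of_eqOn_le`) and `PP ⊆ BPP` (`mem_BPP_of_karpReducible`) — "otherwise it would
   contradict the assumption `PP ⊄ 𝒞`" ([ChenEtAl2022, §5.3]).
3. At a bad level one of the six slots is a counterexample of the right length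
   (`exists_slot_disagree`, Part 7); by pigeonhole one slot index serves infinitely many levels
   (Lemma 6 of [ChenEtAl2022]); the refuter for a threshold slot runs the core on `1ᴺ`, the one for a
   search slot first inverts `PQ` (`RefuterParams.invF`); both are bounded adaptive reductions to
   `L''`, hence pseudo-deterministic `BPP` computations (`exists_randAlg_adFn_unary`, success `≥ 3/4`
   on the canonical value), which gives `IsBPPRefuter` with the printed constant `2/3`.

## References

* L. Chen, C. Jin, R. Santhanam, R. Williams, *Constructive separations and their consequences*,
  FOCS 2021 = TheoretiCS 3 (2024), Thm. 1.2; §5.1 (Lemma 6, Thm. 4), §5.3 (Thm. 6) [ChenEtAl2022].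
-/

noncomputable section

namespace Literature.Computability.MetaComplexity

open _root_.Computability Polynomial Filter Literature.Computability.Complexity
  Literature.Computability.Complexity.Brick Literature.Computability.Complexity.Plumb
  Literature.Computability.Complexity.AdQuery Literature.Computability.QuantumComplexity PPRefuter

open scoped Literature.Computability.Complexity.Notation

/-! ### Class-level ingredients -/

/-- `NP^O ⊆ PP^O` (one extra coin; the tree's `polyExists_subset_pMajority` at `K = P^O`).
[cite: ChenEtAl2022, §5.3 (proof of Thm. 6: "since NP ⊆ PP")] -/
theorem NPRel_subset_PPRel (O : Oracle) : NPRel O ⊆ PPRel O :=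
  polyExists_subset_pMajority (K := PRel O) (fun _ hL _ hg => preimage_mem_PRel hL hg) (P_subset_PRel_holds O)

/-- **`BPP ⊆ AWPP`**: the witness count of a `BPP` witness language is a `#P ⊆ GapP` function within
the `AWPP` bounds (`≥ 2/3·2^p` on members, `≤ 1/3·2^p` on non-members) — immediate from the definition of
`AWPP` (Fenner 2003). [cite: Fenner2003, Thm. 1.2 (definition of AWPP)] -/
theorem BPP_subset_AWPP : BPP ⊆ AWPP := by
  rintro L ⟨L', hL', p, hp⟩
  refine mem_AWPP_iff.2 ⟨fun x => (countWitnesses L' (p.eval x.length) x : ℤ),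
    SharpP_subset_GapP_holds ⟨L', hL', p, fun x => rfl⟩, p, fun x => ?_⟩
  dsimp only
  have hle : countWitnesses L' (p.eval x.length) x ≤ 2 ^ p.eval x.length := by
    rw [PPSharpP.countWitnesses_eq_cnt]; exact cnt_le _ _
  have hpx := hp x
  rw [uniformProb_eq_cnt_div, le_div_iff₀ (by positivity)] at hpx
  have hpos : (0 : ℝ) < 2 ^ p.eval x.length := by positivity
  constructor
  · intro hx
    have hE : cnt (p.eval x.length) {y : List Bool | boolPair x y ∈ L' ↔ x ∈ L} = countWitnesses L' (p.eval x.length) x := by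
      rw [PPSharpP.countWitnesses_eq_cnt]; exact cnt_congr fun y _ => by simp [hx]
    rw [hE] at hpx
    refine ⟨?_, by exact_mod_cast hle⟩
    have h1 : (2 : ℝ) * 2 ^ p.eval x.length ≤ 3 * countWitnesses L' (p.eval x.length) x := by linarith
    exact_mod_cast h1
  · intro hx
    have hE : cnt (p.eval x.length) {y : List Bool | boolPair x y ∈ L' ↔ x ∈ L} =
        2 ^ p.eval x.length - countWitnesses L' (p.eval x.length) x := by
      have hc := cnt_add_cnt_compl (p.eval x.length) {y : List Bool | boolPair x y ∈ L'}
      have : cnt (p.eval x.length) {y : List Bool | boolPair x y ∈ L' ↔ x ∈ L} = cnt (p.eval x.length) {y : List Bool | boolPair x y ∈ L'}ᶜ :=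
        cnt_congr fun y _ => by simp [hx]
      rw [this, PPSharpP.countWitnesses_eq_cnt]; omega
    rw [hE, Nat.cast_sub hle] at hpx
    refine ⟨by positivity, ?_⟩
    push_cast at hpx
    have h1 : (3 : ℝ) * countWitnesses L' (p.eval x.length) x ≤ 2 ^ p.eval x.length := by linarith
    exact_mod_cast h1

/-- `PP^A ⊆ PP` for `A ∈ BPP` (`AWPP` is low for `PP`, proved in the tree).
[cite: ChenEtAl2022, §5.3 (proof of Thm. 6)] -/
theorem PPRel_subset_PP_of_mem_BPP {A : Language Bool} (hA : A ∈ BPP) : PPRel (Oracle.ofLanguage A) ⊆ PP :=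
  AWPPLow.AWPP_low_PP A (BPP_subset_AWPP hA)

/-- `i ↦ i + g(i)` is strictly increasing and dominates the identity. [folklore] -/
theorem strictMono_eval_X_add (g : Polynomial ℕ) : StrictMono (fun i => (X + g).eval i) ∧ ∀ i, i ≤ (X + g).eval i := by
  refine ⟨fun i j hij => ?_, fun i => by simp⟩
  simp only [eval_add, eval_X]
  have := TM2Iter.eval_mono g hij.le
  omega

/-- Monotonicity of `RandAlg.pr` in the event (cf. the dot-notation version in
`Cryptography/SIS.lean`, not imported here). [folklore] -/
theorem randAlg_pr_mono {α β : Type} (R : RandAlg α β) (ea : α → List Bool) (x : α) {E E' : Set β} (h : E ⊆ E') :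
    R.pr ea x E ≤ R.pr ea x E' := by
  rw [RandAlg.pr_eq_uniformProb, RandAlg.pr_eq_uniformProb]
  exact BPExp.uniformProb_mono_len fun y hy _ => h hy

/-! ### The discharge -/

/-- **Thm. 1.2 of [ChenEtAl2022] for `(𝒞, 𝒟) = (BPP, PP)`** (Thm. 6 of §5.3): if `PP ⊄ BPP` then every
paddable `PP`-complete language is `BPP`-constructively separated from `BPP`.
[cite: ChenEtAl2022, Thm. 1.2 (proof: §5.3 Thm. 6, §5.1 Lemma 6)] -/
theorem constructiveSeparation_of_not_subset_BPP_PP_holds : constructiveSeparation_of_not_subset_BPP_PP := by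
  intro hPP L hL hpadL A hA
  classical
  -- (1) data
  obtain ⟨hLPP, hhard⟩ := hL
  obtain ⟨L', hL'P, p, hmaj⟩ := hLPP
  obtain ⟨pad, hpadFP, hpad⟩ := hpadL
  obtain ⟨hT, hT_FP, hTred⟩ := hhard _ (TLang_Vpre_mem_PP (p := p) hL'P)
  obtain ⟨sT, hsT⟩ := exists_poly_length_le_of_mem_FP hT_FP
  set PT : Polynomial ℕ := X + sT.comp (2 * X + 3 * p + 8) with hPT
  obtain ⟨hPTmono, hPTge⟩ := strictMono_eval_X_add (sT.comp (2 * X + 3 * p + 8))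
  have hQLPP : QL p PT pad hT L' A ∈ PP :=
    PPRel_subset_PP_of_mem_BPP hA (NPRel_subset_PPRel _ (QL_mem_NPRel hpadFP hT_FP hL'P A))
  obtain ⟨hQ, hQ_FP, hQred⟩ := hhard _ hQLPP
  obtain ⟨sQ, hsQ⟩ := exists_poly_length_le_of_mem_FP hQ_FP
  set PQ : Polynomial ℕ := X + sQ.comp (3 * X + 4 * p + 9) with hPQ
  obtain ⟨hPQmono, hPQge⟩ := strictMono_eval_X_add (sQ.comp (3 * X + 4 * p + 9))
  set qR : Polynomial ℕ := 2 * (X + p + 3 * (p + 2)) + 2 with hqR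
  -- (2) the level hypotheses at `z = 1ᴺ`, `N ≥ PT(0)`
  have hfitT : ∀ N : ℕ, PT.eval 0 ≤ N → ∀ x t s : List Bool, x.length = lev PT N → t.length ≤ p.eval (lev PT N) + 1 →
      s.length = p.eval (lev PT N) + 2 → (hT (boolPair x (boolPair t s))).length ≤ N := by
    intro N hN x t s hx ht hs
    refine (hsT _).trans ?_
    have h1 : (boolPair x (boolPair t s)).length ≤ 2 * lev PT N + 3 * p.eval (lev PT N) + 8 := by
      rw [length_boolPair, length_boolPair]; omega
    have h2 := TM2Iter.eval_mono sT h1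
    have h3 : PT.eval (lev PT N) ≤ N := eval_pinv_le PT hN
    have h4 : PT.eval (lev PT N) = lev PT N + sT.eval (2 * lev PT N + 3 * p.eval (lev PT N) + 8) := by simp [hPT]
    omega
  have hdepth : ∀ N : ℕ, depth p PT N ≤ N + p.eval N + 3 * (p.eval N + 2) := by
    intro N
    have h1 := lev_le (PT := PT) N
    have h2 := TM2Iter.eval_mono p h1
    simp only [depth]; omega
  have hqR : ∀ N : ℕ, 2 * depth p PT N + 2 ≤ qR.eval N := by
    intro N; have := hdepth N; simp [hqR]; omega
  have hfitQ : ∀ N : ℕ, ∀ y : List Bool, y.length ≤ depth p PT N + 1 → (hQ (boolPair (ones N) y)).length ≤ PQ.eval N := by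
    intro N y hy
    refine (hsQ _).trans ?_
    have hl : (boolPair (ones N) y).length = 2 * N + 2 + y.length := by rw [length_boolPair, List.length_replicate]
    have h2 := TM2Iter.eval_mono sQ (show 2 * N + 2 + y.length ≤ 3 * N + 4 * p.eval N + 9 by have := hdepth N; omega)
    have h3 : PQ.eval N = N + sQ.eval (3 * N + 4 * p.eval N + 9) := by simp [hPQ]
    rw [hl, h3]; omega
  have hQred' : ∀ N : ℕ, ∀ y : List Bool, y.length ≤ depth p PT N + 1 →
      (qq PQ pad hQ (ones N) y ∈ L ↔ boolPair (ones N) y ∈ QL p PT pad hT L' A) := by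
    intro N y hy
    rw [qq, List.length_replicate, (hpad _ _ (hfitQ N y hy)).2]
    exact (hQred _).symm
  -- (3) infinitely many levels have a bad node
  set Good : ℕ → Prop := fun N => boolPair (ones N) [] ∉ QL p PT pad hT L' A with hGood
  have exists_bad_level : ∀ N₁ : ℕ, ∃ N, N₁ ≤ N ∧ ¬ Good N := by
    by_contra hcon
    push Not at hcon
    obtain ⟨N₁, hN₁⟩ := hcon
    have hLBPP : L ∈ BPP := by
      refine mem_BPP_of_eqOn_le (Ldec_mem_BPP (p := p) (PT := PT) hpadFP hT_FP hA) N₁ fun x hx => ?_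
      exact (mem_Ldec_iff (pad := pad) (hT := hT) hPTmono hPTge hmaj x (hN₁ _ (hx.trans (hPTge _)))).symm
    exact hPP fun K hK => mem_BPP_of_karpReducible (hhard K hK) hLBPP
  -- (4) at a bad level some slot is a counterexample of the right length
  set val : ℕ → ℕ → List Bool := fun i N =>
    slotG p PT PQ pad hT hQ L' i (boolPair (ones N) (adBits (coreQ p PT PQ pad hQ) A (ones N) (qR.eval N))) with hval
  set Bad : ℕ → ℕ → Prop := fun i N =>
    ¬ (val i N ∈ A ↔ val i N ∈ L) ∧ (val i N).length = (if i < 3 then N else PQ.eval N) with hBad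
  have slot : ∀ N : ℕ, PT.eval 0 ≤ N → ¬ Good N → ∃ i < 6, Bad i N := by
    intro N hN hbad
    have h := exists_slot_disagree (p := p) (PT := PT) (PQ := PQ) (pad := pad) (hT := hT) (hQ := hQ) (L := L) (L' := L')
      (A := A) (z := ones N) hpad hTred (by simpa only [List.length_replicate] using hfitT N hN)
      (by simpa only [List.length_replicate] using hQred' N) (by simpa only [List.length_replicate] using hfitQ N)
      (R := qR.eval N) (by simpa only [List.length_replicate] using hqR N) (not_not.1 hbad)
    simpa only [List.length_replicate] using h
  -- (5) pigeonhole over the six slots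
  have hS : Set.Infinite {N : ℕ | PT.eval 0 ≤ N ∧ ¬ Good N} := by
    refine Nat.frequently_atTop_iff_infinite.1 (Filter.frequently_atTop.2 fun N₁ => ?_)
    obtain ⟨N, hN, hb⟩ := exists_bad_level (max N₁ (PT.eval 0))
    exact ⟨N, le_trans (le_max_left _ _) hN, le_trans (le_max_right _ _) hN, hb⟩
  have hcover : {N : ℕ | PT.eval 0 ≤ N ∧ ¬ Good N} ⊆ ⋃ i : Fin 6, {N | Bad i N} := by
    rintro N ⟨hN, hb⟩
    obtain ⟨i, hi, hBi⟩ := slot N hN hb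
    exact Set.mem_iUnion.2 ⟨⟨i, hi⟩, hBi⟩
  obtain ⟨i, hinf⟩ : ∃ i : Fin 6, Set.Infinite {N | Bad i N} := by
    by_contra hfin
    push Not at hfin
    exact (hS.mono hcover) (Set.finite_iUnion fun i => hfin i)
  -- (6) the refuter for the slot `i`
  by_cases hi3 : (i : ℕ) < 3
  · -- a threshold slot: run the core on `1ᴺ`
    obtain ⟨R, hRpoly, hRcoins, hpr⟩ := AdBPPSim.exists_randAlg_adFn_unary hA (coreQ_mem_FP (p := p) (PT := PT) (PQ := PQ) hpadFP hQ_FP)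
      (slotG_mem_FP (p := p) (PT := PT) (PQ := PQ) hpadFP hT_FP hQ_FP hL'P i) qR
    refine ⟨R, hRpoly, hRcoins, Nat.frequently_atTop_iff_infinite.2 (hinf.mono fun N hN => ?_)⟩
    obtain ⟨hne, hlen⟩ := hN
    refine le_trans (le_trans (by norm_num : (2 : ℝ) / 3 ≤ 3 / 4) (hpr N)) (randAlg_pr_mono R _ _ fun v hv => ?_)
    rw [Set.mem_singleton_iff] at hv
    subst hv
    have hv : adFn (coreQ p PT PQ pad hQ) qR (slotG p PT PQ pad hT hQ L' ↑i) A (unaryEncodeNat N) = val i N := by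
      simp only [adFn_apply, unaryEncodeNat_eq_replicate, List.length_replicate, hval, ones]
    rw [hv]
    exact ⟨by rw [hlen, if_pos hi3], by tauto⟩
  · -- a search slot: invert `PQ` first
    set pre : List Bool → List Bool := fanoutFn (invF PQ ∘ fstF) sndF with hpre
    have hpreFP : pre ∈ FP := fanoutFn_mem_FP (comp_mem_FP invF_mem_FP fstF_mem_FP) sndF_mem_FP
    have hpre_apply : ∀ x' b : List Bool, pre (boolPair x' b) = boolPair (ones (lev PQ x'.length)) b := by
      intro x' b; simp [hpre, invF_apply, lev]
    obtain ⟨R, hRpoly, hRcoins, hpr⟩ := AdBPPSim.exists_randAlg_adFn_unary hA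
      (comp_mem_FP (coreQ_mem_FP (p := p) (PT := PT) (PQ := PQ) hpadFP hQ_FP) hpreFP)
      (comp_mem_FP (slotG_mem_FP (p := p) (PT := PT) (PQ := PQ) hpadFP hT_FP hQ_FP hL'P i) hpreFP) qR
    refine ⟨R, hRpoly, hRcoins, Nat.frequently_atTop_iff_infinite.2 ?_⟩
    have himage : Set.Infinite ((fun N => PQ.eval N) '' {N | Bad i N}) := hinf.image hPQmono.injective.injOn
    refine himage.mono ?_
    rintro _ ⟨N, ⟨hne, hlen⟩, rfl⟩
    refine le_trans (le_trans (by norm_num : (2 : ℝ) / 3 ≤ 3 / 4) (hpr (PQ.eval N))) (randAlg_pr_mono R _ _ fun v hv => ?_)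
    rw [Set.mem_singleton_iff] at hv
    subst hv
    -- the value of the inverted refuter is the canonical slot value at `N`
    have hlevQ : lev PQ (PQ.eval N) = N := pinv_eval PQ hPQmono hPQge N
    have hbits : ∀ k, adBits (coreQ p PT PQ pad hQ ∘ pre) A (unaryEncodeNat (PQ.eval N)) k =
        adBits (coreQ p PT PQ pad hQ) A (List.replicate N true) k := by
      intro k
      have hk := adBits_precomp (A := A) (x' := unaryEncodeNat (PQ.eval N)) (Qg := coreQ p PT PQ pad hQ)
        (Qg' := coreQ p PT PQ pad hQ ∘ pre) (f := fun x' => ones (lev PQ x'.length))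
        (fun b => by rw [Function.comp_apply, hpre_apply]) k
      simpa only [unaryEncodeNat_eq_replicate, List.length_replicate, hlevQ, ones] using hk
    have hR1 : 2 * depth p PT N + 2 ≤ qR.eval (PQ.eval N) := (hqR N).trans (TM2Iter.eval_mono qR (hPQge N))
    have hv : adFn (coreQ p PT PQ pad hQ ∘ pre) qR (slotG p PT PQ pad hT hQ L' ↑i ∘ pre) A (unaryEncodeNat (PQ.eval N)) = val i N := by
      rw [adFn_apply, Function.comp_apply, hpre_apply, hbits]
      simp only [unaryEncodeNat_eq_replicate, List.length_replicate, hlevQ, hval, ones]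
      refine slotG_eq_of_take_eq (↑i) (List.replicate N true) ?_ ?_ ?_
      · rw [List.length_replicate, adBits_take A _ hR1, adBits_take A _ (hqR N)]
      · rw [length_adBits, List.length_replicate]; exact hR1
      · rw [length_adBits, List.length_replicate]; exact hqR N
    rw [hv]
    exact ⟨by rw [hlen, if_neg hi3], by tauto⟩

end Literature.Computability.MetaComplexity

end
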